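import Mathlib
import Summits.ValiantsHypothesis.ValiantsHypothesis.Theses.DivisionGap
import Summits.ValiantsHypothesis.ValiantsHypothesis.Theorems.ZeroOneTransfer.Negative.TopComponentFree
import Summits.ValiantsHypothesis.ValiantsHypothesis.Theorems.PerDivisionHard.Negative.LoadBearing
import Summits.ValiantsHypothesis.ValiantsHypothesis.Theorems.PerDivisionHard.Negative.VarsCounting
import Summits.ValiantsHypothesis.ValiantsHypothesis.Theorems.PerDivisionHard.Negative.BooleanShadow
import Summits.ValiantsHypothesis.ValiantsHypothesis.Theorems.PerDivisionHard.Negative.PlainBridge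
import Summits.ValiantsHypothesis.ValiantsHypothesis.Theorems.PerDivisionHard.Negative.PerSupportBound
import Literature.Computability.AlgebraicComplexity.ArithCircuitProofs
import Literature.Computability.AlgebraicComplexity.PermanentIrreducible
import Literature.Computability.AlgebraicComplexity.RealTauConjectureDepthFour
import Literature.Computability.AlgebraicComplexity.CircuitDepthProofs
import Summits.ValiantsHypothesis.ValiantsHypothesis.Theorems.DivisionGapPerDivisionHardStubJssContraction
import Summits.ValiantsHypothesis.ValiantsHypothesis.Theorems.DivisionGapDefs
import Summits.ValiantsHypothesis.ValiantsHypothesis.Theorems.DivisionGapPerDivisionHardStubTorus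
import Summits.ValiantsHypothesis.ValiantsHypothesis.Theorems.DivisionGapPerDivisionHardStubTorusSupport
import Summits.ValiantsHypothesis.ValiantsHypothesis.Theorems.DivisionGapPerDivisionHardStubFaceDescent
import Summits.ValiantsHypothesis.ValiantsHypothesis.Theorems.DivisionGapPerDivisionHardStubBlockArsenal
import Summits.ValiantsHypothesis.ValiantsHypothesis.Theorems.DivisionGapPerDivisionHardStubSparseRigid
import Summits.ValiantsHypothesis.ValiantsHypothesis.Theorems.DivisionGapPerDivisionHardStubGenericCut
import Summits.ValiantsHypothesis.ValiantsHypothesis.Theorems.DivisionGapPerDivisionHardStubQPotential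
import Summits.ValiantsHypothesis.ValiantsHypothesis.Theorems.DivisionGapPerDivisionHardStubBlockFits
import Summits.ValiantsHypothesis.ValiantsHypothesis.Theorems.DivisionGapPerDivisionHardStubEdgeExtraction
import Summits.ValiantsHypothesis.ValiantsHypothesis.Theorems.DivisionGapPerDivisionHardStubTwoSidedCount
import Summits.ValiantsHypothesis.ValiantsHypothesis.Theorems.DivisionGapPerDivisionHardStubLiveStructure
import Summits.ValiantsHypothesis.ValiantsHypothesis.Theorems.DivisionGapPerDivisionHardStubSubexpRigid
import Summits.ValiantsHypothesis.ValiantsHypothesis.Theorems.DivisionGapPerDivisionHardStubAtomicTop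
import Summits.ValiantsHypothesis.ValiantsHypothesis.Theorems.DivisionGapPerDivisionHardStubAtomicTorus
import Summits.ValiantsHypothesis.ValiantsHypothesis.Theorems.DivisionGapPerDivisionHardStubAtomicRigid
import Summits.ValiantsHypothesis.ValiantsHypothesis.Theorems.DivisionGapPerDivisionHardStubPairMono
import Summits.ValiantsHypothesis.ValiantsHypothesis.Theorems.DivisionGapPerDivisionHardStubPairPlacement
import Summits.ValiantsHypothesis.ValiantsHypothesis.Theorems.DivisionGapPerDivisionHardStubPairFlip
import Summits.ValiantsHypothesis.ValiantsHypothesis.Theorems.DivisionGapPerDivisionHardSparse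
import Summits.ValiantsHypothesis.ValiantsHypothesis.Theorems.DivisionGapPerDivisionHardSubexpSparse
import Summits.ValiantsHypothesis.ValiantsHypothesis.Theorems.DivisionGapPerDivisionHardStubBlockSubstFacePer
import Summits.ValiantsHypothesis.ValiantsHypothesis.Theorems.DivisionGapPerDivisionHardStubDescent
import Summits.ValiantsHypothesis.ValiantsHypothesis.Theorems.DivisionGapPerDivisionHardStubFibreArith
import Summits.ValiantsHypothesis.ValiantsHypothesis.Theorems.DivisionGapPerDivisionHardStubDecidedAtoms
import Summits.ValiantsHypothesis.ValiantsHypothesis.Theorems.DivisionGapPerDivisionHardStubSigmaPiSigmaPiCount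
import Summits.ValiantsHypothesis.ValiantsHypothesis.Theorems.PerDivisionHard.Negative.PerMulRichFibre
import Summits.ValiantsHypothesis.ValiantsHypothesis.Theorems.DivisionGapPerDivisionHardSparseGraph
import Summits.ValiantsHypothesis.ValiantsHypothesis.Theorems.PerDivisionHard.Negative.PerLowDegreeRung
import Summits.ValiantsHypothesis.ValiantsHypothesis.Theorems.DivisionGapPerDivisionHardStubDescentAt
import Summits.ValiantsHypothesis.ValiantsHypothesis.Theorems.DivisionGapPerDivisionHardStubPureCount
import Summits.ValiantsHypothesis.ValiantsHypothesis.Theorems.DivisionGapPerDivisionHardStubPurePair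
import Summits.ValiantsHypothesis.ValiantsHypothesis.Theorems.DivisionGapPerDivisionHardStubInsideUniversal
import Summits.ValiantsHypothesis.ValiantsHypothesis.Theorems.DivisionGapPerDivisionHardStubFibreTorus
import Summits.ValiantsHypothesis.ValiantsHypothesis.Theorems.DivisionGapPerDivisionHardStubFibreBackground
import Summits.ValiantsHypothesis.ValiantsHypothesis.Theorems.PerDivisionHard.Negative.TranslateCheap
import Summits.ValiantsHypothesis.ValiantsHypothesis.Theorems.DivisionGapPerDivisionHardStubErasedDescent
import Summits.ValiantsHypothesis.ValiantsHypothesis.Theorems.DivisionGapPerDivisionHardStubErasedArsenal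
import Summits.ValiantsHypothesis.ValiantsHypothesis.Theorems.DivisionGapPerDivisionHardStubFormulaTorus
import Summits.ValiantsHypothesis.ValiantsHypothesis.Theorems.DivisionGapPerDivisionHardStubRectKill
import Summits.ValiantsHypothesis.ValiantsHypothesis.Theorems.DivisionGapPerDivisionHardStubPathRigidity
import Summits.ValiantsHypothesis.ValiantsHypothesis.Theorems.DivisionGapPerDivisionHardStubWalkStepMargins
import Summits.ValiantsHypothesis.ValiantsHypothesis.Theorems.DivisionGapPerDivisionHardStubWalkBookkeepingTwin
import Summits.ValiantsHypothesis.ValiantsHypothesis.Theorems.DivisionGapPerDivisionHardStubLureCutsOut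
import Summits.ValiantsHypothesis.ValiantsHypothesis.Theorems.DivisionGapPerDivisionHardWalkDefs
import Summits.ValiantsHypothesis.ValiantsHypothesis.Theorems.DivisionGapPerDivisionHardStubClosedWalkSumTorus
import Summits.ValiantsHypothesis.ValiantsHypothesis.Theorems.DivisionGapPerDivisionHardStubWalkTwin
import Summits.ValiantsHypothesis.ValiantsHypothesis.Theorems.DivisionGapPerDivisionHardStubPricedCut
import Summits.ValiantsHypothesis.ValiantsHypothesis.Theorems.DivisionGapPerDivisionHardStubMagnetRigidAux
import Summits.ValiantsHypothesis.ValiantsHypothesis.Theorems.DivisionGapPerDivisionHardStubMagnetRigidKey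
import Summits.ValiantsHypothesis.ValiantsHypothesis.Theorems.DivisionGapPerDivisionHardStubMagnetRigid
import Summits.ValiantsHypothesis.ValiantsHypothesis.Theorems.DivisionGapPerDivisionHardStubAltRowEquiv
import Summits.ValiantsHypothesis.ValiantsHypothesis.Theorems.DivisionGapPerDivisionHardStubAltFlow
import Summits.ValiantsHypothesis.ValiantsHypothesis.Theorems.DivisionGapPerDivisionHardStubTorusSplit
import Summits.ValiantsHypothesis.ValiantsHypothesis.Theorems.DivisionGapPerDivisionHardStubColContentRigid
import Summits.ValiantsHypothesis.ValiantsHypothesis.Theorems.DivisionGapPerDivisionHardStubColContentSubexpRigid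
import Summits.ValiantsHypothesis.ValiantsHypothesis.Theorems.DivisionGapPerDivisionHardStubMatrixSplit
import Summits.ValiantsHypothesis.ValiantsHypothesis.Theorems.DivisionGapPerDivisionHardStubTransposePair
import Summits.ValiantsHypothesis.ValiantsHypothesis.Theorems.DivisionGapPerDivisionHardStubGreedyRows
import Summits.ValiantsHypothesis.ValiantsHypothesis.Theorems.DivisionGapPerDivisionHardStubSplitFlow
import Summits.ValiantsHypothesis.ValiantsHypothesis.Theorems.DivisionGapPerDivisionHardStubCellContentRigid
import Summits.ValiantsHypothesis.ValiantsHypothesis.Theorems.DivisionGapPerDivisionHardStubHeavyLines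
import Summits.ValiantsHypothesis.ValiantsHypothesis.Theorems.DivisionGapPerDivisionHardDescentTransfer
import Summits.ValiantsHypothesis.ValiantsHypothesis.Theorems.DivisionGapPerDivisionHardPureRich
import Summits.ValiantsHypothesis.ValiantsHypothesis.Theorems.DivisionGapPerDivisionHardMagnetSingleGPart
import Summits.ValiantsHypothesis.ValiantsHypothesis.Theorems.DivisionGapPerDivisionHardStubGreedyRooks
import Summits.ValiantsHypothesis.ValiantsHypothesis.Theorems.DivisionGapPerDivisionHardStubMidRigid
import Summits.ValiantsHypothesis.ValiantsHypothesis.Theorems.DivisionGapPerDivisionHardStubRookRigid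
import Summits.ValiantsHypothesis.ValiantsHypothesis.Theorems.DivisionGapPerDivisionHardStubTopTransfer
import Summits.ValiantsHypothesis.ValiantsHypothesis.Theorems.DivisionGapPerDivisionHardStubUniqueTopSum
import Summits.ValiantsHypothesis.ValiantsHypothesis.Theorems.DivisionGapPerDivisionHardStubLinearUniqueTop
import Summits.ValiantsHypothesis.ValiantsHypothesis.Theorems.DivisionGapPerDivisionHardStubLocalUniqueTop
import Summits.ValiantsHypothesis.ValiantsHypothesis.Theorems.DivisionGapPerDivisionHardStubKeyPlacement
import Summits.ValiantsHypothesis.ValiantsHypothesis.Theorems.DivisionGapPerDivisionHardStubKeyOfSpan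
import Summits.ValiantsHypothesis.ValiantsHypothesis.Theorems.DivisionGapPerDivisionHardStubFarRigid
import Summits.ValiantsHypothesis.ValiantsHypothesis.Theorems.DivisionGapPerDivisionHardStubKeyRigid
import Summits.ValiantsHypothesis.ValiantsHypothesis.Theorems.DivisionGapPerDivisionHardStubOrderedCut
import Summits.ValiantsHypothesis.ValiantsHypothesis.Theorems.DivisionGapPerDivisionHardStubIsolationRigid
import Summits.ValiantsHypothesis.ValiantsHypothesis.Theorems.DivisionGapPerDivisionHardStubExposedRigid
import Summits.ValiantsHypothesis.ValiantsHypothesis.Theorems.DivisionGapPerDivisionHardStubExposedOfIsolated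

/-!
# Line `pair-descent-jss-endpoint` — checked skeleton for crux `PerDivisionHard` — v15.5

(item `stmt-ValiantsHypothesis-5065`, route `DivisionGap`, H1)

Crux (FIXED, concluded BY NAME below):
`PerDivisionHard := ∀ c, ∃ n₀, ∀ n ≥ n₀, ∀ h : ℝ≥0[x_ij] (n × n), h ≠ 0 →
  2 ^ ((Nat.log 2 n + c) ^ c) < L(per_n · h) + L(h)`, `L = complexity` over the semiring `ℝ≥0`.

## The line (idea card `Ideas/pair-descent-jss-endpoint.md`; TRIAGE-r1-{1,2,3}: pass)
Degenerate the PAIR `(per·h, h)` along the normal fan of the Birkhoff polytope (initial forms are free for monotone circuits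
over `ℝ≥0` and multiplicative: tree theorems `complexity_topComponent_le`, `topComponent_mul`).  1. `stub_torus`: WLOG `h`
torus-homogeneous.  2. K2 (`stub_noCheapOmnipresence` / the registered pair forms A–D below, THE OPEN CORE): a cheap `h`
admits a PLACEMENT of the block arsenal `G(b,k) ⊕ M₀` (subdivided `K_{b,b}` + padding matching) and a weight cutting out that
face of `B_n` whose top fibre has a SINGLE `G`-part.  3. `stub_faceDescent`: then `L(x^u · per_G) ≤ L(per·h) + 1`.
4. `stub_jssContraction` (JSS): `L(f) ≤ ((n+2)(L(x^u f)+2))^κ`.  5. `stub_blockArsenal`: `per_b` is a projection of `per_G`,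
so (Jerrum–Snir by support) the placed face beats the budget once `b ≥ (log₂ n+d)^d`.  Composition `PerDivisionHard_of`
(`_routeB`, `_routeD`): sorry-free pure logic over the stubs.  Disproof.lean obligations honoured (cdisprove v2): `h ≠ 0` used
at steps 1 and 3; no-cancellation (char 2 false) used by `topComponent_mul` / JSS; every asymptotic stub has its own `n₀(c,·)`;
bounds are `2^{b/3}` with `b` polylog (inside the tightness window); the Boolean shadow is never used.

## Version history (compressed — 200 kB cap; full text in the git history of this file and the dossiers v1–v9)
v2–v5 (c0, c1): vocabulary `Theorems/DivisionGapDefs.lean`; sparse branch; generic cut; union-bound reshape (route A).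
v6–v10 (c2–c6): rungs Sparse/SparseProduct/SparseGraph/PerPowers/SubexpSparse/Atomic/AtomicFree/PairBinomial/SparseFibre/
SigmaPiSigmaPi/DescentTransfer/PureRich/RowsAvoided/SmallEdgeSum/OddFree; gate-local form (route B); descent across scales.
v11 (c7): ERASURE (route D, DEFICIENCY rung); formula target.  v12 (c8): ONE-SCALE-CUT BARRIER (`h_walk`) and STEERING
(magnets, lures, priced cut).  v13 (c9): the COLUMN-CONTENT rung — rank across one balanced row cut; all stubs landed
(p154909 p155050 p155024 p155460 p157212 p157155 p157259), rung files `Theorems/DivisionGapPerDivisionHardColContent{,Ext}.lean`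
(p156844, p157525), dossier v9.  **v14 (c9, cycle 3): the CELL-CONTENT rung — rank across an ARBITRARY balanced partition of
the variables (`### v14` at the end): provable stubs `stub_heavyLines`, `stub_greedyRows`, `stub_splitFlow` (workers),
`stub_cellContentRigid` (lead); compositions `perDivisionHard_cellContentCol_of`, `perDivisionHard_cellContent_of`.  v14.1: ALL v14 stubs LANDED (p158863 p158261 p158180 p158588;
by stub-add: torusCellSplit p158462, matrixCellSplit p158385); sorries = the five open research forms again.**
**v15 (c10, 2026-08-17): RIGID CELLS (`### v15` at the end) — the ROOK-CONSTANT rung (`stub_greedyRooks`, `stub_midRigid`,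
`stub_rookRigid`; compositions `perDivisionHard_rookConstant_of`, `…cellsConstant_of`, `…cellsAvoided_of`) and the LEX-TOP
transfer (`stub_topTransfer`, `stub_uniqueTopSum`, `stub_linearUniqueTop`, `stub_localUniqueTop`; compositions
`perDivisionHard_topSparse_of`, `…uniqueTopSum_of`, `…sigmaPiSigma_of`, `…localSigmaPi_of`); v13/v14 compositions compressed
to pointers (all landed).  v15.1 (cycle 2): ALL seven v15 stubs LANDED (p163534 p163551 p164436 p163556 p163842 p163715 p163746;
rung files `Theorems/DivisionGapPerDivisionHardLexTop.lean`, `…RookConstant.lean`); new: the KEY rung (`stub_keyPlacement`,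
`stub_keyRigid`, `stub_keyOfSpan`; `perDivisionHard_key_of`, `…fewGenerators_of`) and the CODE rung (`stub_farRigid`;
`perDivisionHard_minDistance_of`).  v15.2 (cycle 3): keyPlacement p165503, keyOfSpan p165196, farRigid p165323 LANDED, keyRigid p166107;
ISOLATION (`stub_orderedCut`, `stub_isolationRigid`; `perDivisionHard_isolation_of`, `…isolationTop_of`).  v15.3 (cycle 4): keyRigid p166107,
orderedCut p167041, isolationRigid p167240 LANDED; rung file `…Keys.lean` p167134; EXPOSED POINTS (`stub_exposedRigid`, `stub_exposedOfIsolated`;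
`perDivisionHard_exposed_of`).  v15.4: exposedRigid p167785, exposedOfIsolated p167735 LANDED — EVERY stub of the chapter RIGID CELLS is landed;
rung files `…Isolation.lean` p168179, `…Exposed.lean` p168346 (with the capstone `perDivisionHard_steerable`: SOME placement + SOME prices off
its face with a unique minimiser ⇒ crux — the open h-alone statement of the line is "every cheap one-degree support is steerable") ACCEPTED;
v15.5: sorries = the five research forms; dossier v11 (`Lines/pair-descent-jss-endpoint-k2-dossier-v11.md`).**
Registered OPEN research forms (unchanged since v11, each crux-equivalent in pair form): A `stub_edgeEntropy`,
B `stub_noGateTie`, C `stub_noRichOmnipresence`, D `stub_confinedVariation`; `stub_formulaRigid` (K2F).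
-/

noncomputable section

set_option linter.dupNamespace false

namespace Summit.ValiantsHypothesis.ValiantsHypothesis.Cruxes.PerDivisionHard.PairDescentJssEndpoint

open MvPolynomial Literature.Computability.AlgebraicComplexity
open Summit.ValiantsHypothesis.ValiantsHypothesis.Theorems.ZeroOneTransfer.Negative
  (topComponent support_topComponent_subset topComponent_ne_zero)
open scoped NNReal BigOperators

/-! ### Vocabulary

Shared with the stub files through the landed module `Theorems/DivisionGapDefs.lean` (p87138):
`IsTorusHomogeneous`, `facePer`, `CutsOut`, `HasSingleGPart`, `BlockV`, `blockAdj`, `placedBlock`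
(verbatim the round-1 skeleton's local definitions; opened below by name so that the stub
signatures read exactly as registered). -/

open Summit.ValiantsHypothesis.ValiantsHypothesis.Theorems.DivisionGapPerDivisionHard
  (IsTorusHomogeneous facePer CutsOut HasSingleGPart BlockV blockAdj placedBlock blockSubst
    walkStep IsClosedNBWalk walkExponent closedWalkSum
    degree_eq_of_rowDegrees_eq exists_blockEquiv placedFlow_card_rows placedFlow_row_notPadding
    sum_diff_eq_zero diffRows diffCols diffCells Fittable IsEdgePair edgePairs edgeSigs edgeSum)

/-! ### Registered stubs -/

/-- **stub_torus (card step 0; provable now, size M).**  `per_n` is weighted-homogeneous of degree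
`1` for each of the `2n` row / column indicator weights, so `top_w(per · h) = per · top_w(h)`
(`topComponent_mul`, `topComponent_eq_self_of_isWeightedHomogeneous`); iterating `h ↦ top_w h`
over the `2n` weights keeps `h ≠ 0` (`topComponent_ne_zero`), selects sub-supports
(`support_topComponent_subset`, so earlier homogeneities survive), and never increases either
complexity (`complexity_topComponent_le`).  The end result is torus-homogeneous.  Signature
identical to the sibling line's `stub_torus` (one proof serves both). -/
theorem stub_torus :
    ∀ (n : ℕ) (h : MvPolynomial (Fin n × Fin n) ℝ≥0), h ≠ 0 →
      ∃ h' : MvPolynomial (Fin n × Fin n) ℝ≥0, h' ≠ 0 ∧ IsTorusHomogeneous h' ∧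
        complexity (perPoly (Fin n) ℝ≥0 * h') ≤ complexity (perPoly (Fin n) ℝ≥0 * h) ∧
        complexity h' ≤ complexity h :=
  -- LANDED (wave 1, p87655).
  Summit.ValiantsHypothesis.ValiantsHypothesis.Theorems.DivisionGapPerDivisionHard.stub_torus

/-- **stub_faceDescent (the lever `FaceDescent` of the card; provable now, size M).**  If `w` cuts
out `G` then `top_w(per_n) = facePer G` (`perPoly_eq_sum_monomial`; the weight of `x^{μ_σ}` is
`Σ_i w(σ i, i)`), hence `top_w(per_n · h) = facePer G · top_w h` (`topComponent_mul`) at complexity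
`≤ L(per_n · h)` (`complexity_topComponent_le`).  The projection `x_e ↦ 1` (`e ∉ G`), `x_e ↦ x_e`
(`e ∈ G`) fixes `facePer G` and maps `top_w h` to `a · x^u`, `a = Σ coeff ≠ 0` (single `G`-part,
`h ≠ 0`); projections are free (`IsProjection.complexity_le_holds`) and the rescaling by `a⁻¹`
costs one gate (`complexity_smul_le_holds`). -/
theorem stub_faceDescent :
    ∀ (n : ℕ) (G : Finset (Fin n × Fin n)) (w : Fin n × Fin n → ℕ)
      (h : MvPolynomial (Fin n × Fin n) ℝ≥0) (u : (Fin n × Fin n) →₀ ℕ),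
      CutsOut w G → h ≠ 0 → HasSingleGPart G w h u →
      complexity (monomial u (1 : ℝ≥0) * facePer G) ≤
        complexity (perPoly (Fin n) ℝ≥0 * h) + 1 :=
  -- LANDED (wave 1, p87774).
  Summit.ValiantsHypothesis.ValiantsHypothesis.Theorems.DivisionGapPerDivisionHard.stub_faceDescent

/-- **stub_jssContraction (the JSS endpoint, card K1'; literature vendoring, size L).**
Jukna–Seiwert–Sergeev: if `x^u · f` has a monotone fan-in-two circuit of size `s` over `ℝ≥0` in
`N = n²` variables, then `f` has one of size `O(N s²)`: carry the contraction `[g] = g / x^{gcd g}`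
gate by gate (sum gate: `gcd = min`, re-multiply the two operands by `2^s`-bounded monomials;
product gate: `gcd` adds, nothing to do — Jukna 2023 Claim 6.17), produce each bounded monomial by
repeated squaring (`O(N s)` gates, Claim 6.18), note `[x^u f] = [f]` and `f = x^{gcd f} · [f]`
(Jukna 2023 L.6.16, Rem 6.19 for the arithmetic semiring; JuknaSeiwertSergeev2022 Lemma 2).
Weighted sum gates: plainify first (`Negative/PlainBridge.exists_plain_of_computes`, factor ≤ 3).
RAW polynomial form (the constant and `N = n²` absorbed in `κ`); `f = 0` and constants are free. -/
theorem stub_jssContraction :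
    ∃ κ : ℕ, ∀ (n : ℕ) (f : MvPolynomial (Fin n × Fin n) ℝ≥0) (u : (Fin n × Fin n) →₀ ℕ),
      complexity f ≤ ((n + 2) * (complexity (monomial u (1 : ℝ≥0) * f) + 2)) ^ κ :=
  -- LANDED (wave 1, p86475 + parts A p84470 / B p84474): JSS contraction in the tree's model, κ = 4.
  Summit.ValiantsHypothesis.ValiantsHypothesis.Theorems.DivisionGapPerDivisionHard.stub_jssContraction

/-- **stub_blockArsenal (the unconditional arsenal of the card; provable now, size M).**
(i) Phase bijection: the perfect matchings of `G(b,k) ⊕ M₀` are in bijection with `S_b` (a core row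
`i` is matched into exactly one path `(i, j)`, which is then traversed in its "used" phase, all
other paths in their "unused" phase; padding is forced), so the projection
`x_{(i, (i,j,0))} ↦ X (i, j)` (for `k = 0`: `x_{(i,j)} ↦ X (i,j)`), every other variable `↦ 1`,
maps `facePer (placedBlock eR eC)` onto `perPoly (Fin b) ℝ≥0` (after `rename` along `eR/eC`);
projections are free (`IsProjection.complexity_le_holds`).  (ii) `2^{b/3} ≤ L(per_b)` for `b ≥ 6`
(`Negative.PerSupportBound.two_pow_le_complexity_of_support_eq_perPoly`, or Jerrum–Snir through
`Negative/PlainBridge.js_le_two_mul_complexity_perPoly`).  (iii) Arithmetic: with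
`B = (log₂ n + c)^c`, `((n+2)(2^B+3))^κ ≤ 2^{κ(B + log₂ n + 4)} < 2^{b/3}` as soon as
`b ≥ (log₂ n + d)^d`, `d = c + 3κ + 7`, `n ≥ 2`.  (`b ≤ n` is forced by the placements.) -/
theorem stub_blockArsenal :
    ∀ c κ : ℕ, ∃ d n₁ : ℕ, ∀ n ≥ n₁, ∀ (b k m : ℕ) (eR eC : BlockV b k m ≃ Fin n),
      (Nat.log 2 n + d) ^ d ≤ b →
      ((n + 2) * (2 ^ ((Nat.log 2 n + c) ^ c) + 3)) ^ κ <
        complexity (facePer (placedBlock eR eC)) :=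
  -- LANDED (wave 1, p87932 + Aux p83110).
  Summit.ValiantsHypothesis.ValiantsHypothesis.Theorems.DivisionGapPerDivisionHard.stub_blockArsenal

/-! ### v4 (lead seat c1, 2026-08-16): the generic cut, the face form of K2′, arithmetic rigidity
(Prose compressed in v11 — see the git history of this file and the k2 dossiers; the
registered signatures below are unchanged.) -/

/-- **stub_genericCut (v4; provable now, size S — a corollary of the landed generic weight of
`StubSparseRigidCount.lean`).**  On any placed block `G = placedBlock eR eC` with `k ≥ 1` and for
any `h` all of whose monomials have the same degree (e.g. torus-homogeneous `h`, or `h` supported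
on permutation monomials), the generic weight `w = genericWeight G (deg h + 1)` (`W` on `G`,
`W - B^{rank e}` off `G`) CUTS OUT `G` (`cutsOut_genericWeight`: the placed graph contains a
perfect matching, `exists_blockMatching` + `exists_perm_mem_placedBlock`) and its top fibre AGREES
OFF `G` (`eq_offG_of_mem_support_topComponent`: base-`B` digits). [folklore] -/
theorem stub_genericCut :
    ∀ (b k m n : ℕ) (eR eC : BlockV b k m ≃ Fin n) (h : MvPolynomial (Fin n × Fin n) ℝ≥0),
      0 < k → (∀ m₁ ∈ h.support, ∀ m₂ ∈ h.support, m₁.degree = m₂.degree) →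
      ∃ w : Fin n × Fin n → ℕ, CutsOut w (placedBlock eR eC) ∧
        ∀ m₁ ∈ (topComponent w h).support, ∀ m₂ ∈ (topComponent w h).support,
          ∀ e ∉ placedBlock eR eC, m₁ e = m₂ e :=
  -- LANDED (seat c1, p107596).
  Summit.ValiantsHypothesis.ValiantsHypothesis.Theorems.DivisionGapPerDivisionHard.stub_genericCut

/-! ### v5 vocabulary

`diffRows`, `diffCols`, `diffCells`, `Fittable`, `IsEdgePair`, `edgePairs`, `edgeSigs`, `edgeSum`
now live in the landed module `Theorems/DivisionGapDefs.lean` (p114207, seat c2) and are opened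
above by name, so the stub signatures below read exactly as registered. -/

/-! ### v5 stubs -/

/-- **stub_edgeExtraction (v5; provable now, size L).**  LANDED ?; statement and proof sketch in the landed file's docstring
(prose compressed in v11.1, 200 kB cap). [folklore] -/
theorem stub_edgeExtraction :
    ∀ (n : ℕ) (h : MvPolynomial (Fin n × Fin n) ℝ≥0) (w : Fin n × Fin n → ℕ)
      (m₁ m₂ : (Fin n × Fin n) →₀ ℕ),
      (∀ p₁ ∈ h.support, ∀ p₂ ∈ h.support, p₁.degree = p₂.degree) →
      m₁ ∈ (topComponent w h).support → m₂ ∈ (topComponent w h).support → m₁ ≠ m₂ →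
      ∃ (w' : Fin n × Fin n → ℕ) (p₁ p₂ : (Fin n × Fin n) →₀ ℕ),
        (topComponent w' h).support ⊆ (topComponent w h).support ∧
        p₁ ∈ (topComponent w' h).support ∧ p₂ ∈ (topComponent w' h).support ∧ p₁ ≠ p₂ ∧
        ∀ p ∈ (topComponent w' h).support, ∀ e, p₁ e = p₂ e → p e = p₁ e :=
  -- LANDED (seat c1, p108990).
  Summit.ValiantsHypothesis.ValiantsHypothesis.Theorems.DivisionGapPerDivisionHard.stub_edgeExtraction

/-- **stub_twoSidedCount (v5; provable now, size M).**  Two-sided placement by counting: if the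
sum over the bad index set of `C(n - |Tr p|, N - |Tr p|) · C(n - |Tc p|, N - |Tc p|)` (an upper
bound for the number of pairs `(R, C)` of `N`-sets with `Tr p ⊆ R`, `Tc p ⊆ C`) is less than
`C(n, N)²`, some pair of `N`-sets contains no bad pair of sets.  (`card_supersets_le` of
`StubSparseRigidCount.lean` on each side, `Finset.card_biUnion_le`, product of powersets.)
[folklore] -/
theorem stub_twoSidedCount :
    ∀ (n N : ℕ) (ι : Type) (P : Finset ι) (Tr Tc : ι → Finset (Fin n)),
      (∑ p ∈ P, (n - (Tr p).card).choose (N - (Tr p).card) *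
          (n - (Tc p).card).choose (N - (Tc p).card)) < n.choose N * n.choose N →
      ∃ R C : Finset (Fin n), R.card = N ∧ C.card = N ∧ ∀ p ∈ P, ¬ (Tr p ⊆ R ∧ Tc p ⊆ C) :=
  -- LANDED (seat c1, p109074).
  Summit.ValiantsHypothesis.ValiantsHypothesis.Theorems.DivisionGapPerDivisionHard.stub_twoSidedCount

/-- **stub_edgeEntropy (v5; OPEN — the Newton-edge entropy form of the core).**  For every
`c, d` and all large `n`, every nonzero torus-homogeneous `h` with `L(h) ≤ 2^B` and
`L(per_n · h) ≤ 2^B` admits block parameters `b ≥ (log₂ n + d)^d`, `k ≥ 1` for which the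
two-sided union-bound sum over the (row set, column set) signatures of the `(b,k)`-FITTABLE EDGE
PAIRS of `Newt(h)` differing in `≥ 4k + 2` rows is below the number `C(n, N)²` of placements of
the `N = b + b²k` block rows and block columns.  (Signatures, not pairs: parallel edges share one
bad event; only cell sets that lie inside SOME placement of `G(b,k) ⊕ M₀` can ever be bad — this
excludes e.g. the `n^{Θ(ρ)}` long two-column edges of the cheap rigid polynomial
`∏_ρ (e_ρ(even rows) + e_ρ(odd rows))`, which fit nowhere for `k ≥ 1`.) -/
theorem stub_edgeEntropy :
    ∀ c d : ℕ, ∃ n₀ : ℕ, ∀ n ≥ n₀, ∀ h : MvPolynomial (Fin n × Fin n) ℝ≥0,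
      h ≠ 0 → IsTorusHomogeneous h → complexity h ≤ 2 ^ ((Nat.log 2 n + c) ^ c) →
      complexity (perPoly (Fin n) ℝ≥0 * h) ≤ 2 ^ ((Nat.log 2 n + c) ^ c) →
      ∃ b k : ℕ, (Nat.log 2 n + d) ^ d ≤ b ∧ 0 < k ∧
        edgeSum h (4 * k + 2) b k (b + b * (b * k)) <
          n.choose (b + b * (b * k)) * n.choose (b + b * (b * k)) := by
  sorry

/-- **The h-ALONE entropy form (v6; documented sufficient condition, NOT registered — the
disprover's falsifiable target T1 of dossier v3 §6).  REFUTED (seat c8, `NegativeNotes-genericCut-walkTwins.md`):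
the walk-sum cofactor `h_walk` carries a fittable edge pair differing in `≥ 4k+2` rows inside EVERY placement, so
`edgeSum h_walk (4k+2) b k N ≥ C(n,N)²` for all `b ≥ 4`, `k ≥ 1`; kept as documentation of a dead form.**  `stub_edgeEntropy` without the pair
hypothesis `L(per_n · h) ≤ 2^B`: a statement about cheap torus-homogeneous `h` alone.  Unlike the
registered stub it is NOT implied by the crux (a cheap `h` with omnipresent fittable long Newton
edges and an expensive `per_n · h` would refute it and leave the crux open), so it stays a `def`,
exactly as K2 (`NoCheapOmnipresence`) vs K2′ in v2–v4. -/
def EdgeEntropyAlone : Prop :=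
  ∀ c d : ℕ, ∃ n₀ : ℕ, ∀ n ≥ n₀, ∀ h : MvPolynomial (Fin n × Fin n) ℝ≥0,
    h ≠ 0 → IsTorusHomogeneous h → complexity h ≤ 2 ^ ((Nat.log 2 n + c) ^ c) →
    ∃ b k : ℕ, (Nat.log 2 n + d) ^ d ≤ b ∧ 0 < k ∧
      edgeSum h (4 * k + 2) b k (b + b * (b * k)) <
        n.choose (b + b * (b * k)) * n.choose (b + b * (b * k))

/-- The h-alone form closes the registered stub (drop the pair hypothesis). -/
theorem stub_edgeEntropy_of_alone (hA : EdgeEntropyAlone) :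
    ∀ c d : ℕ, ∃ n₀ : ℕ, ∀ n ≥ n₀, ∀ h : MvPolynomial (Fin n × Fin n) ℝ≥0,
      h ≠ 0 → IsTorusHomogeneous h → complexity h ≤ 2 ^ ((Nat.log 2 n + c) ^ c) →
      complexity (perPoly (Fin n) ℝ≥0 * h) ≤ 2 ^ ((Nat.log 2 n + c) ^ c) →
      ∃ b k : ℕ, (Nat.log 2 n + d) ^ d ≤ b ∧ 0 < k ∧
        edgeSum h (4 * k + 2) b k (b + b * (b * k)) <
          n.choose (b + b * (b * k)) * n.choose (b + b * (b * k)) := by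
  intro c d
  obtain ⟨n₀, h₀⟩ := hA c d
  exact ⟨n₀, fun n hn h hh htor hcheap _ => h₀ n hn h hh htor hcheap⟩

/-- **The registered stub is implied by the crux** (so it can fail only if the crux fails): at level
`c + 1` the crux makes the two complexity hypotheses jointly unsatisfiable for large `n`, because
`2 · 2^{(log₂ n + c)^c} ≤ 2^{(log₂ n + c + 1)^{c+1}}`. -/
theorem stub_edgeEntropy_of_crux
    (H : Summit.ValiantsHypothesis.ValiantsHypothesis.Theses.DivisionGap.PerDivisionHard) :
    ∀ c d : ℕ, ∃ n₀ : ℕ, ∀ n ≥ n₀, ∀ h : MvPolynomial (Fin n × Fin n) ℝ≥0,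
      h ≠ 0 → IsTorusHomogeneous h → complexity h ≤ 2 ^ ((Nat.log 2 n + c) ^ c) →
      complexity (perPoly (Fin n) ℝ≥0 * h) ≤ 2 ^ ((Nat.log 2 n + c) ^ c) →
      ∃ b k : ℕ, (Nat.log 2 n + d) ^ d ≤ b ∧ 0 < k ∧
        edgeSum h (4 * k + 2) b k (b + b * (b * k)) <
          n.choose (b + b * (b * k)) * n.choose (b + b * (b * k)) := by
  intro c d
  obtain ⟨n₀, h₀⟩ := H (c + 1)
  refine ⟨n₀ + 2, fun n hn h hh _ hcheap hcheapPair => ?_⟩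
  exfalso
  have hlt := h₀ n (by omega) h hh
  -- `2^B + 2^B = 2^(B+1) ≤ 2^((log₂ n + c + 1)^(c+1))` (uses `log₂ n ≥ 1`, i.e. `n ≥ 2`)
  have hL : 1 ≤ Nat.log 2 n := Nat.log_pos (by norm_num) (by omega)
  have hB : (Nat.log 2 n + c) ^ c + 1 ≤ (Nat.log 2 n + (c + 1)) ^ (c + 1) := by
    set x := Nat.log 2 n + c with hx
    have hx1 : 1 ≤ x := by omega
    have hxc : 1 ≤ x ^ c := Nat.one_le_pow _ _ hx1
    have hx' : Nat.log 2 n + (c + 1) = x + 1 := by omega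
    rw [hx']
    calc x ^ c + 1 ≤ x ^ c * x + x ^ c := by nlinarith [Nat.mul_le_mul hxc hx1]
      _ = x ^ c * (x + 1) := by ring
      _ ≤ (x + 1) ^ c * (x + 1) := Nat.mul_le_mul_right _ (Nat.pow_le_pow_left (by omega) c)
      _ = (x + 1) ^ (c + 1) := by ring
  have hsum : complexity (perPoly (Fin n) ℝ≥0 * h) + complexity h ≤
      2 ^ ((Nat.log 2 n + (c + 1)) ^ (c + 1)) :=
    calc complexity (perPoly (Fin n) ℝ≥0 * h) + complexity h
        ≤ 2 ^ ((Nat.log 2 n + c) ^ c) + 2 ^ ((Nat.log 2 n + c) ^ c) := Nat.add_le_add hcheapPair hcheap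
      _ = 2 ^ ((Nat.log 2 n + c) ^ c + 1) := by ring
      _ ≤ 2 ^ ((Nat.log 2 n + (c + 1)) ^ (c + 1)) := Nat.pow_le_pow_right (by norm_num) hB
  exact absurd (lt_of_lt_of_le hlt hsum) (lt_irrefl _)

/-! ### v7 (lead seat c3, 2026-08-16): the GATE-LOCAL form of the core
(Prose compressed in v11 — see the git history of this file and the k2 dossiers; the
registered signatures below are unchanged.) -/

/-- **stub_liveStructure (v7; LANDED p117478).**  Statement and proof sketch in the landed file's docstring
(prose compressed in v13.1, 200 kB cap). [folklore] -/
theorem stub_liveStructure :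
    ∀ (n : ℕ) (P : ArithCircuit ℝ≥0 (Fin n × Fin n)) (w : Fin n × Fin n → ℕ)
      (m₁ m₂ : (Fin n × Fin n) →₀ ℕ),
      m₁ ∈ (topComponent w P.eval).support → m₂ ∈ (topComponent w P.eval).support → m₁ ≠ m₂ →
      ∃ (i : ℕ) (args : List (ℝ≥0 × ArithCircuit.Operand ℝ≥0 (Fin n × Fin n)))
        (o₁ o₂ : ℝ≥0 × ArithCircuit.Operand ℝ≥0 (Fin n × Fin n))
        (a₁ a₂ b : (Fin n × Fin n) →₀ ℕ),
        P.gates[i]? = some (ArithCircuit.Gate.sum args) ∧ o₁ ∈ args ∧ o₂ ∈ args ∧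
        o₁.1 ≠ 0 ∧ o₂.1 ≠ 0 ∧
        (topComponent w (o₁.2.eval (ArithCircuit.gateValues (P.gates.take i)))).support = {a₁} ∧
        (topComponent w (o₂.2.eval (ArithCircuit.gateValues (P.gates.take i)))).support = {a₂} ∧
        a₁ ≠ a₂ ∧
        a₁ + b ∈ (topComponent w P.eval).support ∧ a₂ + b ∈ (topComponent w P.eval).support :=
  -- LANDED (seat c3, wave 1, p117478).
  Summit.ValiantsHypothesis.ValiantsHypothesis.Theorems.DivisionGapPerDivisionHard.stub_liveStructure

/-- **stub_noGateTie (v7; OPEN — the gate-local form of the core, pair form).**  For every `c, d`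
and all large `n`: every nonzero torus-homogeneous `h` with `L(h) ≤ 2^B` and `L(per_n · h) ≤ 2^B`
and every fan-in-two circuit `P` for `h` of size `≤ 2^B` admit a placement `eR, eC` of some
`G(b,k) ⊕ M₀` (`b ≥ (log₂ n + d)^d`, `k ≥ 1`) such that for EVERY weight `w` cutting out the
placed face whose top fibre agrees off it, every live pair of single-monomial tops of two
effective operands of a sum gate of `P` coincides (no live gate tie).  Implied by the crux (its two
complexity hypotheses are jointly unsatisfiable at level `c + 1`); implied by route A
(`noGateTie_of_noOmnipresentFace`); its `h`-alone form `NoGateTieAlone` is the falsifiable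
research statement (= K2 for admissible generic weights, by `stub_liveStructure`). -/
theorem stub_noGateTie :
    ∀ c d : ℕ, ∃ n₀ : ℕ, ∀ n ≥ n₀, ∀ h : MvPolynomial (Fin n × Fin n) ℝ≥0,
      h ≠ 0 → IsTorusHomogeneous h → complexity h ≤ 2 ^ ((Nat.log 2 n + c) ^ c) →
      complexity (perPoly (Fin n) ℝ≥0 * h) ≤ 2 ^ ((Nat.log 2 n + c) ^ c) →
      ∀ P : ArithCircuit ℝ≥0 (Fin n × Fin n), P.IsFanInTwo → P.Computes h →
        P.size ≤ 2 ^ ((Nat.log 2 n + c) ^ c) →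
      ∃ (b k m : ℕ) (eR eC : BlockV b k m ≃ Fin n), (Nat.log 2 n + d) ^ d ≤ b ∧ 0 < k ∧
        ∀ w : Fin n × Fin n → ℕ, CutsOut w (placedBlock eR eC) →
          (∀ m₁ ∈ (topComponent w h).support, ∀ m₂ ∈ (topComponent w h).support,
            ∀ e ∉ placedBlock eR eC, m₁ e = m₂ e) →
          ∀ (i : ℕ) (args : List (ℝ≥0 × ArithCircuit.Operand ℝ≥0 (Fin n × Fin n)))
            (o₁ o₂ : ℝ≥0 × ArithCircuit.Operand ℝ≥0 (Fin n × Fin n))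
            (a₁ a₂ b' : (Fin n × Fin n) →₀ ℕ),
            P.gates[i]? = some (ArithCircuit.Gate.sum args) → o₁ ∈ args → o₂ ∈ args →
            o₁.1 ≠ 0 → o₂.1 ≠ 0 →
            (topComponent w (o₁.2.eval (ArithCircuit.gateValues (P.gates.take i)))).support
              = {a₁} →
            (topComponent w (o₂.2.eval (ArithCircuit.gateValues (P.gates.take i)))).support
              = {a₂} →
            a₁ + b' ∈ (topComponent w h).support → a₂ + b' ∈ (topComponent w h).support →
            a₁ = a₂ := by
  sorry

/-- **The `h`-ALONE gate form (v7; documented, NOT registered — the disprover's falsifiable target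
T3).  REFUTED (seat c8, `NegativeNotes-genericCut-walkTwins.md`): under a ONE-SCALE cut the top fibre of the
walk-sum cofactor `h_walk` agrees off the face and has two elements at EVERY placement, so `stub_liveStructure`
yields a tying gate `a₁ ≠ a₂` in any circuit for it; kept as documentation of a dead form.**  `stub_noGateTie` without the pair hypothesis `L(per_n · h) ≤ 2^B`.  By
`stub_liveStructure` (⇐) and the remark that a live tie yields two fibre monomials differing on
the face (⇒) it is EQUIVALENT to K2 (`NoCheapOmnipresence`) restricted to admissible weights whose
fibre agrees off the face — the generic cuts.  A cheap torus-homogeneous `h` with a cheap circuit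
that ties at EVERY placement would refute it and leave the crux open. -/
def NoGateTieAlone : Prop :=
  ∀ c d : ℕ, ∃ n₀ : ℕ, ∀ n ≥ n₀, ∀ h : MvPolynomial (Fin n × Fin n) ℝ≥0,
    h ≠ 0 → IsTorusHomogeneous h → complexity h ≤ 2 ^ ((Nat.log 2 n + c) ^ c) →
    ∀ P : ArithCircuit ℝ≥0 (Fin n × Fin n), P.IsFanInTwo → P.Computes h →
      P.size ≤ 2 ^ ((Nat.log 2 n + c) ^ c) →
    ∃ (b k m : ℕ) (eR eC : BlockV b k m ≃ Fin n), (Nat.log 2 n + d) ^ d ≤ b ∧ 0 < k ∧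
      ∀ w : Fin n × Fin n → ℕ, CutsOut w (placedBlock eR eC) →
        (∀ m₁ ∈ (topComponent w h).support, ∀ m₂ ∈ (topComponent w h).support,
          ∀ e ∉ placedBlock eR eC, m₁ e = m₂ e) →
        ∀ (i : ℕ) (args : List (ℝ≥0 × ArithCircuit.Operand ℝ≥0 (Fin n × Fin n)))
          (o₁ o₂ : ℝ≥0 × ArithCircuit.Operand ℝ≥0 (Fin n × Fin n))
          (a₁ a₂ b' : (Fin n × Fin n) →₀ ℕ),
          P.gates[i]? = some (ArithCircuit.Gate.sum args) → o₁ ∈ args → o₂ ∈ args →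
          o₁.1 ≠ 0 → o₂.1 ≠ 0 →
          (topComponent w (o₁.2.eval (ArithCircuit.gateValues (P.gates.take i)))).support
            = {a₁} →
          (topComponent w (o₂.2.eval (ArithCircuit.gateValues (P.gates.take i)))).support
            = {a₂} →
          a₁ + b' ∈ (topComponent w h).support → a₂ + b' ∈ (topComponent w h).support →
          a₁ = a₂

/-- **Route B: the face form of K2′ is a THEOREM of `stub_liveStructure` and `stub_noGateTie`
(v7).**  Take a fan-in-two circuit `P` for `h` of size `L(h) ≤ 2^B`
(`exists_computes_size_eq_complexity`), the placement of `stub_noGateTie`; at an admissible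
weight whose fibre agrees off the face, a fibre with two `G`-parts has two distinct monomials,
`stub_liveStructure` produces a live tie `a₁ ≠ a₂`, and `stub_noGateTie` says `a₁ = a₂`. -/
theorem stub_noOmnipresentFace :
    ∀ c d : ℕ, ∃ n₀ : ℕ, ∀ n ≥ n₀, ∀ h : MvPolynomial (Fin n × Fin n) ℝ≥0,
      h ≠ 0 → IsTorusHomogeneous h → complexity h ≤ 2 ^ ((Nat.log 2 n + c) ^ c) →
      complexity (perPoly (Fin n) ℝ≥0 * h) ≤ 2 ^ ((Nat.log 2 n + c) ^ c) →
      ∃ (b k m : ℕ) (eR eC : BlockV b k m ≃ Fin n), (Nat.log 2 n + d) ^ d ≤ b ∧ 0 < k ∧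
        ∀ w : Fin n × Fin n → ℕ, CutsOut w (placedBlock eR eC) →
          (∀ m₁ ∈ (topComponent w h).support, ∀ m₂ ∈ (topComponent w h).support,
            ∀ e ∉ placedBlock eR eC, m₁ e = m₂ e) →
          ∃ u : (Fin n × Fin n) →₀ ℕ, HasSingleGPart (placedBlock eR eC) w h u := by
  classical
  intro c d
  obtain ⟨n₀, hT⟩ := stub_noGateTie c d
  refine ⟨n₀, fun n hn h hh htor hcheap hcheapPair => ?_⟩
  obtain ⟨P, hP2, hPc, hPsize⟩ := ArithCircuit.exists_computes_size_eq_complexity h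
  obtain ⟨b, k, m, eR, eC, hb, hk, hnoTie⟩ :=
    hT n hn h hh htor hcheap hcheapPair P hP2 hPc (hPsize ▸ hcheap)
  refine ⟨b, k, m, eR, eC, hb, hk, fun w hcut hagree => ?_⟩
  set G := placedBlock eR eC with hG
  have hPeval : P.eval = h := hPc
  -- the top fibre is a single monomial
  have hfib : ∀ m₁ ∈ (topComponent w h).support, ∀ m₂ ∈ (topComponent w h).support, m₁ = m₂ := by
    intro m₁ hm₁ m₂ hm₂
    by_contra hne
    obtain ⟨i, args, o₁, o₂, a₁, a₂, b', hgi, ho₁, ho₂, hc₁, hc₂, ha₁, ha₂, hne', hl₁, hl₂⟩ :=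
      stub_liveStructure n P w m₁ m₂ (hPeval ▸ hm₁) (hPeval ▸ hm₂) hne
    rw [hPeval] at hl₁ hl₂
    exact hne' (hnoTie w hcut hagree i args o₁ o₂ a₁ a₂ b' hgi ho₁ ho₂ hc₁ hc₂ ha₁ ha₂ hl₁ hl₂)
  obtain ⟨m₀, hm₀⟩ := support_nonempty.mpr (topComponent_ne_zero w hh)
  refine ⟨m₀.filter (· ∈ G), fun e he => ?_, fun m' hm' e he => ?_⟩
  · rw [Finsupp.support_filter] at he
    exact (Finset.mem_filter.mp he).2
  · rw [hfib m' hm' m₀ hm₀, Finsupp.filter_apply_pos _ _ he]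

/-! ### v5 composition: the face stub from the three -/

-- (v13.1) `adj_paddingCol` now comes from the landed `Theorems/DivisionGapPerDivisionHardCutsOutDiag.lean`
-- (imported through `…StubAltFlow.lean`); the skeleton's verbatim copy was removed to avoid the name clash.

/-- **Route A: the face form of K2′ from `stub_edgeExtraction`, `stub_twoSidedCount`, `stub_edgeEntropy` (v5; prose compressed v14 — see git history ≤ v13.2).** [folklore] -/
theorem noOmnipresentFace_of_edgeEntropy :
    ∀ c d : ℕ, ∃ n₀ : ℕ, ∀ n ≥ n₀, ∀ h : MvPolynomial (Fin n × Fin n) ℝ≥0,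
      h ≠ 0 → IsTorusHomogeneous h → complexity h ≤ 2 ^ ((Nat.log 2 n + c) ^ c) →
      complexity (perPoly (Fin n) ℝ≥0 * h) ≤ 2 ^ ((Nat.log 2 n + c) ^ c) →
      ∃ (b k m : ℕ) (eR eC : BlockV b k m ≃ Fin n), (Nat.log 2 n + d) ^ d ≤ b ∧ 0 < k ∧
        ∀ w : Fin n × Fin n → ℕ, CutsOut w (placedBlock eR eC) →
          (∀ m₁ ∈ (topComponent w h).support, ∀ m₂ ∈ (topComponent w h).support,
            ∀ e ∉ placedBlock eR eC, m₁ e = m₂ e) →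
          ∃ u : (Fin n × Fin n) →₀ ℕ, HasSingleGPart (placedBlock eR eC) w h u := by
  classical
  intro c d
  obtain ⟨n₀, hE⟩ := stub_edgeEntropy c d
  refine ⟨n₀, fun n hn h hh htor hcheap hcheapPair => ?_⟩
  obtain ⟨b, k, hb, hk, hsum⟩ := hE n hn h hh htor hcheap hcheapPair
  set N := b + b * (b * k) with hN
  -- two-sided placement by counting
  obtain ⟨R, C, hRcard, hCcard, hgood⟩ := stub_twoSidedCount n N _ (edgeSigs h (4 * k + 2) b k N)
    (fun s => s.1) (fun s => s.2) hsum
  obtain ⟨eR, heR₁, heR₂⟩ := exists_blockEquiv R b k (n - N) hRcard (by rw [hRcard])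
  obtain ⟨eC, heC₁, heC₂⟩ := exists_blockEquiv C b k (n - N) hCcard (by rw [hCcard])
  refine ⟨b, k, n - N, eR, eC, hb, hk, fun w _ hagree => ?_⟩
  set G := placedBlock eR eC with hG
  have hdeg : ∀ p₁ ∈ h.support, ∀ p₂ ∈ h.support, p₁.degree = p₂.degree := by
    intro p₁ hp₁ p₂ hp₂
    obtain ⟨r₀, c₀, hrc⟩ := htor
    exact degree_eq_of_rowDegrees_eq ((hrc p₁ hp₁).1.trans (hrc p₂ hp₂).1.symm)
  -- the top fibre is a single monomial
  have hfib : ∀ m₁ ∈ (topComponent w h).support, ∀ m₂ ∈ (topComponent w h).support, m₁ = m₂ := by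
    intro m₁ hm₁ m₂ hm₂
    by_contra hne
    -- an edge inside the fibre
    obtain ⟨w', p₁, p₂, hsub, hp₁, hp₂, hp, hseg⟩ :=
      stub_edgeExtraction n h w m₁ m₂ hdeg hm₁ hm₂ hne
    have hs₁ := support_topComponent_subset _ h (hsub hp₁)
    have hs₂ := support_topComponent_subset _ h (hsub hp₂)
    have hedge : IsEdgePair h p₁ p₂ := ⟨hp, w', hp₁, hp₂, hseg⟩
    -- the difference `D = p₁ - p₂`: supported on `G`, vanishing margins, nonzero
    obtain ⟨r₀, c₀, hrc⟩ := htor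
    obtain ⟨hrow, hcol⟩ := sum_diff_eq_zero ((hrc p₁ hs₁).1.trans (hrc p₂ hs₂).1.symm)
      ((hrc p₁ hs₁).2.trans (hrc p₂ hs₂).2.symm)
    have hoff := hagree p₁ (hsub hp₁) p₂ (hsub hp₂)
    have hDG : ∀ e, (fun e => (p₁ e : ℤ) - p₂ e) e ≠ 0 → e ∈ G := fun e he => by
      by_contra heG
      exact he (by simp only [hoff e heG, sub_self])
    have hDne : ∃ e, (fun e => (p₁ e : ℤ) - p₂ e) e ≠ 0 := by
      by_contra hall
      push Not at hall
      exact hp (Finsupp.ext fun e => by exact_mod_cast sub_eq_zero.mp (hall e))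
    have hrows := placedFlow_card_rows eR eC hk hDG hrow hcol hDne
    have hTD : diffRows p₁ p₂ =
        Finset.univ.filter fun r => ∃ c', (p₁ (r, c') : ℤ) - p₂ (r, c') ≠ 0 := by
      simp only [diffRows, ne_eq, sub_eq_zero, Nat.cast_inj]
    -- so `(p₁, p₂)` is a bad edge pair; its rows lie in `R` and its columns in `C`
    have hfit : Fittable b k (diffCells p₁ p₂) := by
      refine ⟨n - N, eR, eC, fun e he => hDG e ?_⟩
      have he' : p₁ e ≠ p₂ e := (Finset.mem_filter.mp he).2
      simpa [sub_eq_zero] using he'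
    have hmem : (p₁, p₂) ∈ edgePairs h (4 * k + 2) b k := by
      unfold edgePairs
      exact Finset.mem_filter.mpr
        ⟨Finset.mk_mem_product hs₁ hs₂, hedge, by rw [hTD]; exact hrows, hfit⟩
    have hRsub : diffRows p₁ p₂ ⊆ R := by
      intro r hr
      rw [hTD] at hr
      obtain ⟨c', hc'⟩ := (Finset.mem_filter.mp hr).2
      have hpad := placedFlow_row_notPadding eR eC hDG hrow hcol hc'
      obtain ⟨x, rfl⟩ := eR.surjective r
      rcases x with i | p | u
      · exact heR₁ i
      · exact heR₂ p
      · exact absurd (eR.symm_apply_apply _) (hpad u)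
    have hCsub : diffCols p₁ p₂ ⊆ C := by
      intro c' hc'
      obtain ⟨r, hr⟩ := (Finset.mem_filter.mp hc').2
      have hr' : (p₁ (r, c') : ℤ) - p₂ (r, c') ≠ 0 := by
        simpa [sub_eq_zero] using hr
      have hpad := placedFlow_row_notPadding eR eC hDG hrow hcol hr'
      have hcell : (r, c') ∈ G := hDG _ hr'
      have hadj : blockAdj b k (n - N) (eR.symm r) (eC.symm c') = true := by
        simpa [hG, placedBlock] using hcell
      obtain ⟨y, rfl⟩ := eC.surjective c'
      rcases y with j | p | u
      · exact heC₁ j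
      · exact heC₂ p
      · rw [Equiv.symm_apply_apply] at hadj
        exact absurd (Summit.ValiantsHypothesis.ValiantsHypothesis.Theorems.DivisionGapPerDivisionHard.adj_paddingCol hadj) (hpad u)
    have hsig : (diffRows p₁ p₂, diffCols p₁ p₂) ∈ edgeSigs h (4 * k + 2) b k N := by
      unfold edgeSigs
      refine Finset.mem_filter.mpr ⟨Finset.mem_image.mpr ⟨(p₁, p₂), hmem, rfl⟩, ?_, ?_⟩
      · exact hRcard ▸ Finset.card_le_card hRsub
      · exact hCcard ▸ Finset.card_le_card hCsub
    exact hgood _ hsig ⟨hRsub, hCsub⟩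
  obtain ⟨m₀, hm₀⟩ := support_nonempty.mpr (topComponent_ne_zero w hh)
  refine ⟨m₀.filter (· ∈ G), fun e he => ?_, fun m' hm' e he => ?_⟩
  · rw [Finsupp.support_filter] at he
    exact (Finset.mem_filter.mp he).2
  · rw [hfib m' hm' m₀ hm₀, Finsupp.filter_apply_pos _ _ he]

/-- **Route A ⇒ route B (v7).**  The conclusion of `stub_noGateTie` follows from the face form:
a live tie `a₁ ≠ a₂` at an admissible weight gives two fibre monomials `a₁ + b', a₂ + b'` that
differ somewhere, hence (agreeing off the face) differ ON the face — impossible when the fibre has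
a single `G`-part.  So `stub_edgeEntropy` (through `noOmnipresentFace_of_edgeEntropy`) is a
sufficient condition for the registered open stub of the crux cone. -/
theorem noGateTie_of_noOmnipresentFace {n : ℕ} {h : MvPolynomial (Fin n × Fin n) ℝ≥0}
    {G : Finset (Fin n × Fin n)} {w : Fin n × Fin n → ℕ}
    (hagree : ∀ m₁ ∈ (topComponent w h).support, ∀ m₂ ∈ (topComponent w h).support,
      ∀ e ∉ G, m₁ e = m₂ e)
    (hsingle : ∃ u : (Fin n × Fin n) →₀ ℕ, HasSingleGPart G w h u)
    {a₁ a₂ b' : (Fin n × Fin n) →₀ ℕ}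
    (hl₁ : a₁ + b' ∈ (topComponent w h).support) (hl₂ : a₂ + b' ∈ (topComponent w h).support) :
    a₁ = a₂ := by
  obtain ⟨u, -, hu⟩ := hsingle
  ext e
  have key : (a₁ + b') e = (a₂ + b') e := by
    by_cases he : e ∈ G
    · rw [hu _ hl₁ e he, hu _ hl₂ e he]
    · exact hagree _ hl₁ _ hl₂ e he
  simpa using key

/-- Route A, assembled: `stub_edgeEntropy` (with the landed `stub_edgeExtraction`,
`stub_twoSidedCount`) implies the registered open stub `stub_noGateTie` verbatim. -/
theorem noGateTie_of_edgeEntropy :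
    ∀ c d : ℕ, ∃ n₀ : ℕ, ∀ n ≥ n₀, ∀ h : MvPolynomial (Fin n × Fin n) ℝ≥0,
      h ≠ 0 → IsTorusHomogeneous h → complexity h ≤ 2 ^ ((Nat.log 2 n + c) ^ c) →
      complexity (perPoly (Fin n) ℝ≥0 * h) ≤ 2 ^ ((Nat.log 2 n + c) ^ c) →
      ∀ P : ArithCircuit ℝ≥0 (Fin n × Fin n), P.IsFanInTwo → P.Computes h →
        P.size ≤ 2 ^ ((Nat.log 2 n + c) ^ c) →
      ∃ (b k m : ℕ) (eR eC : BlockV b k m ≃ Fin n), (Nat.log 2 n + d) ^ d ≤ b ∧ 0 < k ∧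
        ∀ w : Fin n × Fin n → ℕ, CutsOut w (placedBlock eR eC) →
          (∀ m₁ ∈ (topComponent w h).support, ∀ m₂ ∈ (topComponent w h).support,
            ∀ e ∉ placedBlock eR eC, m₁ e = m₂ e) →
          ∀ (i : ℕ) (args : List (ℝ≥0 × ArithCircuit.Operand ℝ≥0 (Fin n × Fin n)))
            (o₁ o₂ : ℝ≥0 × ArithCircuit.Operand ℝ≥0 (Fin n × Fin n))
            (a₁ a₂ b' : (Fin n × Fin n) →₀ ℕ),
            P.gates[i]? = some (ArithCircuit.Gate.sum args) → o₁ ∈ args → o₂ ∈ args →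
            o₁.1 ≠ 0 → o₂.1 ≠ 0 →
            (topComponent w (o₁.2.eval (ArithCircuit.gateValues (P.gates.take i)))).support
              = {a₁} →
            (topComponent w (o₂.2.eval (ArithCircuit.gateValues (P.gates.take i)))).support
              = {a₂} →
            a₁ + b' ∈ (topComponent w h).support → a₂ + b' ∈ (topComponent w h).support →
            a₁ = a₂ := by
  intro c d
  obtain ⟨n₀, hF⟩ := noOmnipresentFace_of_edgeEntropy c d
  refine ⟨n₀, fun n hn h hh htor hcheap hcheapPair P _ _ _ => ?_⟩
  obtain ⟨b, k, m, eR, eC, hb, hk, hface⟩ := hF n hn h hh htor hcheap hcheapPair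
  refine ⟨b, k, m, eR, eC, hb, hk, fun w hcut hagree i args o₁ o₂ a₁ a₂ b' _ _ _ _ _ _ _ hl₁ hl₂ =>
    noGateTie_of_noOmnipresentFace hagree (hface w hcut hagree) hl₁ hl₂⟩

-- (v12 compression) `perDivisionHard_of_smallEdgeSum` — the unconditional union-bound rung of v5.1 — is
-- LANDED verbatim as `Theorems/DivisionGapPerDivisionHardSmallEdgeSum.lean` (`perDivisionHard_of_smallEdgeSum`,
-- `exists_rigidPlacement_of_smallEdgeSum`); its in-skeleton proof is in the git history of this file (≤ v11.2).

/-- **K2′ (`stub_noCheapOmnipresence`, the v2/v3 registration) is a theorem of `stub_genericCut` and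
`stub_noOmnipresentFace`.**  For every `c, d` and all large `n`: every nonzero torus-homogeneous
`h` of complexity `≤ 2^{(log₂ n + c)^c}` whose per-multiple is as cheap admits a placement
`eR, eC` of some `G(b,k) ⊕ M₀` with `b ≥ (log₂ n + d)^d`, a weight `w` cutting out that face, and
a `G`-part `u` shared by the whole top-`w` fibre of `h`. -/
theorem stub_noCheapOmnipresence :
    ∀ c d : ℕ, ∃ n₀ : ℕ, ∀ n ≥ n₀, ∀ h : MvPolynomial (Fin n × Fin n) ℝ≥0,
      h ≠ 0 → IsTorusHomogeneous h → complexity h ≤ 2 ^ ((Nat.log 2 n + c) ^ c) →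
      complexity (perPoly (Fin n) ℝ≥0 * h) ≤ 2 ^ ((Nat.log 2 n + c) ^ c) →
      ∃ (b k m : ℕ) (eR eC : BlockV b k m ≃ Fin n) (w : Fin n × Fin n → ℕ)
        (u : (Fin n × Fin n) →₀ ℕ),
        (Nat.log 2 n + d) ^ d ≤ b ∧ CutsOut w (placedBlock eR eC) ∧
          HasSingleGPart (placedBlock eR eC) w h u := by
  intro c d
  obtain ⟨n₀, hF⟩ := stub_noOmnipresentFace c d
  refine ⟨n₀, fun n hn h hh htor hcheap hcheapPair => ?_⟩
  obtain ⟨b, k, m, eR, eC, hb, hk, hface⟩ := hF n hn h hh htor hcheap hcheapPair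
  have hdeg : ∀ m₁ ∈ h.support, ∀ m₂ ∈ h.support, m₁.degree = m₂.degree := by
    intro m₁ hm₁ m₂ hm₂
    obtain ⟨r₀, c₀, hrc⟩ := htor
    exact degree_eq_of_rowDegrees_eq ((hrc m₁ hm₁).1.trans (hrc m₂ hm₂).1.symm)
  obtain ⟨w, hcut, hagree⟩ := stub_genericCut b k m n eR eC h hk hdeg
  obtain ⟨u, hu⟩ := hface w hcut hagree
  exact ⟨b, k, m, eR, eC, w, u, hb, hcut, hu⟩

/-! ### v4: ARITHMETIC RIGIDITY — the odd-free rung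
(Prose compressed in v11 — see the git history of this file and the k2 dossiers; the
registered signatures below are unchanged.) -/

/-- **stub_qPotential (v4; provable now, size M).**  LANDED ?; statement and proof sketch in the landed file's docstring
(prose compressed in v11.1, 200 kB cap). [folklore] -/
theorem stub_qPotential :
    ∀ (b k m n : ℕ) (eR eC : BlockV b k m ≃ Fin n) (σ σ' : Equiv.Perm (Fin n)), 0 < k →
      (∀ e ∉ placedBlock eR eC, permMonomial σ e = permMonomial σ' e) →
      σ = σ' ∨ (2 * k + 1) ∣ orderOf (σ⁻¹ * σ') :=
  -- LANDED (seat c1, p107307).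
  Summit.ValiantsHypothesis.ValiantsHypothesis.Theorems.DivisionGapPerDivisionHard.stub_qPotential

/-- **stub_blockFits (v4; provable now, size S — polylog bookkeeping).**  For `b = (log₂ n + d)^d`
and every `k` with `k² ≤ n`, the block `G(b,k)` fits: `b + b·(b·k) ≤ n` for all large `n`
(`b² √n + b ≤ n` as soon as `4 b⁴ ≤ n`; cf. `four_mul_logPow_le`, `growth`, `pow_le_two_pow`).
[folklore] -/
theorem stub_blockFits :
    ∀ d : ℕ, ∃ n₀ : ℕ, ∀ n ≥ n₀, ∀ k : ℕ, k * k ≤ n →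
      (Nat.log 2 n + d) ^ d + (Nat.log 2 n + d) ^ d * ((Nat.log 2 n + d) ^ d * k) ≤ n :=
  -- LANDED (seat c1, p107894).
  Summit.ValiantsHypothesis.ValiantsHypothesis.Theorems.DivisionGapPerDivisionHard.stub_blockFits

/-- Permutation monomials have degree `n`. [folklore] -/
theorem degree_permMonomial' (n : ℕ) (σ : Equiv.Perm (Fin n)) : (permMonomial σ).degree = n := by
  simp [permMonomial, map_sum]

-- (v12.4 compression) `perDivisionHard_oddFree_of` + `perDivisionHard_coprimeGroup_of` — the odd-free / coprime-group rung
-- of v4 — are LANDED as `Theorems/DivisionGapPerDivisionHardOddFree.lean` (`perDivisionHard_oddFree`,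
-- `perDivisionHard_coprimeGroup`); in-skeleton proofs: git history of this file (≤ v12.3).

/-- K2 in its original "`h` alone" form (round-1 registration; the research target documented in
the card and in `NegativeNotes-stub_noCheapOmnipresence.md`): the same conclusion WITHOUT the
hypothesis that `per_n · h` is cheap.  Not registered any more (reshape v2): it is strictly
stronger than what the composition consumes and, unlike K2′, is not implied by the crux. -/
def NoCheapOmnipresence : Prop :=
  ∀ c d : ℕ, ∃ n₀ : ℕ, ∀ n ≥ n₀, ∀ h : MvPolynomial (Fin n × Fin n) ℝ≥0,
    h ≠ 0 → IsTorusHomogeneous h → complexity h ≤ 2 ^ ((Nat.log 2 n + c) ^ c) →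
    ∃ (b k m : ℕ) (eR eC : BlockV b k m ≃ Fin n) (w : Fin n × Fin n → ℕ)
      (u : (Fin n × Fin n) →₀ ℕ),
      (Nat.log 2 n + d) ^ d ≤ b ∧ CutsOut w (placedBlock eR eC) ∧
        HasSingleGPart (placedBlock eR eC) w h u

/-- K2 ⇒ K2′ (drop the pair hypothesis): any proof of the `h`-alone form closes the registered
stub. -/
theorem noCheapOmnipresence_pair_of_hAlone (hK2 : NoCheapOmnipresence) :
    ∀ c d : ℕ, ∃ n₀ : ℕ, ∀ n ≥ n₀, ∀ h : MvPolynomial (Fin n × Fin n) ℝ≥0,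
      h ≠ 0 → IsTorusHomogeneous h → complexity h ≤ 2 ^ ((Nat.log 2 n + c) ^ c) →
      complexity (perPoly (Fin n) ℝ≥0 * h) ≤ 2 ^ ((Nat.log 2 n + c) ^ c) →
      ∃ (b k m : ℕ) (eR eC : BlockV b k m ≃ Fin n) (w : Fin n × Fin n → ℕ)
        (u : (Fin n × Fin n) →₀ ℕ),
        (Nat.log 2 n + d) ^ d ≤ b ∧ CutsOut w (placedBlock eR eC) ∧
          HasSingleGPart (placedBlock eR eC) w h u := by
  intro c d
  obtain ⟨n₀, h₀⟩ := hK2 c d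
  exact ⟨n₀, fun n hn h hh htor hcheap _ => h₀ n hn h hh htor hcheap⟩

/-! ### The sparse branch (v2): the same pipeline, unconditionally, for cofactors with at most
`2^{(log₂ n + c)^c}` monomials — a new rung of the crux once `stub_sparseRigid` lands -/

/-- **stub_torusSupport (v2; LANDED p92687 — a 10-line corollary of the landed `stub_torus` proof).**
The torus normal form is reached by top components only, so its support is a SUB-support of
`h` (`support_topComponent_subset`); the sparse branch needs this to keep the monomial count. -/
theorem stub_torusSupport :
    ∀ (n : ℕ) (h : MvPolynomial (Fin n × Fin n) ℝ≥0), h ≠ 0 →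
      ∃ h' : MvPolynomial (Fin n × Fin n) ℝ≥0, h' ≠ 0 ∧ IsTorusHomogeneous h' ∧
        h'.support ⊆ h.support ∧
        complexity (perPoly (Fin n) ℝ≥0 * h') ≤ complexity (perPoly (Fin n) ℝ≥0 * h) ∧
        complexity h' ≤ complexity h :=
  -- LANDED (v2, p92687).
  Summit.ValiantsHypothesis.ValiantsHypothesis.Theorems.DivisionGapPerDivisionHard.stub_torusSupport

/-- **stub_sparseRigid (v2; LANDED p92595 — K2 for SPARSE cofactors, by counting placements).**  LANDED p92595; statement and proof sketch in the landed file's docstring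
(prose compressed in v11.1, 200 kB cap). [folklore] -/
theorem stub_sparseRigid :
    ∀ c d : ℕ, ∃ n₀ : ℕ, ∀ n ≥ n₀, ∀ h : MvPolynomial (Fin n × Fin n) ℝ≥0,
      h ≠ 0 → IsTorusHomogeneous h → h.support.card ≤ 2 ^ ((Nat.log 2 n + c) ^ c) →
      ∃ (b k m : ℕ) (eR eC : BlockV b k m ≃ Fin n) (w : Fin n × Fin n → ℕ)
        (u : (Fin n × Fin n) →₀ ℕ),
        (Nat.log 2 n + d) ^ d ≤ b ∧ CutsOut w (placedBlock eR eC) ∧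
          HasSingleGPart (placedBlock eR eC) w h u :=
  -- LANDED (wave 2, p92595 + Flow p91346 / Count p91349).
  Summit.ValiantsHypothesis.ValiantsHypothesis.Theorems.DivisionGapPerDivisionHard.stub_sparseRigid

-- (v12.4 compression) `perDivisionHard_sparse_of` — the sparse rung of v2 — is LANDED as
-- `Theorems/DivisionGapPerDivisionHardSparse.lean` (`perDivisionHard_sparse`, used below by the sparse-fibre rung);
-- in-skeleton proof: git history (≤ v12.3).

/-! ### v7.1 (lead seat c3): the SUB-EXPONENTIAL sparse branch
(Prose compressed in v11 — see the git history of this file and the k2 dossiers; the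
registered signatures below are unchanged.) -/

/-- **stub_subexpRigid (v7.1; LANDED p118076 — `stub_sparseRigid` with long subdivision paths).**  LANDED p118076; statement and proof sketch in the landed file's docstring
(prose compressed in v11.1, 200 kB cap). [folklore] -/
theorem stub_subexpRigid :
    ∀ d : ℕ, ∃ e n₀ : ℕ, ∀ n ≥ n₀, ∀ h : MvPolynomial (Fin n × Fin n) ℝ≥0,
      h ≠ 0 → IsTorusHomogeneous h → h.support.card ≤ 2 ^ (n / (Nat.log 2 n + e) ^ e) →
      ∃ (b k m : ℕ) (eR eC : BlockV b k m ≃ Fin n) (w : Fin n × Fin n → ℕ)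
        (u : (Fin n × Fin n) →₀ ℕ),
        (Nat.log 2 n + d) ^ d ≤ b ∧ CutsOut w (placedBlock eR eC) ∧
          HasSingleGPart (placedBlock eR eC) w h u :=
  -- LANDED (seat c3, wave 2, p118076).
  Summit.ValiantsHypothesis.ValiantsHypothesis.Theorems.DivisionGapPerDivisionHard.stub_subexpRigid

-- (v12.4 compression) `perDivisionHard_subexpSparse_of` — LANDED as `Theorems/DivisionGapPerDivisionHardSubexpSparse.lean`
-- (`perDivisionHard_subexpSparse`); in-skeleton proof: git history (≤ v12.3).

/-! ### v7.1 (lead seat c3): the ATOMIC branch — sums of products of sparse atoms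
(Prose compressed in v11 — see the git history of this file and the k2 dossiers; the
registered signatures below are unchanged.) -/

/-- **stub_atomicTop (v7.1; LANDED p118163).**  Every monomial of the top-`w` fibre of an
atomic expression comes from one term `l` with ALL atom monomials taken from the top-`w` fibres of
the atoms: `m = C_l + Σ_{β ∈ I} Σ_{j < μ_l(β)} f_{β,j}`, `f_{β,j} ∈ supp(top_w F_β)`.  (Support of
a positive combination is the union, support of a product over `ℝ≥0` is the sumset —
`support_mul` ⊆ and `JerrumSnir.support_mul_eq` ⊇ —; a non-top `f_{β,j}` could be swapped for a
heavier monomial of `F_β` inside `supp h`, contradicting maximality.) [folklore] -/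
theorem stub_atomicTop :
    ∀ (n : ℕ) (ι κ : Type) (I : Finset ι) (L : Finset κ)
      (F : ι → MvPolynomial (Fin n × Fin n) ℝ≥0) (a : κ → ℝ≥0) (C : κ → (Fin n × Fin n) →₀ ℕ)
      (μ : κ → ι → ℕ) (w : Fin n × Fin n → ℕ) (m : (Fin n × Fin n) →₀ ℕ),
      m ∈ (topComponent w
        (∑ l ∈ L, a l • (monomial (C l) (1 : ℝ≥0) * ∏ β ∈ I, F β ^ μ l β))).support →
      ∃ l ∈ L, ∃ f : ι → ℕ → ((Fin n × Fin n) →₀ ℕ),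
        (∀ β ∈ I, ∀ j < μ l β, f β j ∈ (topComponent w (F β)).support) ∧
        m = C l + ∑ β ∈ I, ∑ j ∈ Finset.range (μ l β), f β j :=
  -- LANDED (seat c3, wave 2, p118163).
  Summit.ValiantsHypothesis.ValiantsHypothesis.Theorems.DivisionGapPerDivisionHard.stub_atomicTop

/-- **stub_atomicTorus (v7.1; LANDED p118329 — `stub_torusFamily` for sums of products).**  LANDED p118329; statement and proof sketch in the landed file's docstring
(prose compressed in v11.1, 200 kB cap). [folklore] -/
theorem stub_atomicTorus :
    ∀ (n : ℕ) (ι κ : Type) (I : Finset ι) (L : Finset κ)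
      (F : ι → MvPolynomial (Fin n × Fin n) ℝ≥0) (a : κ → ℝ≥0) (C : κ → (Fin n × Fin n) →₀ ℕ)
      (μ : κ → ι → ℕ),
      (∀ β ∈ I, F β ≠ 0) →
      (∑ l ∈ L, a l • (monomial (C l) (1 : ℝ≥0) * ∏ β ∈ I, F β ^ μ l β)) ≠ 0 →
      ∃ (L' : Finset κ) (F' : ι → MvPolynomial (Fin n × Fin n) ℝ≥0),
        L' ⊆ L ∧ (∀ β ∈ I, F' β ≠ 0) ∧ (∀ β ∈ I, IsTorusHomogeneous (F' β)) ∧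
        (∀ β ∈ I, (F' β).support ⊆ (F β).support) ∧
        (∑ l ∈ L', a l • (monomial (C l) (1 : ℝ≥0) * ∏ β ∈ I, F' β ^ μ l β)) ≠ 0 ∧
        IsTorusHomogeneous
          (∑ l ∈ L', a l • (monomial (C l) (1 : ℝ≥0) * ∏ β ∈ I, F' β ^ μ l β)) ∧
        complexity (perPoly (Fin n) ℝ≥0 *
            ∑ l ∈ L', a l • (monomial (C l) (1 : ℝ≥0) * ∏ β ∈ I, F' β ^ μ l β)) ≤
          complexity (perPoly (Fin n) ℝ≥0 *
            ∑ l ∈ L, a l • (monomial (C l) (1 : ℝ≥0) * ∏ β ∈ I, F β ^ μ l β)) ∧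
        complexity (∑ l ∈ L', a l • (monomial (C l) (1 : ℝ≥0) * ∏ β ∈ I, F' β ^ μ l β)) ≤
          complexity (∑ l ∈ L, a l • (monomial (C l) (1 : ℝ≥0) * ∏ β ∈ I, F β ^ μ l β)) :=
  -- LANDED (seat c3, wave 2, p118329).
  Summit.ValiantsHypothesis.ValiantsHypothesis.Theorems.DivisionGapPerDivisionHard.stub_atomicTorus

/-- **stub_atomicRigid (v7.1; LANDED p119098 — K2 for atomic expressions by counting placements against internal pairs and cross patterns).**  LANDED p119098; statement and proof sketch in the landed file's docstring
(prose compressed in v11.1, 200 kB cap). [folklore] -/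
theorem stub_atomicRigid :
    ∀ d : ℕ, ∃ e n₀ : ℕ, ∀ n ≥ n₀, ∀ (ι κ : Type) (I : Finset ι) (L : Finset κ)
      (F : ι → MvPolynomial (Fin n × Fin n) ℝ≥0) (a : κ → ℝ≥0) (C : κ → (Fin n × Fin n) →₀ ℕ)
      (μ : κ → ι → ℕ),
      (∀ β ∈ I, F β ≠ 0) → (∀ β ∈ I, IsTorusHomogeneous (F β)) →
      (∑ l ∈ L, a l • (monomial (C l) (1 : ℝ≥0) * ∏ β ∈ I, F β ^ μ l β)) ≠ 0 →
      IsTorusHomogeneous (∑ l ∈ L, a l • (monomial (C l) (1 : ℝ≥0) * ∏ β ∈ I, F β ^ μ l β)) →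
      L.card ≤ 2 ^ (n / (Nat.log 2 n + e) ^ e) →
      (∑ β ∈ I, (F β).support.card ^ 2) ≤ 2 ^ (n / (Nat.log 2 n + e) ^ e) →
      (∀ l ∈ L, ∀ l' ∈ L, l ≠ l' →
        ∏ β ∈ I.filter (fun β => μ l β ≠ μ l' β), (F β).support.card ≤
          2 ^ (n / (Nat.log 2 n + e) ^ e)) →
      ∃ (b k m : ℕ) (eR eC : BlockV b k m ≃ Fin n) (w : Fin n × Fin n → ℕ)
        (u : (Fin n × Fin n) →₀ ℕ),
        (Nat.log 2 n + d) ^ d ≤ b ∧ CutsOut w (placedBlock eR eC) ∧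
          HasSingleGPart (placedBlock eR eC) w
            (∑ l ∈ L, a l • (monomial (C l) (1 : ℝ≥0) * ∏ β ∈ I, F β ^ μ l β)) u :=
  -- LANDED (seat c3, wave 3, p119098).
  Summit.ValiantsHypothesis.ValiantsHypothesis.Theorems.DivisionGapPerDivisionHard.stub_atomicRigid

-- (v12 compression) `perDivisionHard_atomic_of` — the atomic rung of v7.1 — is LANDED as
-- `Theorems/DivisionGapPerDivisionHardAtomic.lean` (`perDivisionHard_atomic`); in-skeleton proof: git history (≤ v11.2).

/-! ### v7.2 (lead seat c3): the PAIR-FLIP branch — sums of two products of binomials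
(Prose compressed in v11 — see the git history of this file and the k2 dossiers; the
registered signatures below are unchanged.) -/

/-- **stub_pairFlip (v7.2; LANDED ?).**  Statement and proof sketch in the landed file's docstring
(prose compressed in v13.1, 200 kB cap). [folklore] -/
theorem stub_pairFlip :
    ∀ (n : ℕ) (G : Finset (Fin n × Fin n)) (ι κ : Type) (I : Finset ι) (L : Finset κ)
      (F : ι → MvPolynomial (Fin n × Fin n) ℝ≥0) (a : κ → ℝ≥0) (C : κ → (Fin n × Fin n) →₀ ℕ)
      (μ : κ → ι → ℕ) (l₁ l₂ : κ) (β₀ : ι) (s s' : (Fin n × Fin n) →₀ ℕ) (ep em : Fin n × Fin n),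
      (∃ σ : Equiv.Perm (Fin n), ∀ i, (σ i, i) ∈ G) →
      (∀ β ∈ I, F β ≠ 0 ∧ (F β).support.card ≤ 2 ∧
        ∀ f ∈ (F β).support, ∀ f' ∈ (F β).support, f.degree = f'.degree) →
      L.card ≤ 2 → (∀ l ∈ L, a l ≠ 0) →
      (∀ m₁ ∈ (∑ l ∈ L, a l • (monomial (C l) (1 : ℝ≥0) * ∏ β ∈ I, F β ^ μ l β)).support,
        ∀ m₂ ∈ (∑ l ∈ L, a l • (monomial (C l) (1 : ℝ≥0) * ∏ β ∈ I, F β ^ μ l β)).support,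
        m₁.degree = m₂.degree) →
      (∀ β ∈ I, ∀ f ∈ (F β).support, ∀ f' ∈ (F β).support, f ≠ f' → ∃ e ∉ G, f e ≠ f' e) →
      l₁ ∈ L → l₂ ∈ L → l₁ ≠ l₂ → β₀ ∈ I → μ l₁ β₀ ≠ μ l₂ β₀ →
      s ∈ (F β₀).support → s' ∈ (F β₀).support → s ≠ s' →
      ep ∉ G → em ∉ G → s' ep < s ep → s em < s' em →
      (∀ β ∈ I, β ≠ β₀ → ∀ f ∈ (F β).support, ∀ f' ∈ (F β).support, f ≠ f' →
        ∀ i j : ℤ, (i ≠ 0 ∨ j ≠ 0) →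
          ∃ e ∉ G, i * ((f e : ℤ) - f' e) ≠ j * ((s e : ℤ) - s' e)) →
      ∃ w : Fin n × Fin n → ℕ, CutsOut w G ∧ ∃ u : (Fin n × Fin n) →₀ ℕ,
        HasSingleGPart G w (∑ l ∈ L, a l • (monomial (C l) (1 : ℝ≥0) * ∏ β ∈ I, F β ^ μ l β)) u :=
  -- LANDED (seat c3, p120124).
  Summit.ValiantsHypothesis.ValiantsHypothesis.Theorems.DivisionGapPerDivisionHard.stub_pairFlip

/-- **stub_pairMono (v7.2; LANDED p119077).**  The complementary case, for any number of
terms: if every atom on which two terms differ (`μ_{l₁} β ≠ μ_{l₂} β`) is a MONOMIAL, two candidate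
fibre monomials differ by the placement-free vector
`V_{l₁l₂} = C_{l₁} − C_{l₂} + Σ_β (μ_{l₁} β − μ_{l₂} β) · (Σ_{f ∈ supp F_β} f)`; if every such `V` is
`0` or does not vanish off `G` (H3), a digit weight cuts out `G` with a single `G`-part (binomial
atoms on which all terms agree are decided strictly and identically by H1 + digit genericity).
[folklore] -/
theorem stub_pairMono :
    ∀ (n : ℕ) (G : Finset (Fin n × Fin n)) (ι κ : Type) (I : Finset ι) (L : Finset κ)
      (F : ι → MvPolynomial (Fin n × Fin n) ℝ≥0) (a : κ → ℝ≥0) (C : κ → (Fin n × Fin n) →₀ ℕ)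
      (μ : κ → ι → ℕ),
      (∃ σ : Equiv.Perm (Fin n), ∀ i, (σ i, i) ∈ G) →
      (∀ β ∈ I, F β ≠ 0 ∧ (F β).support.card ≤ 2 ∧
        ∀ f ∈ (F β).support, ∀ f' ∈ (F β).support, f.degree = f'.degree) →
      (∀ l ∈ L, a l ≠ 0) →
      (∀ m₁ ∈ (∑ l ∈ L, a l • (monomial (C l) (1 : ℝ≥0) * ∏ β ∈ I, F β ^ μ l β)).support,
        ∀ m₂ ∈ (∑ l ∈ L, a l • (monomial (C l) (1 : ℝ≥0) * ∏ β ∈ I, F β ^ μ l β)).support,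
        m₁.degree = m₂.degree) →
      (∀ β ∈ I, ∀ f ∈ (F β).support, ∀ f' ∈ (F β).support, f ≠ f' → ∃ e ∉ G, f e ≠ f' e) →
      (∀ l₁ ∈ L, ∀ l₂ ∈ L, ∀ β ∈ I, μ l₁ β ≠ μ l₂ β → (F β).support.card = 1) →
      (∀ l₁ ∈ L, ∀ l₂ ∈ L,
        (∀ e, (C l₁ e : ℤ) - C l₂ e +
            ∑ β ∈ I, ((μ l₁ β : ℤ) - μ l₂ β) * ∑ f ∈ (F β).support, (f e : ℤ) = 0) ∨
        ∃ e ∉ G, (C l₁ e : ℤ) - C l₂ e +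
            ∑ β ∈ I, ((μ l₁ β : ℤ) - μ l₂ β) * ∑ f ∈ (F β).support, (f e : ℤ) ≠ 0) →
      ∃ w : Fin n × Fin n → ℕ, CutsOut w G ∧ ∃ u : (Fin n × Fin n) →₀ ℕ,
        HasSingleGPart G w (∑ l ∈ L, a l • (monomial (C l) (1 : ℝ≥0) * ∏ β ∈ I, F β ^ μ l β)) u :=
  -- LANDED (seat c3, wave 3, p119077).
  Summit.ValiantsHypothesis.ValiantsHypothesis.Theorems.DivisionGapPerDivisionHard.stub_pairMono

/-- **stub_pairPlacement (v7.2; LANDED p119900 — counting as in `stub_subexpRigid` plus a column labelling that keeps two cells outside the face).**  LANDED p119900; statement and proof sketch in the landed file's docstring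
(prose compressed in v11.1, 200 kB cap). [folklore] -/
theorem stub_pairPlacement :
    ∀ d : ℕ, ∃ e n₀ : ℕ, ∀ n ≥ n₀, ∀ (ι κ : Type) (I : Finset ι) (L : Finset κ)
      (F : ι → MvPolynomial (Fin n × Fin n) ℝ≥0) (a : κ → ℝ≥0) (C : κ → (Fin n × Fin n) →₀ ℕ)
      (μ : κ → ι → ℕ) (ep em : Fin n × Fin n),
      (∀ β ∈ I, F β ≠ 0 ∧ (F β).support.card ≤ 2 ∧ IsTorusHomogeneous (F β)) →
      I.card ≤ 2 ^ (n / (Nat.log 2 n + e) ^ e) → L.card ≤ 2 → (∀ l ∈ L, a l ≠ 0) →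
      (∀ β ∈ I, ∀ β' ∈ I, β ≠ β' → ∀ f ∈ (F β).support, ∀ f' ∈ (F β).support, f ≠ f' →
        ∀ g ∈ (F β').support, ∀ g' ∈ (F β').support, g ≠ g' → ∀ i j : ℤ, (i ≠ 0 ∨ j ≠ 0) →
          ∃ e₀ : Fin n × Fin n, i * ((f e₀ : ℤ) - f' e₀) ≠ j * ((g e₀ : ℤ) - g' e₀)) →
      (∑ l ∈ L, a l • (monomial (C l) (1 : ℝ≥0) * ∏ β ∈ I, F β ^ μ l β)) ≠ 0 →
      IsTorusHomogeneous (∑ l ∈ L, a l • (monomial (C l) (1 : ℝ≥0) * ∏ β ∈ I, F β ^ μ l β)) →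
      ∃ (b k m : ℕ) (eR eC : BlockV b k m ≃ Fin n), (Nat.log 2 n + d) ^ d ≤ b ∧ 0 < k ∧
        ep ∉ placedBlock eR eC ∧ em ∉ placedBlock eR eC ∧
        (∀ β ∈ I, ∀ f ∈ (F β).support, ∀ f' ∈ (F β).support, f ≠ f' →
          ∃ e ∉ placedBlock eR eC, f e ≠ f' e) ∧
        (∀ β ∈ I, ∀ β' ∈ I, β ≠ β' → ∀ f ∈ (F β).support, ∀ f' ∈ (F β).support, f ≠ f' →
          ∀ g ∈ (F β').support, ∀ g' ∈ (F β').support, g ≠ g' → ∀ i j : ℤ, (i ≠ 0 ∨ j ≠ 0) →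
            ∃ e ∉ placedBlock eR eC, i * ((f e : ℤ) - f' e) ≠ j * ((g e : ℤ) - g' e)) ∧
        (∀ l₁ ∈ L, ∀ l₂ ∈ L, (∀ β ∈ I, μ l₁ β ≠ μ l₂ β → (F β).support.card = 1) →
          (∀ e, (C l₁ e : ℤ) - C l₂ e +
              ∑ β ∈ I, ((μ l₁ β : ℤ) - μ l₂ β) * ∑ f ∈ (F β).support, (f e : ℤ) = 0) ∨
          ∃ e ∉ placedBlock eR eC, (C l₁ e : ℤ) - C l₂ e +
              ∑ β ∈ I, ((μ l₁ β : ℤ) - μ l₂ β) * ∑ f ∈ (F β).support, (f e : ℤ) ≠ 0) :=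
  -- LANDED (seat c3, wave 3, p119900 + Aux p119271).
  Summit.ValiantsHypothesis.ValiantsHypothesis.Theorems.DivisionGapPerDivisionHard.stub_pairPlacement

-- (v12 compression) `perDivisionHard_pairBinomial_of` (+ helper `exists_lt_and_gt_of_degree_eq`) — the
-- pair-flip rung of v7.2 — is LANDED as `Theorems/DivisionGapPerDivisionHardPairBinomial.lean`
-- (`perDivisionHard_pairBinomial`); in-skeleton proof: git history of this file (≤ v11.2).

/-! ### v8 (lead seat c4, prover-line-stmt-ValiantsHypothesis-5065-c4-0, 2026-08-16): DESCENT ACROSS SCALES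
(Prose compressed in v11 — see the git history of this file and the k2 dossiers; the
registered signatures below are unchanged.) -/

/-- **stub_blockSubstFacePer (v8; LANDED p122555).**  LANDED p122555; statement and proof sketch in the landed file's docstring
(prose compressed in v11.1, 200 kB cap). [folklore] -/
theorem stub_blockSubstFacePer :
    ∀ (b k m n : ℕ) (eR eC : BlockV b k m ≃ Fin n),
      aeval (blockSubst eR eC) (facePer (placedBlock eR eC)) = perPoly (Fin b) ℝ≥0 :=
  -- LANDED (seat c4, wave 1, p122555).
  Summit.ValiantsHypothesis.ValiantsHypothesis.Theorems.DivisionGapPerDivisionHard.stub_blockSubstFacePer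

/-- **stub_descent (v8; LANDED p122738).**  Statement and proof sketch in the landed file's docstring
(prose compressed in v13.1, 200 kB cap). [folklore] -/
theorem stub_descent :
    ∀ (b k m n : ℕ) (eR eC : BlockV b k m ≃ Fin n) (w : Fin n × Fin n → ℕ)
      (h : MvPolynomial (Fin n × Fin n) ℝ≥0), CutsOut w (placedBlock eR eC) → h ≠ 0 →
      ∃ h' : MvPolynomial (Fin b × Fin b) ℝ≥0, h' ≠ 0 ∧
        complexity (aeval (blockSubst eR eC) (facePer (placedBlock eR eC)) * h') ≤
          complexity (perPoly (Fin n) ℝ≥0 * h) ∧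
        complexity h' ≤ complexity h ∧
        h'.support.card ≤ (topComponent w h).support.card :=
  -- LANDED (seat c4, wave 1, p122738).
  Summit.ValiantsHypothesis.ValiantsHypothesis.Theorems.DivisionGapPerDivisionHard.stub_descent

/-- **stub_fibreArith (v8; LANDED p122855) — level matching across scales.**  If `n ≤ b^a`
then `log₂ n ≤ a (log₂ b + 1)`, so `(log₂ n + c)^c ≤ (log₂ b + c₁)^{c₁}` for some `c₁ = c₁(a, c)`
(e.g. `c₁ = (a + 1)(c + 1)`; `a = 0` forces `n ≤ 1`). [folklore] -/
theorem stub_fibreArith :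
    ∀ a c : ℕ, ∃ c₁ : ℕ, ∀ n b : ℕ, n ≤ b ^ a →
      (Nat.log 2 n + c) ^ c ≤ (Nat.log 2 b + c₁) ^ c₁ :=
  -- LANDED (seat c4, wave 1, p122855; `c₁ = 2a + 2c + 2`).
  Summit.ValiantsHypothesis.ValiantsHypothesis.Theorems.DivisionGapPerDivisionHard.stub_fibreArith

/-- **stub_decidedAtoms (v8; LANDED p123010) — a LARGE block deciding every sparse atom.**  LANDED p123010; statement and proof sketch in the landed file's docstring
(prose compressed in v11.1, 200 kB cap). [folklore] -/
theorem stub_decidedAtoms :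
    ∃ e n₀ : ℕ, ∀ n ≥ n₀, ∀ (ι : Type) (I : Finset ι)
      (F : ι → MvPolynomial (Fin n × Fin n) ℝ≥0),
      (∀ β ∈ I, IsTorusHomogeneous (F β)) →
      (∑ β ∈ I, (F β).support.card ^ 2) ≤ 2 ^ (Nat.sqrt n / (Nat.log 2 n + e) ^ e) →
      ∃ (b k m : ℕ) (eR eC : BlockV b k m ≃ Fin n) (w : Fin n × Fin n → ℕ),
        n ≤ b ^ 4 ∧ CutsOut w (placedBlock eR eC) ∧
        ∀ β ∈ I, ∀ f ∈ (topComponent w (F β)).support,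
          ∀ f' ∈ (topComponent w (F β)).support, f = f' :=
  -- LANDED (seat c4, wave 1, p123010; `e = 4`, `n₀ = 4096`, `b = ⌊⌊√n⌋^{1/2}⌋ + 1`, `k = ⌊√n⌋/16`).
  Summit.ValiantsHypothesis.ValiantsHypothesis.Theorems.DivisionGapPerDivisionHard.stub_decidedAtoms

/-- **The sparse-fibre rung (v8 composition, sorry-free modulo `stub_blockSubstFacePer`,
`stub_descent`, `stub_fibreArith`; the size-`b` endpoint is the LANDED sparse rung
`Theorems/DivisionGapPerDivisionHardSparse.perDivisionHard_sparse`): `PerDivisionHard`'s inequality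
for every nonzero `h` such that on SOME placed block face with `n ≤ b^a`, under SOME weight cutting
it out, the top fibre of `h` has at most `2^{(log₂ n + c)^c}` monomials** — any `k, m`, any cost.
(The face `K_{n,n}` — `b = n`, `k = m = 0`, `a = 1`, `w = 0` — gives back the sparse rung.) -/
theorem perDivisionHard_sparseFibre_of :
    ∀ a c : ℕ, ∃ n₀ : ℕ, ∀ n ≥ n₀, ∀ h : MvPolynomial (Fin n × Fin n) ℝ≥0, h ≠ 0 →
      (∃ (b k m : ℕ) (eR eC : BlockV b k m ≃ Fin n) (w : Fin n × Fin n → ℕ),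
        CutsOut w (placedBlock eR eC) ∧ n ≤ b ^ a ∧
        (topComponent w h).support.card ≤ 2 ^ ((Nat.log 2 n + c) ^ c)) →
      2 ^ ((Nat.log 2 n + c) ^ c) < complexity (perPoly (Fin n) ℝ≥0 * h) + complexity h := by
  intro a c
  obtain ⟨c₁, hc₁⟩ := stub_fibreArith a c
  obtain ⟨n₁, hsparse⟩ :=
    Summit.ValiantsHypothesis.ValiantsHypothesis.Theorems.DivisionGapPerDivisionHard.perDivisionHard_sparse
      c₁
  refine ⟨n₁ ^ a + 2, ?_⟩
  rintro n hn h hh ⟨b, k, m, eR, eC, w, hcut, hnb, hcard⟩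
  have ha : a ≠ 0 := by
    rintro rfl
    rw [pow_zero] at hnb
    omega
  have hb : n₁ ≤ b :=
    (Nat.pow_le_pow_iff_left ha).mp (le_trans (le_trans (Nat.le_add_right _ _) hn) hnb)
  obtain ⟨h', hh', hle1, hle2, hsupp⟩ := stub_descent b k m n eR eC w h hcut hh
  rw [stub_blockSubstFacePer] at hle1
  have hlev : 2 ^ ((Nat.log 2 n + c) ^ c) ≤ 2 ^ ((Nat.log 2 b + c₁) ^ c₁) :=
    Nat.pow_le_pow_right two_pos (hc₁ n b hnb)
  calc 2 ^ ((Nat.log 2 n + c) ^ c) ≤ 2 ^ ((Nat.log 2 b + c₁) ^ c₁) := hlev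
    _ < complexity (perPoly (Fin b) ℝ≥0 * h') + complexity h' :=
        hsparse b hb h' hh' (hsupp.trans (hcard.trans hlev))
    _ ≤ complexity (perPoly (Fin n) ℝ≥0 * h) + complexity h := Nat.add_le_add hle1 hle2

/-- **The subexponential-fibre rung (v8 composition, sorry-free modulo the same three stubs; endpoint
the LANDED `perDivisionHard_subexpSparse`):** the same with at most `2^{b/(log₂ b + e)^e}` fibre
monomials, `e = e(a, c)`. -/
theorem perDivisionHard_subexpFibre_of :
    ∀ a c : ℕ, ∃ e n₀ : ℕ, ∀ n ≥ n₀, ∀ h : MvPolynomial (Fin n × Fin n) ℝ≥0, h ≠ 0 →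
      (∃ (b k m : ℕ) (eR eC : BlockV b k m ≃ Fin n) (w : Fin n × Fin n → ℕ),
        CutsOut w (placedBlock eR eC) ∧ n ≤ b ^ a ∧
        (topComponent w h).support.card ≤ 2 ^ (b / (Nat.log 2 b + e) ^ e)) →
      2 ^ ((Nat.log 2 n + c) ^ c) < complexity (perPoly (Fin n) ℝ≥0 * h) + complexity h := by
  intro a c
  obtain ⟨c₁, hc₁⟩ := stub_fibreArith a c
  obtain ⟨e, n₁, hsparse⟩ :=
    Summit.ValiantsHypothesis.ValiantsHypothesis.Theorems.DivisionGapPerDivisionHard.perDivisionHard_subexpSparse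
      c₁
  refine ⟨e, n₁ ^ a + 2, ?_⟩
  rintro n hn h hh ⟨b, k, m, eR, eC, w, hcut, hnb, hcard⟩
  have ha : a ≠ 0 := by
    rintro rfl
    rw [pow_zero] at hnb
    omega
  have hb : n₁ ≤ b :=
    (Nat.pow_le_pow_iff_left ha).mp (le_trans (le_trans (Nat.le_add_right _ _) hn) hnb)
  obtain ⟨h', hh', hle1, hle2, hsupp⟩ := stub_descent b k m n eR eC w h hcut hh
  rw [stub_blockSubstFacePer] at hle1
  have hlev : 2 ^ ((Nat.log 2 n + c) ^ c) ≤ 2 ^ ((Nat.log 2 b + c₁) ^ c₁) :=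
    Nat.pow_le_pow_right two_pos (hc₁ n b hnb)
  calc 2 ^ ((Nat.log 2 n + c) ^ c) ≤ 2 ^ ((Nat.log 2 b + c₁) ^ c₁) := hlev
    _ < complexity (perPoly (Fin b) ℝ≥0 * h') + complexity h' :=
        hsparse b hb h' hh' (hsupp.trans hcard)
    _ ≤ complexity (perPoly (Fin n) ℝ≥0 * h) + complexity h := Nat.add_le_add hle1 hle2

-- (v15 compression) `perDivisionHard_atomicFree_of` — LANDED as Theorems/DivisionGapPerDivisionHardAtomicFree.lean (`perDivisionHard_atomicFree`);
-- in-skeleton proof: git history (≤ v14.2).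

/-! ### v8.2 (lead seat c4, same session): depth four over a decided atom pool, and the per-multiple floor of route C
(Prose compressed in v11 — see the git history of this file and the k2 dossiers; the
registered signatures below are unchanged.) -/

/-- **stub_sigmaPiSigmaPiCount (v8.2; LANDED p123647).**  Statement and proof sketch in the landed file's docstring
(prose compressed in v13.1, 200 kB cap). [folklore] -/
theorem stub_sigmaPiSigmaPiCount :
    ∀ (n : ℕ) (ι κ κ' θ : Type) (I : Finset ι) (L : Finset κ) (J : Finset θ) (L' : θ → Finset κ')
      (F : ι → MvPolynomial (Fin n × Fin n) ℝ≥0) (a : κ → ℝ≥0) (C : κ → (Fin n × Fin n) →₀ ℕ)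
      (a' : θ → κ' → ℝ≥0) (C' : θ → κ' → (Fin n × Fin n) →₀ ℕ) (μ : θ → κ' → ι → ℕ)
      (ν : κ → θ → ℕ) (w : Fin n × Fin n → ℕ),
      (∀ β ∈ I, ∀ f ∈ (topComponent w (F β)).support,
        ∀ f' ∈ (topComponent w (F β)).support, f = f') →
      (topComponent w (∑ l ∈ L, a l • (monomial (C l) (1 : ℝ≥0) *
        ∏ γ ∈ J, (∑ l' ∈ L' γ, a' γ l' • (monomial (C' γ l') (1 : ℝ≥0) *
          ∏ β ∈ I, F β ^ μ γ l' β)) ^ ν l γ))).support.card ≤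
        ∑ l ∈ L, ∏ γ ∈ J, (L' γ).card ^ ν l γ :=
  -- LANDED (seat c4, wave 2, p123647).
  Summit.ValiantsHypothesis.ValiantsHypothesis.Theorems.DivisionGapPerDivisionHard.stub_sigmaPiSigmaPiCount

/-- **The per-multiple floor of route C (v8.2; prose compressed v14 — see git history ≤ v13.2).** [folklore] -/
theorem perMul_fibre_card_ge :
    ∀ (b k m n : ℕ) (eR eC : BlockV b k m ≃ Fin n) (w : Fin n × Fin n → ℕ)
      (g : MvPolynomial (Fin n × Fin n) ℝ≥0), CutsOut w (placedBlock eR eC) → g ≠ 0 →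
      Nat.factorial b ≤ (topComponent w (perPoly (Fin n) ℝ≥0 * g)).support.card :=
  -- LANDED (seat c4, wave 2, p123580; `Theorems/PerDivisionHard/Negative/PerMulRichFibre.lean`).
  Summit.ValiantsHypothesis.ValiantsHypothesis.Theorems.DivisionGapPerDivisionHard.perMul_fibre_card_ge

-- (v15 compression) `perDivisionHard_sigmaPiSigmaPi_of` — LANDED as Theorems/DivisionGapPerDivisionHardSigmaPiSigmaPi.lean (`perDivisionHard_sigmaPiSigmaPi`);
-- in-skeleton proof: git history (≤ v14.2).

/-- **stub_noRichOmnipresence (v8; OPEN — route C, the weakest registered form of the core,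
pair form; v8.2: the fibre bound may be ANY quasi-polynomial `2^{(log₂ n + c')^{c'}}`).**  For every
`c` there are `a, c', n₀` such that for `n ≥ n₀`: every nonzero torus-homogeneous `h` with
`L(h) ≤ 2^B`, `L(per_n · h) ≤ 2^B` (`B = (log₂ n + c)^c`) admits a placement of some `G(b,k) ⊕ M₀`
with `n ≤ b^a` and a weight cutting it out under which the top fibre of `h` has at most
`2^{(log₂ n + c')^{c'}}` monomials.  Implied by the crux (its two complexity hypotheses are
jointly unsatisfiable at level `c + 1`); NOT implied by, and not implying, the polylog-block forms
K2′ / `stub_noOmnipresentFace` / `stub_noGateTie` (different block sizes), but its negation is a far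
stronger property of `h`: super-quasi-polynomially many fibre monomials under EVERY admissible weight
on EVERY large placed block face — true of `per_n · g` (`g ≠ 0`), of nothing cheap known. -/
theorem stub_noRichOmnipresence :
    ∀ c : ℕ, ∃ a c' n₀ : ℕ, ∀ n ≥ n₀, ∀ h : MvPolynomial (Fin n × Fin n) ℝ≥0,
      h ≠ 0 → IsTorusHomogeneous h → complexity h ≤ 2 ^ ((Nat.log 2 n + c) ^ c) →
      complexity (perPoly (Fin n) ℝ≥0 * h) ≤ 2 ^ ((Nat.log 2 n + c) ^ c) →
      ∃ (b k m : ℕ) (eR eC : BlockV b k m ≃ Fin n) (w : Fin n × Fin n → ℕ),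
        CutsOut w (placedBlock eR eC) ∧ n ≤ b ^ a ∧
        (topComponent w h).support.card ≤ 2 ^ ((Nat.log 2 n + c') ^ c') := by
  sorry

/-- Monotonicity of the quasi-polynomial exponent in its level: `(x + c)^c ≤ (x + C)^C` for
`c ≤ C`. [folklore] -/
theorem polylog_mono (x c C : ℕ) (h : c ≤ C) : (x + c) ^ c ≤ (x + C) ^ C := by
  rcases Nat.eq_zero_or_pos (x + C) with h0 | hpos
  · have hc : c = 0 := by omega
    have hC : C = 0 := by omega
    subst hc; subst hC
    exact le_rfl
  · exact (Nat.pow_le_pow_left (by omega) c).trans (Nat.pow_le_pow_right hpos h)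


/-! ### v9 (lead seat c5, prover-line-stmt-ValiantsHypothesis-5065-c5-0, 2026-08-16): GENERIC DESCENT TRANSFER, TYPED VERTICES AT THE BOTTOM, BACKGROUND SPLIT
(Prose compressed in v11 — see the git history of this file and the k2 dossiers; the
registered signatures below are unchanged.) -/

/-- **stub_descentAt (v9; LANDED p124889).**  LANDED p124889; statement and proof sketch in the landed file's docstring
(prose compressed in v11.1, 200 kB cap). [folklore] -/
theorem stub_descentAt :
    ∀ (b k m n : ℕ) (eR eC : BlockV b k m ≃ Fin n) (w : Fin n × Fin n → ℕ)
      (h : MvPolynomial (Fin n × Fin n) ℝ≥0), CutsOut w (placedBlock eR eC) → h ≠ 0 →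
      aeval (blockSubst eR eC) (topComponent w h) ≠ 0 ∧
      complexity (perPoly (Fin b) ℝ≥0 * aeval (blockSubst eR eC) (topComponent w h)) ≤
        complexity (perPoly (Fin n) ℝ≥0 * h) ∧
      complexity (aeval (blockSubst eR eC) (topComponent w h)) ≤ complexity h ∧
      (aeval (blockSubst eR eC) (topComponent w h)).support.card ≤
        (topComponent w h).support.card :=
  -- LANDED (seat c5, wave 1, p124889).
  Summit.ValiantsHypothesis.ValiantsHypothesis.Theorems.DivisionGapPerDivisionHard.stub_descentAt

/-- **The generic descent transfer (v9 composition, sorry-free modulo `stub_descentAt`; uses the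
landed `stub_fibreArith`).**  If on SOME placed block face with `n ≤ b^a`, under SOME weight
cutting it out, the projected pair `(per_b · h♭, h♭)` is expensive at level `c₁ = c₁(a, c)` of
size `b`, then the pair `(per_n · h, h)` is expensive at level `c` of size `n`.  Every rung of the
crux proved at size `b` plugs in here. -/
theorem perDivisionHard_projectedPair_of :
    ∀ a c : ℕ, ∃ c₁ : ℕ, ∀ (n : ℕ) (h : MvPolynomial (Fin n × Fin n) ℝ≥0), h ≠ 0 →
      (∃ (b k m : ℕ) (eR eC : BlockV b k m ≃ Fin n) (w : Fin n × Fin n → ℕ),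
        CutsOut w (placedBlock eR eC) ∧ n ≤ b ^ a ∧
        2 ^ ((Nat.log 2 b + c₁) ^ c₁) <
          complexity (perPoly (Fin b) ℝ≥0 * aeval (blockSubst eR eC) (topComponent w h)) +
            complexity (aeval (blockSubst eR eC) (topComponent w h))) →
      2 ^ ((Nat.log 2 n + c) ^ c) < complexity (perPoly (Fin n) ℝ≥0 * h) + complexity h :=
  -- (v15.1 compression) LANDED in Theorems/DivisionGapPerDivisionHardDescentTransfer.lean; in-skeleton proof: git history (≤ v15.0).
  Summit.ValiantsHypothesis.ValiantsHypothesis.Theorems.DivisionGapPerDivisionHard.perDivisionHard_projectedPair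

/-- **The sparse-graph-fibre rung (v9 instance of the transfer; endpoint the LANDED
`perDivisionHard_sparseGraph` at size `b`).**  `PerDivisionHard`'s inequality for every nonzero `h`
such that on SOME placed block face with `n ≤ b^a`, under SOME weight cutting it out, the
projected fibre `h♭` has a SPARSE VARIABLE GRAPH: every row and every column of the `b × b` block
meets at most `b/(log₂ b + e)^e` of its variables (any number of monomials, any cost).  For the
core: a rich fibre must also be SPREAD over the hub graph. -/
theorem perDivisionHard_sparseGraphFibre_of :
    ∀ a c : ℕ, ∃ e n₀ : ℕ, ∀ n ≥ n₀, ∀ h : MvPolynomial (Fin n × Fin n) ℝ≥0, h ≠ 0 →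
      (∃ (b k m : ℕ) (eR eC : BlockV b k m ≃ Fin n) (w : Fin n × Fin n → ℕ),
        CutsOut w (placedBlock eR eC) ∧ n ≤ b ^ a ∧
        (∀ r : Fin b, (((aeval (blockSubst eR eC) (topComponent w h)).support.biUnion
            fun m => m.support).filter (fun x => x.1 = r)).card ≤ b / (Nat.log 2 b + e) ^ e) ∧
        (∀ s : Fin b, (((aeval (blockSubst eR eC) (topComponent w h)).support.biUnion
            fun m => m.support).filter (fun x => x.2 = s)).card ≤ b / (Nat.log 2 b + e) ^ e)) →
      2 ^ ((Nat.log 2 n + c) ^ c) < complexity (perPoly (Fin n) ℝ≥0 * h) + complexity h :=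
  -- (v15.1 compression) LANDED in Theorems/DivisionGapPerDivisionHardDescentTransfer.lean; in-skeleton proof: git history (≤ v15.0).
  Summit.ValiantsHypothesis.ValiantsHypothesis.Theorems.DivisionGapPerDivisionHard.perDivisionHard_sparseGraphFibre

/-- **stub_pureCount (v9; LANDED p124995 — the typed vertex count for ARBITRARY margins).**  LANDED p124995; statement and proof sketch in the landed file's docstring
(prose compressed in v11.1, 200 kB cap). [folklore] -/
theorem stub_pureCount :
    ∀ (n : ℕ) (g : MvPolynomial (Fin n × Fin n) ℝ≥0) (R Cc : Fin n → ℕ), 3 ≤ n →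
      (∀ i, 1 ≤ R i) →
      (∀ α ∈ g.support, (∀ i, ∑ j, α (i, j) = R i) ∧ (∀ j, ∑ i, α (i, j) = Cc j)) →
      (Finset.univ.filter fun π : Equiv.Perm (Fin n) =>
          (∑ j, Finsupp.single (π j, j) (R (π j))) ∈ g.support).card * 2 ^ (n / 3) ≤
        complexity g * n.factorial :=
  -- LANDED (seat c5, wave 1, p124995).
  Summit.ValiantsHypothesis.ValiantsHypothesis.Theorems.DivisionGapPerDivisionHard.stub_pureCount

/-- **stub_purePair (v9; LANDED p124908).**  Multiplication by `per_n` over `ℝ≥0` shifts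
margins by one (`supp (per · h) ⊆ supp per + supp h`, permutation monomials have unit margins —
`rowCount_permMonomial`, `colCount_permMonomial`, cf. `margins_perPow`) and carries the pure
monomial of type `R` on `π` to the pure monomial of type `R + 1` on `π` (add `μ_π`; nothing
cancels: `add_mem_support_mul`, `coeff_permMonomial_perPoly`). [folklore] -/
theorem stub_purePair :
    ∀ (n : ℕ) (h : MvPolynomial (Fin n × Fin n) ℝ≥0) (R Cc : Fin n → ℕ),
      (∀ α ∈ h.support, (∀ i, ∑ j, α (i, j) = R i) ∧ (∀ j, ∑ i, α (i, j) = Cc j)) →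
      (∀ α ∈ (perPoly (Fin n) ℝ≥0 * h).support,
          (∀ i, ∑ j, α (i, j) = R i + 1) ∧ (∀ j, ∑ i, α (i, j) = Cc j + 1)) ∧
      ∀ π : Equiv.Perm (Fin n), (∑ j, Finsupp.single (π j, j) (R (π j))) ∈ h.support →
        (∑ j, Finsupp.single (π j, j) (R (π j) + 1)) ∈ (perPoly (Fin n) ℝ≥0 * h).support :=
  -- LANDED (seat c5, wave 1, p124908).
  Summit.ValiantsHypothesis.ValiantsHypothesis.Theorems.DivisionGapPerDivisionHard.stub_purePair

/-- **The pure-rich rung (v9 composition, sorry-free modulo `stub_pureCount`, `stub_purePair`):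
`PerDivisionHard`'s inequality — indeed `2^B < L(per_n · h)` alone — for every torus-homogeneous
`h` (margins `(R, C)`, `n ≥ 3`) with more than `2^B · n!/2^{⌊n/3⌋}` pure monomials of type `R`.**
The powers rung `perDivisionHard_powers` is the instance `h = per_n^M` (`R = C = M`, all `n!` pure
monomials `M • μ_π`); new here: arbitrary margins and sub-supports (e.g. `Σ_{σ ∈ S} a_σ x^σ · g`
for `|S| > 2^B n!/2^{⌊n/3⌋}` and any torus-homogeneous `g` with a pure monomial on `1`). -/
theorem perDivisionHard_pureRich_of :
    ∀ c : ℕ, ∃ n₀ : ℕ, ∀ n ≥ n₀, ∀ (h : MvPolynomial (Fin n × Fin n) ℝ≥0) (R Cc : Fin n → ℕ),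
      (∀ α ∈ h.support, (∀ i, ∑ j, α (i, j) = R i) ∧ (∀ j, ∑ i, α (i, j) = Cc j)) →
      2 ^ ((Nat.log 2 n + c) ^ c) * n.factorial <
        (Finset.univ.filter fun π : Equiv.Perm (Fin n) =>
          (∑ j, Finsupp.single (π j, j) (R (π j))) ∈ h.support).card * 2 ^ (n / 3) →
      2 ^ ((Nat.log 2 n + c) ^ c) < complexity (perPoly (Fin n) ℝ≥0 * h) + complexity h :=
  -- (v15.1 compression) LANDED in Theorems/DivisionGapPerDivisionHardPureRich.lean; in-skeleton proof: git history (≤ v15.0).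
  Summit.ValiantsHypothesis.ValiantsHypothesis.Theorems.DivisionGapPerDivisionHard.perDivisionHard_pureRich

/-- **The pure-fibre rung (v9 instance of the transfer; endpoint `perDivisionHard_pureRich_of` at
size `b`):** the inequality for every nonzero `h` such that on SOME placed block face with
`n ≤ b^a`, under SOME weight cutting it out, the projected fibre `h♭` is torus-homogeneous with
margins `(R, C)` and has more than `2^{(log₂ b + c₁)^{c₁}} · b!/2^{⌊b/3⌋}` pure monomials of type
`R` (`c₁ = c₁(a, c)`).  For the core: the richness of a counterexample's fibres must come from
NON-pure hub patterns. -/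
theorem perDivisionHard_pureFibre_of :
    ∀ a c : ℕ, ∃ c₁ n₀ : ℕ, ∀ n ≥ n₀, ∀ h : MvPolynomial (Fin n × Fin n) ℝ≥0, h ≠ 0 →
      (∃ (b k m : ℕ) (eR eC : BlockV b k m ≃ Fin n) (w : Fin n × Fin n → ℕ) (R Cc : Fin b → ℕ),
        CutsOut w (placedBlock eR eC) ∧ n ≤ b ^ a ∧
        (∀ α ∈ (aeval (blockSubst eR eC) (topComponent w h)).support,
            (∀ i, ∑ j, α (i, j) = R i) ∧ (∀ j, ∑ i, α (i, j) = Cc j)) ∧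
        2 ^ ((Nat.log 2 b + c₁) ^ c₁) * b.factorial <
          (Finset.univ.filter fun P : Equiv.Perm (Fin b) =>
            (∑ j, Finsupp.single (P j, j) (R (P j))) ∈
              (aeval (blockSubst eR eC) (topComponent w h)).support).card * 2 ^ (b / 3)) →
      2 ^ ((Nat.log 2 n + c) ^ c) < complexity (perPoly (Fin n) ℝ≥0 * h) + complexity h :=
  -- (v15.1 compression) LANDED in Theorems/DivisionGapPerDivisionHardPureRich.lean; in-skeleton proof: git history (≤ v15.0).
  Summit.ValiantsHypothesis.ValiantsHypothesis.Theorems.DivisionGapPerDivisionHard.perDivisionHard_pureFibre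

/-- **The background-pure rung (v9 composition; prose compressed v14 — see git history ≤ v13.2 and dossier v6).** [folklore] -/
theorem perDivisionHard_backgroundPure_of :
    ∀ a c : ℕ, ∃ κ c₁ n₀ : ℕ, ∀ n ≥ n₀, ∀ h : MvPolynomial (Fin n × Fin n) ℝ≥0, h ≠ 0 →
      (∃ (b k m : ℕ) (eR eC : BlockV b k m ≃ Fin n) (w : Fin n × Fin n → ℕ)
          (U : (Fin b × Fin b) →₀ ℕ) (F : MvPolynomial (Fin b × Fin b) ℝ≥0) (R Cc : Fin b → ℕ),
        CutsOut w (placedBlock eR eC) ∧ n ≤ b ^ a ∧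
        aeval (blockSubst eR eC) (topComponent w h) = monomial U 1 * F ∧
        (∀ α ∈ F.support, (∀ i, ∑ j, α (i, j) = R i) ∧ (∀ j, ∑ i, α (i, j) = Cc j)) ∧
        ((b + 2) * (2 ^ ((Nat.log 2 b + c₁) ^ c₁) + 2)) ^ κ * b.factorial <
          (Finset.univ.filter fun P : Equiv.Perm (Fin b) =>
            (∑ j, Finsupp.single (P j, j) (R (P j))) ∈ F.support).card * 2 ^ (b / 3)) →
      2 ^ ((Nat.log 2 n + c) ^ c) < complexity (perPoly (Fin n) ℝ≥0 * h) + complexity h :=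
  -- (v15.1 compression) LANDED in Theorems/DivisionGapPerDivisionHardPureRich.lean; in-skeleton proof: git history (≤ v15.0).
  Summit.ValiantsHypothesis.ValiantsHypothesis.Theorems.DivisionGapPerDivisionHard.perDivisionHard_backgroundPure

/-- **The background-low-degree rung (v9 composition; prose compressed v14 — see git history ≤ v13.2).** [folklore] -/
theorem perDivisionHard_backgroundLowDegree_of :
    ∀ a c : ℕ, ∃ κ c₁ : ℕ, ∀ (n : ℕ) (h : MvPolynomial (Fin n × Fin n) ℝ≥0), h ≠ 0 →
      (∃ (b k m : ℕ) (eR eC : BlockV b k m ≃ Fin n) (w : Fin n × Fin n → ℕ)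
          (U : (Fin b × Fin b) →₀ ℕ) (F : MvPolynomial (Fin b × Fin b) ℝ≥0),
        CutsOut w (placedBlock eR eC) ∧ n ≤ b ^ a ∧
        aeval (blockSubst eR eC) (topComponent w h) = monomial U 1 * F ∧ F ≠ 0 ∧
        F.totalDegree + 6 ≤ b ∧
        ((b + 2) * (2 ^ ((Nat.log 2 b + c₁) ^ c₁) + 2)) ^ κ + 1 < 2 ^ ((b - F.totalDegree) / 3)) →
      2 ^ ((Nat.log 2 n + c) ^ c) < complexity (perPoly (Fin n) ℝ≥0 * h) + complexity h :=
  -- (v15.1 compression) LANDED in Theorems/DivisionGapPerDivisionHardDescentTransfer.lean; in-skeleton proof: git history (≤ v15.0).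
  Summit.ValiantsHypothesis.ValiantsHypothesis.Theorems.DivisionGapPerDivisionHard.perDivisionHard_backgroundLowDegree


/-! ### v9.1 (lead seat c5, same session): INSIDE-UNIVERSALITY IS EXPONENTIALLY EXPENSIVE
(Prose compressed in v11 — see the git history of this file and the k2 dossiers; the
registered signatures below are unchanged.) -/

/-- **stub_insideUniversal (v9.1; LANDED p125315, lead's own, `Theorems/DivisionGapPerDivisionHardStubInsideUniversal.lean`).**  LANDED p125315; statement and proof sketch in the landed file's docstring
(prose compressed in v11.1, 200 kB cap). [folklore] -/
theorem stub_insideUniversal :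
    ∀ (b k m n D : ℕ) (e₀ : BlockV b k m ≃ Fin n) (h : MvPolynomial (Fin n × Fin n) ℝ≥0),
      3 ≤ m → 1 ≤ D →
      (∀ α ∈ h.support, (∀ i, ∑ j, α (i, j) = D) ∧ (∀ j, ∑ i, α (i, j) = D)) →
      (∀ eR eC : BlockV b k m ≃ Fin n, ∃ α ∈ h.support, α.support ⊆ placedBlock eR eC) →
      2 ^ (m / 3) ≤ complexity h :=
  -- LANDED (seat c5, lead's own, p125315).
  Summit.ValiantsHypothesis.ValiantsHypothesis.Theorems.DivisionGapPerDivisionHard.stub_insideUniversal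

/-- **The inside-universal rung (v9.1 composition, sorry-free modulo `stub_insideUniversal`):**
`2^B < L(h)` alone — so certainly the crux's inequality — for every `h` with uniform margins `D ≥ 1`
that has a monomial inside EVERY placement of some block shape `G(b,k) ⊕ M₀` with `m ≥ 3(B+1)`
padding vertices (e.g. any `h ⊇ {D • μ_σ}`, or `h` containing a `D`-factor of every relabelled
`G(b,k) ⊕ M₀`). -/
theorem perDivisionHard_insideUniversal_of :
    ∀ (c n D : ℕ) (h : MvPolynomial (Fin n × Fin n) ℝ≥0), 1 ≤ D →
      (∀ α ∈ h.support, (∀ i, ∑ j, α (i, j) = D) ∧ (∀ j, ∑ i, α (i, j) = D)) →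
      (∃ (b k m : ℕ) (_e₀ : BlockV b k m ≃ Fin n), 3 * ((Nat.log 2 n + c) ^ c + 1) ≤ m ∧
        ∀ eR eC : BlockV b k m ≃ Fin n, ∃ α ∈ h.support, α.support ⊆ placedBlock eR eC) →
      2 ^ ((Nat.log 2 n + c) ^ c) < complexity (perPoly (Fin n) ℝ≥0 * h) + complexity h := by
  rintro c n D h hD hmarg ⟨b, k, m, e₀, hm, huniv⟩
  have h1 := stub_insideUniversal b k m n D e₀ h (by omega) hD hmarg huniv
  have h2 : 2 ^ ((Nat.log 2 n + c) ^ c) < 2 ^ (m / 3) :=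
    Nat.pow_lt_pow_right one_lt_two (by omega)
  exact lt_of_lt_of_le h2 (h1.trans (Nat.le_add_left _ _))

/-! ### v9.2 (lead seat c5, same session): the projected fibre is torus-homogeneous at an agreeing weight; translates of `S_n` are cheap
(Prose compressed in v11 — see the git history of this file and the k2 dossiers; the
registered signatures below are unchanged.) -/

/-- **stub_fibreTorus (v9.2; LANDED p125985 — `sorry` kept here only while the farm snapshot rebuilds its module).**  LANDED p125985; statement and proof sketch in the landed file's docstring
(prose compressed in v11.1, 200 kB cap). [folklore] -/
theorem stub_fibreTorus :
    ∀ (b k m n : ℕ) (eR eC : BlockV b k m ≃ Fin n) (w : Fin n × Fin n → ℕ)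
      (h : MvPolynomial (Fin n × Fin n) ℝ≥0), 0 < k → IsTorusHomogeneous h →
      (∀ m₁ ∈ (topComponent w h).support, ∀ m₂ ∈ (topComponent w h).support,
        ∀ e ∉ placedBlock eR eC, m₁ e = m₂ e) →
      IsTorusHomogeneous (aeval (blockSubst eR eC) (topComponent w h)) :=
  -- LANDED (seat c5, p125985).
  Summit.ValiantsHypothesis.ValiantsHypothesis.Theorems.DivisionGapPerDivisionHard.stub_fibreTorus

/-- **The pure-fibre rung at an agreeing weight (v9.2 composition, sorry-free modulo
`stub_fibreTorus`, `stub_descentAt`, `stub_pureCount`, `stub_purePair`):** as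
`perDivisionHard_pureFibre_of`, but the torus-homogeneity of the projected fibre is DERIVED from the
fibre agreeing off the face (`k ≥ 1`), and pure-richness is asked for whatever its margins are. -/
theorem perDivisionHard_pureFibreAgree_of :
    ∀ a c : ℕ, ∃ c₁ n₀ : ℕ, ∀ n ≥ n₀, ∀ h : MvPolynomial (Fin n × Fin n) ℝ≥0, h ≠ 0 →
      IsTorusHomogeneous h →
      (∃ (b k m : ℕ) (eR eC : BlockV b k m ≃ Fin n) (w : Fin n × Fin n → ℕ),
        CutsOut w (placedBlock eR eC) ∧ n ≤ b ^ a ∧ 0 < k ∧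
        (∀ m₁ ∈ (topComponent w h).support, ∀ m₂ ∈ (topComponent w h).support,
          ∀ e ∉ placedBlock eR eC, m₁ e = m₂ e) ∧
        ∀ R Cc : Fin b → ℕ,
          (∀ α ∈ (aeval (blockSubst eR eC) (topComponent w h)).support,
            (∀ i, ∑ j, α (i, j) = R i) ∧ (∀ j, ∑ i, α (i, j) = Cc j)) →
          2 ^ ((Nat.log 2 b + c₁) ^ c₁) * b.factorial <
            (Finset.univ.filter fun P : Equiv.Perm (Fin b) =>
              (∑ j, Finsupp.single (P j, j) (R (P j))) ∈
                (aeval (blockSubst eR eC) (topComponent w h)).support).card * 2 ^ (b / 3)) →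
      2 ^ ((Nat.log 2 n + c) ^ c) < complexity (perPoly (Fin n) ℝ≥0 * h) + complexity h := by
  intro a c
  obtain ⟨c₁, n₀, hP⟩ := perDivisionHard_pureFibre_of a c
  refine ⟨c₁, n₀, ?_⟩
  rintro n hn h hh htor ⟨b, k, m, eR, eC, w, hcut, hnb, hk, hagree, hrich⟩
  obtain ⟨r, cc, hrc⟩ := stub_fibreTorus b k m n eR eC w h hk htor hagree
  have hRC : ∀ α ∈ (aeval (blockSubst eR eC) (topComponent w h)).support,
      (∀ i, ∑ j, α (i, j) = r i) ∧ (∀ j, ∑ i, α (i, j) = cc j) := by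
    intro α hα
    obtain ⟨hr, hc⟩ := hrc α hα
    refine ⟨fun i => ?_, fun j => ?_⟩
    · rw [← Summit.ValiantsHypothesis.ValiantsHypothesis.Theorems.DivisionGapPerDivisionHard.rowDegrees_apply, hr]
    · rw [← Summit.ValiantsHypothesis.ValiantsHypothesis.Theorems.DivisionGapPerDivisionHard.colDegrees_apply, hc]
  exact hP n hn h hh ⟨b, k, m, eR, eC, w, r, cc, hcut, hnb, hRC, hrich (fun i => r i) (fun j => cc j) hRC⟩

/-- **stub_translateCheap (v9.2; LANDED p125862).**  Statement and proof sketch in the landed file's docstring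
(prose compressed in v13.1, 200 kB cap). [folklore] -/
theorem stub_translateCheap :
    ∀ n : ℕ, 3 ≤ n →
      ∃ (h : MvPolynomial (Fin n × Fin n) ℝ≥0) (u : (Fin n × Fin n) →₀ ℕ) (R Cc : Fin n → ℕ),
        (∀ α ∈ h.support, (∀ i, ∑ j, α (i, j) = R i) ∧ (∀ j, ∑ i, α (i, j) = Cc j)) ∧
        complexity h ≤ 4 * n ^ 3 ∧
        (∀ σ : Equiv.Perm (Fin n), u + permMonomial σ ∈ h.support) ∧
        ¬ ∃ g : MvPolynomial (Fin n × Fin n) ℝ≥0, h = perPoly (Fin n) ℝ≥0 * g :=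
  -- LANDED (seat c5, p125862, `Theorems/PerDivisionHard/Negative/TranslateCheap.lean`).
  Summit.ValiantsHypothesis.ValiantsHypothesis.Theorems.DivisionGapPerDivisionHard.stub_translateCheap

/-! ### v9.3 (lead seat c5): every `h`-alone form is the crux without its `L(h)` term (dossier v6 §1)
(Prose compressed in v11 — see the git history of this file and the k2 dossiers; the
registered signatures below are unchanged.) -/

/-- **T4 `RichFibresAlone` (documented `h`-alone route C; NOT a stub).**  Every quasi-polynomially
cheap nonzero torus-homogeneous `f` has, on some placed block face with `n ≤ b^a`, a weight cutting it
out with a quasi-polynomially sparse top fibre. [folklore] -/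
def RichFibresAlone : Prop :=
  ∀ c : ℕ, ∃ a c' n₀ : ℕ, ∀ n ≥ n₀, ∀ f : MvPolynomial (Fin n × Fin n) ℝ≥0,
    f ≠ 0 → IsTorusHomogeneous f → complexity f ≤ 2 ^ ((Nat.log 2 n + c) ^ c) →
    ∃ (b k m : ℕ) (eR eC : BlockV b k m ≃ Fin n) (w : Fin n × Fin n → ℕ),
      CutsOut w (placedBlock eR eC) ∧ n ≤ b ^ a ∧
      (topComponent w f).support.card ≤ 2 ^ ((Nat.log 2 n + c') ^ c')

/-- A product of `per_n` with a torus-homogeneous polynomial is torus-homogeneous (margins shift by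
one; `supp (per · h) ⊆ supp per + supp h`). [folklore] -/
theorem isTorusHomogeneous_perPoly_mul {n : ℕ} {h : MvPolynomial (Fin n × Fin n) ℝ≥0}
    (hh : IsTorusHomogeneous h) : IsTorusHomogeneous (perPoly (Fin n) ℝ≥0 * h) := by
  classical
  obtain ⟨r, cc, hrc⟩ := hh
  refine ⟨r + Finsupp.equivFunOnFinite.symm (fun _ => 1),
    cc + Finsupp.equivFunOnFinite.symm (fun _ => 1), fun α hα => ?_⟩
  obtain ⟨u, hu, β, hβ, rfl⟩ := Finset.mem_add.mp (support_mul _ _ hα)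
  obtain ⟨σ, rfl⟩ := exists_permMonomial_eq_of_coeff_perPoly_ne_zero ℝ≥0 (mem_support_iff.mp hu)
  obtain ⟨hr, hc⟩ := hrc β hβ
  refine ⟨?_, ?_⟩
  · ext i
    have h1 : ∑ j, permMonomial σ (i, j) = 1 := rowCount_permMonomial σ i
    have h2 : ∑ j, β (i, j) = r i := by
      rw [← Summit.ValiantsHypothesis.ValiantsHypothesis.Theorems.DivisionGapPerDivisionHard.rowDegrees_apply, hr]
    rw [Summit.ValiantsHypothesis.ValiantsHypothesis.Theorems.DivisionGapPerDivisionHard.rowDegrees_apply]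
    simp only [Finsupp.coe_add, Pi.add_apply, Finset.sum_add_distrib, h1, h2,
      Finsupp.coe_equivFunOnFinite_symm]
    exact add_comm _ _
  · ext j
    have h1 : ∑ i, permMonomial σ (i, j) = 1 := colCount_permMonomial σ j
    have h2 : ∑ i, β (i, j) = cc j := by
      rw [← Summit.ValiantsHypothesis.ValiantsHypothesis.Theorems.DivisionGapPerDivisionHard.colDegrees_apply, hc]
    rw [Summit.ValiantsHypothesis.ValiantsHypothesis.Theorems.DivisionGapPerDivisionHard.colDegrees_apply]
    simp only [Finsupp.coe_add, Pi.add_apply, Finset.sum_add_distrib, h1, h2,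
      Finsupp.coe_equivFunOnFinite_symm]
    exact add_comm _ _

/-- `2^{b-1} ≤ b!`. [folklore] -/
theorem two_pow_pred_le_factorial (b : ℕ) : 2 ^ (b - 1) ≤ b.factorial := by
  rcases b with _ | b
  · simp
  · have := Nat.factorial_mul_pow_le_factorial (m := 1) (n := b)
    simp only [Nat.factorial_one, one_mul, Nat.reduceAdd] at this
    rw [Nat.add_sub_cancel, show b + 1 = 1 + b from Nat.add_comm _ _]
    exact this

/-- **`RichFibresAlone` implies the crux without its `L(h)` term** (dossier v6 §1): for every `c`,
for all large `n` and every `h ≠ 0`, `2^{(log₂ n + c)^c} < L(per_n · h) + 1`.  (Uses the landed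
`stub_torus`, `perMul_fibre_card_ge`, `stub_fibreArith`, `four_mul_logPow_le`.) -/
theorem perHard_of_richFibresAlone (hR : RichFibresAlone) :
    ∀ c : ℕ, ∃ n₀ : ℕ, ∀ n ≥ n₀, ∀ h : MvPolynomial (Fin n × Fin n) ℝ≥0, h ≠ 0 →
      2 ^ ((Nat.log 2 n + c) ^ c) < complexity (perPoly (Fin n) ℝ≥0 * h) + 1 := by
  classical
  intro c
  obtain ⟨a, c', n₀, hA⟩ := hR c
  obtain ⟨c₁, hc₁⟩ := stub_fibreArith a c'
  obtain ⟨n₂, hn₂⟩ :=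
    Summit.ValiantsHypothesis.ValiantsHypothesis.Theorems.DivisionGapPerDivisionHard.four_mul_logPow_le c₁
  refine ⟨n₀ + (n₂ + 2) ^ a + 2, ?_⟩
  intro n hn h hh
  by_contra hlt
  have hle : complexity (perPoly (Fin n) ℝ≥0 * h) ≤ 2 ^ ((Nat.log 2 n + c) ^ c) := by omega
  obtain ⟨h', hh', htor, hle1, -⟩ := stub_torus n h hh
  set f := perPoly (Fin n) ℝ≥0 * h' with hf
  have hf0 : f ≠ 0 := mul_ne_zero (perPoly_ne_zero (Fin n) ℝ≥0) hh'
  have hftor : IsTorusHomogeneous f := isTorusHomogeneous_perPoly_mul htor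
  have hfle : complexity f ≤ 2 ^ ((Nat.log 2 n + c) ^ c) := hle1.trans hle
  obtain ⟨b, k, m, eR, eC, w, hcut, hnb, hcard⟩ := hA n (by omega) f hf0 hftor hfle
  have ha : a ≠ 0 := by
    rintro rfl
    rw [pow_zero] at hnb
    omega
  have hb : n₂ + 2 ≤ b :=
    (Nat.pow_le_pow_iff_left ha).mp (le_trans (le_trans (by omega) hn) hnb)
  -- the fibre of `per · h'` has at least `b!` monomials
  have hrich := Summit.ValiantsHypothesis.ValiantsHypothesis.Theorems.DivisionGapPerDivisionHard.perMul_fibre_card_ge b k m n eR eC w h' hcut hh'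
  -- but `2^{(log₂ n + c')^{c'}} ≤ 2^{(log₂ b + c₁)^{c₁}} ≤ 2^{b/4} < b!`
  have h1 : (Nat.log 2 n + c') ^ c' + 1 ≤ b - 1 := by
    have := hc₁ n b hnb
    have := hn₂ b (by omega)
    omega
  have h2 : 2 ^ ((Nat.log 2 n + c') ^ c') < b.factorial :=
    calc 2 ^ ((Nat.log 2 n + c') ^ c') < 2 ^ ((Nat.log 2 n + c') ^ c' + 1) :=
          Nat.pow_lt_pow_right one_lt_two (Nat.lt_succ_self _)
      _ ≤ 2 ^ (b - 1) := Nat.pow_le_pow_right two_pos h1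
      _ ≤ b.factorial := two_pow_pred_le_factorial b
  exact absurd (hrich.trans hcard) (not_le.mpr h2)

/-! ### v9.4 (lead seat c5): the CANONICAL background split of a projected fibre (dossier v6 §5')
(Prose compressed in v11 — see the git history of this file and the k2 dossiers; the
registered signatures below are unchanged.) -/

/-- **stub_fibreBackground (v9.4; LANDED p126202 — `sorry` kept here only while the farm snapshot rebuilds its module).**  LANDED p126202; statement and proof sketch in the landed file's docstring
(prose compressed in v11.1, 200 kB cap). [folklore] -/
theorem stub_fibreBackground :
    ∀ (b k m n : ℕ) (eR eC : BlockV b k m ≃ Fin n) (w : Fin n × Fin n → ℕ)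
      (h : MvPolynomial (Fin n × Fin n) ℝ≥0) (hk : 0 < k),
      (∀ m₁ ∈ (topComponent w h).support, ∀ m₂ ∈ (topComponent w h).support,
        ∀ e ∉ placedBlock eR eC, m₁ e = m₂ e) →
      ∃ (U₀ : (Fin b × Fin b) →₀ ℕ) (F : MvPolynomial (Fin b × Fin b) ℝ≥0),
        aeval (blockSubst eR eC) (topComponent w h) = monomial U₀ 1 * F ∧
        F.support = (topComponent w h).support.image fun d =>
          Finsupp.equivFunOnFinite.symm fun ij : Fin b × Fin b =>
            d (eR (Sum.inl ij.1), eC (Sum.inr (Sum.inl (ij.1, ij.2, ⟨0, hk⟩)))) :=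
  -- LANDED (seat c5, p126202).
  Summit.ValiantsHypothesis.ValiantsHypothesis.Theorems.DivisionGapPerDivisionHard.stub_fibreBackground

/-- **The hub-pure rung (v9.4 composition, sorry-free modulo `stub_fibreBackground` and the stubs of
`perDivisionHard_backgroundPure_of`):** the inequality for every nonzero `h` such that on SOME placed
block face with `n ≤ b^a`, `k ≥ 1`, under SOME weight cutting it out whose fibre agrees off the face,
the hub tables of the fibre have margins `(R, C)` and more than
`((b+2)(2^{(log₂ b + c₁)^{c₁}} + 2))^κ · b!/2^{⌊b/3⌋}` of them are PURE of type `R`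
(`T = Σ_j R(P j) e_{(P j, j)}` for a permutation `P` of the core). -/
theorem perDivisionHard_hubPure_of :
    ∀ a c : ℕ, ∃ κ c₁ n₀ : ℕ, ∀ n ≥ n₀, ∀ h : MvPolynomial (Fin n × Fin n) ℝ≥0, h ≠ 0 →
      (∃ (b k m : ℕ) (eR eC : BlockV b k m ≃ Fin n) (w : Fin n × Fin n → ℕ) (hk : 0 < k)
          (R Cc : Fin b → ℕ),
        CutsOut w (placedBlock eR eC) ∧ n ≤ b ^ a ∧
        (∀ m₁ ∈ (topComponent w h).support, ∀ m₂ ∈ (topComponent w h).support,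
          ∀ e ∉ placedBlock eR eC, m₁ e = m₂ e) ∧
        (∀ d ∈ (topComponent w h).support,
          (∀ i, ∑ j, d (eR (Sum.inl i), eC (Sum.inr (Sum.inl (i, j, ⟨0, hk⟩)))) = R i) ∧
          (∀ j, ∑ i, d (eR (Sum.inl i), eC (Sum.inr (Sum.inl (i, j, ⟨0, hk⟩)))) = Cc j)) ∧
        ((b + 2) * (2 ^ ((Nat.log 2 b + c₁) ^ c₁) + 2)) ^ κ * b.factorial <
          (Finset.univ.filter fun P : Equiv.Perm (Fin b) =>
            ∃ d ∈ (topComponent w h).support, ∀ i j,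
              d (eR (Sum.inl i), eC (Sum.inr (Sum.inl (i, j, ⟨0, hk⟩)))) =
                (∑ j', Finsupp.single (P j', j') (R (P j'))) (i, j)).card * 2 ^ (b / 3)) →
      2 ^ ((Nat.log 2 n + c) ^ c) < complexity (perPoly (Fin n) ℝ≥0 * h) + complexity h := by
  classical
  intro a c
  obtain ⟨κ, c₁, n₀, hB⟩ := perDivisionHard_backgroundPure_of a c
  refine ⟨κ, c₁, n₀, ?_⟩
  rintro n hn h hh ⟨b, k, m, eR, eC, w, hk, R, Cc, hcut, hnb, hagree, hmarg, hrich⟩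
  obtain ⟨U₀, F, hsplit, hsupp⟩ := stub_fibreBackground b k m n eR eC w h hk hagree
  refine hB n hn h hh ⟨b, k, m, eR, eC, w, U₀, F, R, Cc, hcut, hnb, hsplit, ?_, ?_⟩
  · intro α hα
    rw [hsupp, Finset.mem_image] at hα
    obtain ⟨d, hd, rfl⟩ := hα
    obtain ⟨hr, hc⟩ := hmarg d hd
    refine ⟨fun i => ?_, fun j => ?_⟩
    · simpa [Finsupp.coe_equivFunOnFinite_symm] using hr i
    · simpa [Finsupp.coe_equivFunOnFinite_symm] using hc j
  · refine lt_of_lt_of_le hrich (Nat.mul_le_mul_right _ (Finset.card_le_card ?_))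
    intro P hP
    simp only [Finset.mem_filter, Finset.mem_univ, true_and] at hP ⊢
    obtain ⟨d, hd, hdP⟩ := hP
    rw [hsupp, Finset.mem_image]
    refine ⟨d, hd, ?_⟩
    ext ⟨i, j⟩
    rw [Finsupp.coe_equivFunOnFinite_symm]
    exact hdP i j

/-! ### v9.5 (lead seat c5): richness = number of distinct hub tables (proved)
(Prose compressed in v11 — see the git history of this file and the k2 dossiers; the
registered signatures below are unchanged.) -/

/-- **Hub tables separate an agreeing fibre** (`k ≥ 1`, `h` torus-homogeneous): two fibre
monomials with the same hub values are equal. [folklore] -/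
theorem hubTable_injOn {b k m n : ℕ} (eR eC : BlockV b k m ≃ Fin n) (w : Fin n × Fin n → ℕ)
    (h : MvPolynomial (Fin n × Fin n) ℝ≥0) (hk : 0 < k) (htor : IsTorusHomogeneous h)
    (hagree : ∀ m₁ ∈ (topComponent w h).support, ∀ m₂ ∈ (topComponent w h).support,
      ∀ e ∉ placedBlock eR eC, m₁ e = m₂ e) :
    ∀ d₁ ∈ (topComponent w h).support, ∀ d₂ ∈ (topComponent w h).support,
      (∀ i j : Fin b, d₁ (eR (Sum.inl i), eC (Sum.inr (Sum.inl (i, j, ⟨0, hk⟩)))) =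
        d₂ (eR (Sum.inl i), eC (Sum.inr (Sum.inl (i, j, ⟨0, hk⟩))))) → d₁ = d₂ := by
  classical
  intro d₁ hd₁ d₂ hd₂ hhub
  obtain ⟨r, cc, hrc⟩ := htor
  obtain ⟨hr₁, hc₁⟩ := hrc d₁ (support_topComponent_subset w h hd₁)
  obtain ⟨hr₂, hc₂⟩ := hrc d₂ (support_topComponent_subset w h hd₂)
  set D : Fin n × Fin n → ℤ := fun e => (d₁ e : ℤ) - d₂ e with hD
  have hG : ∀ e, D e ≠ 0 → e ∈ placedBlock eR eC := by
    intro e he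
    by_contra hne
    exact he (by rw [hD]; simp [hagree d₁ hd₁ d₂ hd₂ e hne])
  have hrow : ∀ r, ∑ c, D (r, c) = 0 := by
    intro i
    have h1 := Summit.ValiantsHypothesis.ValiantsHypothesis.Theorems.DivisionGapPerDivisionHard.rowDegrees_apply d₁ i
    have h2 := Summit.ValiantsHypothesis.ValiantsHypothesis.Theorems.DivisionGapPerDivisionHard.rowDegrees_apply d₂ i
    rw [hr₁] at h1; rw [hr₂] at h2
    simp only [hD, Finset.sum_sub_distrib]
    rw [← Nat.cast_sum, ← Nat.cast_sum, ← h1, ← h2, sub_self]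
  have hcol : ∀ c, ∑ r, D (r, c) = 0 := by
    intro j
    have h1 := Summit.ValiantsHypothesis.ValiantsHypothesis.Theorems.DivisionGapPerDivisionHard.colDegrees_apply d₁ j
    have h2 := Summit.ValiantsHypothesis.ValiantsHypothesis.Theorems.DivisionGapPerDivisionHard.colDegrees_apply d₂ j
    rw [hc₁] at h1; rw [hc₂] at h2
    simp only [hD, Finset.sum_sub_distrib]
    rw [← Nat.cast_sum, ← Nat.cast_sum, ← h1, ← h2, sub_self]
  have hF := Summit.ValiantsHypothesis.ValiantsHypothesis.Theorems.DivisionGapPerDivisionHard.labelFlow_of_placed eR eC hG hrow hcol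
  by_contra hne
  have hex : ∃ e, D e ≠ 0 := by
    by_contra hall
    push Not at hall
    apply hne
    ext e
    have := hall e
    simp only [hD, sub_eq_zero, Nat.cast_inj] at this
    exact this
  obtain ⟨⟨r₀, c₀⟩, h₀⟩ := hex
  have h₀' : (fun r ℓ => D (eR r, eC ℓ)) (eR.symm r₀) (eC.symm c₀) ≠ 0 := by simpa using h₀
  obtain ⟨i, j, hij⟩ := Summit.ValiantsHypothesis.ValiantsHypothesis.Theorems.DivisionGapPerDivisionHard.exists_pathVal_ne_zero hF hk h₀'
  apply hij
  simp only [Summit.ValiantsHypothesis.ValiantsHypothesis.Theorems.DivisionGapPerDivisionHard.pathVal, Summit.ValiantsHypothesis.ValiantsHypothesis.Theorems.DivisionGapPerDivisionHard.iv, hD]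
  rw [sub_eq_zero, Nat.cast_inj]
  exact hhub i j

/-! ### The kernel-checked composition -/

/-- **Route B composition (the v7 cone, kept verbatim).**  Concludes the crux `DivisionGap.PerDivisionHard`
BY NAME from the registered stubs (`stub_torus`, `stub_faceDescent`, `stub_jssContraction`,
`stub_blockArsenal` landed; `stub_noCheapOmnipresence` derived — v7: from `stub_genericCut`,
`stub_liveStructure`, `stub_noGateTie`), invoked by name; no `sorry` of its own; pure logic
plus one monotonicity step (`((n+2)(s+2))^κ` is monotone in `s`). -/
theorem PerDivisionHard_of_routeB :
    Summit.ValiantsHypothesis.ValiantsHypothesis.Theses.DivisionGap.PerDivisionHard := by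
  intro c
  obtain ⟨κ, hcon⟩ := stub_jssContraction
  obtain ⟨d, n₁, hhard⟩ := stub_blockArsenal c κ
  obtain ⟨n₀, hK2⟩ := stub_noCheapOmnipresence c d
  refine ⟨n₀ + n₁, ?_⟩
  intro n hn h hh
  obtain ⟨h', hh', htor, hle1, hle2⟩ := stub_torus n h hh
  by_contra hlt
  have hle : complexity (perPoly (Fin n) ℝ≥0 * h) + complexity h ≤
      2 ^ ((Nat.log 2 n + c) ^ c) := not_lt.mp hlt
  -- the pair is cheap, hence so is the torus normal form `h'`
  have hcheap : complexity h' ≤ 2 ^ ((Nat.log 2 n + c) ^ c) :=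
    le_trans hle2 (le_trans (Nat.le_add_left _ _) hle)
  -- K2: place a hard block face on which the top fibre of `h'` has a single `G`-part
  have hcheapPair : complexity (perPoly (Fin n) ℝ≥0 * h') ≤ 2 ^ ((Nat.log 2 n + c) ^ c) :=
    le_trans hle1 (le_trans (Nat.le_add_right _ _) hle)
  obtain ⟨b, k, m, eR, eC, w, u, hb, hcut, hsingle⟩ :=
    hK2 n (by omega) h' hh' htor hcheap hcheapPair
  -- face descent: `x^u · per_G` is (up to one gate) no more expensive than `per · h'`
  have hdesc := stub_faceDescent n (placedBlock eR eC) w h' u hcut hh' hsingle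
  have h1 : complexity (monomial u (1 : ℝ≥0) * facePer (placedBlock eR eC)) ≤
      2 ^ ((Nat.log 2 n + c) ^ c) + 1 :=
    calc complexity (monomial u (1 : ℝ≥0) * facePer (placedBlock eR eC))
        ≤ complexity (perPoly (Fin n) ℝ≥0 * h') + 1 := hdesc
      _ ≤ complexity (perPoly (Fin n) ℝ≥0 * h) + 1 := Nat.add_le_add_right hle1 1
      _ ≤ 2 ^ ((Nat.log 2 n + c) ^ c) + 1 :=
          Nat.add_le_add_right (le_trans (Nat.le_add_right _ _) hle) 1
  -- JSS contraction: strip the monomial at polynomial cost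
  have h2 : complexity (facePer (placedBlock eR eC)) ≤
      ((n + 2) * (2 ^ ((Nat.log 2 n + c) ^ c) + 3)) ^ κ :=
    calc complexity (facePer (placedBlock eR eC))
        ≤ ((n + 2) * (complexity (monomial u (1 : ℝ≥0) * facePer (placedBlock eR eC)) + 2)) ^ κ :=
          hcon n (facePer (placedBlock eR eC)) u
      _ ≤ ((n + 2) * (2 ^ ((Nat.log 2 n + c) ^ c) + 3)) ^ κ :=
          Nat.pow_le_pow_left (Nat.mul_le_mul_left _ (by omega)) κ
  -- the placed block face is harder than that
  have h3 := hhard n (by omega) b k m eR eC hb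
  exact absurd (lt_of_lt_of_le h3 h2) (lt_irrefl _)

/-- **Composition (audited skeleton theorem, v8).**  Concludes the crux `DivisionGap.PerDivisionHard`
BY NAME from `stub_torus` (landed), `stub_noRichOmnipresence` (OPEN, route C) and the sparse-fibre
rung `perDivisionHard_sparseFibre_of` (sorry-free modulo the provable v8 stubs `stub_descent`,
`stub_blockSubstFacePer`, `stub_fibreArith` and the landed sparse rung); pure logic: the torus
normal form `h'` of a cheap pair is a cheap pair, route C gives it a large block face with a
quasi-polynomially sparse admissible fibre, and the sparse-fibre rung says such an `h'` has an
expensive pair. -/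
theorem PerDivisionHard_of :
    Summit.ValiantsHypothesis.ValiantsHypothesis.Theses.DivisionGap.PerDivisionHard := by
  intro c
  obtain ⟨a, c', n₁, hC⟩ := stub_noRichOmnipresence c
  obtain ⟨n₂, hR⟩ := perDivisionHard_sparseFibre_of a (max c c')
  refine ⟨n₁ + n₂, ?_⟩
  intro n hn h hh
  obtain ⟨h', hh', htor, hle1, hle2⟩ := stub_torus n h hh
  by_contra hlt
  have hle : complexity (perPoly (Fin n) ℝ≥0 * h) + complexity h ≤
      2 ^ ((Nat.log 2 n + c) ^ c) := not_lt.mp hlt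
  have hcheap : complexity h' ≤ 2 ^ ((Nat.log 2 n + c) ^ c) :=
    le_trans hle2 (le_trans (Nat.le_add_left _ _) hle)
  have hcheapPair : complexity (perPoly (Fin n) ℝ≥0 * h') ≤ 2 ^ ((Nat.log 2 n + c) ^ c) :=
    le_trans hle1 (le_trans (Nat.le_add_right _ _) hle)
  obtain ⟨b, k, m, eR, eC, w, hcut, hnb, hcard⟩ := hC n (by omega) h' hh' htor hcheap hcheapPair
  have hmono₁ : 2 ^ ((Nat.log 2 n + c) ^ c) ≤ 2 ^ ((Nat.log 2 n + max c c') ^ max c c') :=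
    Nat.pow_le_pow_right two_pos (polylog_mono _ _ _ (le_max_left c c'))
  have hmono₂ : 2 ^ ((Nat.log 2 n + c') ^ c') ≤ 2 ^ ((Nat.log 2 n + max c c') ^ max c c') :=
    Nat.pow_le_pow_right two_pos (polylog_mono _ _ _ (le_max_right c c'))
  have hmain := hR n (by omega) h' hh' ⟨b, k, m, eR, eC, w, hcut, hnb, hcard.trans hmono₂⟩
  exact hlt (lt_of_le_of_lt hmono₁ (lt_of_lt_of_le hmain (Nat.add_le_add hle1 hle2)))


/-! ### v11 (lead seat c7, prover-line-stmt-ValiantsHypothesis-5065-c7-0, 2026-08-16): ERASURE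
(Prose compressed in v14 — 200 kB cap; see the dossiers and the git history of this file ≤ v13.2.) -/

/-- **stub_rectKill (v11; LANDED p128843).**  Statement and proof sketch in the landed file's docstring
(prose compressed in v13.1, 200 kB cap). [folklore] -/
theorem stub_rectKill :
    ∀ c : ℕ, ∃ c' n₀ : ℕ, ∀ n ≥ n₀, ∀ (A B : Finset (Fin n))
      (h : MvPolynomial (Fin n × Fin n) ℝ≥0) (d : ℕ) (u : (Fin n × Fin n) →₀ ℕ),
      h.IsHomogeneous d → u ∈ h.support →
      (∀ e : Fin n × Fin n, e.1 ∈ A → e.2 ∈ B → u e = 0) →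
      n + (Nat.log 2 n + c') ^ c' ≤ A.card + B.card →
      2 ^ ((Nat.log 2 n + c) ^ c) + 1 <
        complexity (topComponent (fun e : Fin n × Fin n => if e.1 ∈ A ∧ e.2 ∈ B then 0 else 1)
          (perPoly (Fin n) ℝ≥0 * h)) :=
  -- LANDED (seat c7, wave 1, p128843).
  Summit.ValiantsHypothesis.ValiantsHypothesis.Theorems.DivisionGapPerDivisionHard.stub_rectKill

/-- Torus-homogeneous polynomials are homogeneous (all monomials share the row margins `r`, hence the
total degree `|r|`). [folklore] -/
theorem isHomogeneous_of_isTorusHomogeneous {n : ℕ} {h : MvPolynomial (Fin n × Fin n) ℝ≥0}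
    (htor : IsTorusHomogeneous h) : ∃ d, h.IsHomogeneous d := by
  classical
  obtain ⟨r, c, hrc⟩ := htor
  refine ⟨r.degree, ?_⟩
  rw [MvPolynomial.IsHomogeneous, MvPolynomial.IsWeightedHomogeneous]
  intro m hm
  have hmem : m ∈ h.support := by simpa [MvPolynomial.mem_support_iff] using hm
  have hr := (hrc m hmem).1
  have e1 : Finsupp.weight (1 : Fin n × Fin n → ℕ) m = m.degree := by
    rw [Finsupp.degree_eq_weight_one]; rfl
  rw [e1, ← Finsupp.degree_mapDomain Prod.fst m]
  show (Finsupp.mapDomain Prod.fst m).degree = r.degree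
  rw [← hr]; rfl

/-- **The DEFICIENCY rung (v11 composition, sorry-free modulo `stub_rectKill`).**  For every `c`
there are `c', n₀` such that for `n ≥ n₀`: every nonzero HOMOGENEOUS `h` with a monomial vanishing on
a rectangle `A × B`, `|A| + |B| ≥ n + (log₂ n + c')^{c'}` (a Hall violator of polylogarithmic
deficiency in its support), satisfies `2^{(log₂ n + c)^c} < L(per_n · h) + L(h)` — in fact
`< L(per_n · h)` alone.  Generalises the low-degree rung (`Negative/PerLowDegreeRung`) and
`perDivisionHard_rowsAvoided`. -/
theorem perDivisionHard_deficient_of :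
    ∀ c : ℕ, ∃ c' n₀ : ℕ, ∀ n ≥ n₀, ∀ (h : MvPolynomial (Fin n × Fin n) ℝ≥0) (d : ℕ),
      h ≠ 0 → h.IsHomogeneous d →
      (∃ u ∈ h.support, ∃ A B : Finset (Fin n),
        (∀ e : Fin n × Fin n, e.1 ∈ A → e.2 ∈ B → u e = 0) ∧
        n + (Nat.log 2 n + c') ^ c' ≤ A.card + B.card) →
      2 ^ ((Nat.log 2 n + c) ^ c) < complexity (perPoly (Fin n) ℝ≥0 * h) + complexity h := by
  intro c
  obtain ⟨c', n₀, hK⟩ := stub_rectKill c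
  refine ⟨c', n₀, fun n hn h d _ hhom ⟨u, hu, A, B, hrect, hAB⟩ => ?_⟩
  have h1 := hK n hn A B h d u hhom hu hrect hAB
  have h2 := Summit.ValiantsHypothesis.ValiantsHypothesis.Theorems.ZeroOneTransfer.Negative.complexity_topComponent_le
    (fun e : Fin n × Fin n => if e.1 ∈ A ∧ e.2 ∈ B then 0 else 1) (perPoly (Fin n) ℝ≥0 * h)
  omega

/-- **The deficiency rung for torus-homogeneous cofactors** (the form the skeleton's torus step
produces). -/
theorem perDivisionHard_deficientTorus_of :
    ∀ c : ℕ, ∃ c' n₀ : ℕ, ∀ n ≥ n₀, ∀ h : MvPolynomial (Fin n × Fin n) ℝ≥0,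
      h ≠ 0 → IsTorusHomogeneous h →
      (∃ u ∈ h.support, ∃ A B : Finset (Fin n),
        (∀ e : Fin n × Fin n, e.1 ∈ A → e.2 ∈ B → u e = 0) ∧
        n + (Nat.log 2 n + c') ^ c' ≤ A.card + B.card) →
      2 ^ ((Nat.log 2 n + c) ^ c) < complexity (perPoly (Fin n) ℝ≥0 * h) + complexity h := by
  intro c
  obtain ⟨c', n₀, hK⟩ := perDivisionHard_deficient_of c
  refine ⟨c', n₀, fun n hn h hh htor hdef => ?_⟩
  obtain ⟨d, hd⟩ := isHomogeneous_of_isTorusHomogeneous htor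
  exact hK n hn h d hh hd hdef

/-- **stub_erasedDescent (v11; LANDED p128089).**  Statement and proof sketch in the landed file's docstring
(prose compressed in v13.1, 200 kB cap). [folklore] -/
theorem stub_erasedDescent :
    ∀ (n : ℕ) (G D : Finset (Fin n × Fin n)) (w : Fin n × Fin n → ℕ)
      (h : MvPolynomial (Fin n × Fin n) ℝ≥0) (u : (Fin n × Fin n) →₀ ℕ),
      CutsOut w G → h ≠ 0 →
      (∀ m ∈ (topComponent w h).support, ∀ e ∈ G, e ∉ D → m e = u e) →
      ∃ u' : (Fin n × Fin n) →₀ ℕ,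
        complexity (monomial u' (1 : ℝ≥0) *
            aeval (fun e : Fin n × Fin n =>
              if e ∈ D then (1 : MvPolynomial (Fin n × Fin n) ℝ≥0) else X e) (facePer G)) ≤
          complexity (perPoly (Fin n) ℝ≥0 * h) + 1 :=
  -- LANDED (seat c7, wave 1, p128089).
  Summit.ValiantsHypothesis.ValiantsHypothesis.Theorems.DivisionGapPerDivisionHard.stub_erasedDescent

/-- **stub_erasedArsenal (v11; LANDED p128169).**  Statement and proof sketch in the landed file's docstring
(prose compressed in v13.1, 200 kB cap). [folklore] -/
theorem stub_erasedArsenal :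
    ∀ c κ : ℕ, ∃ d n₁ : ℕ, ∀ n ≥ n₁, ∀ (b k m : ℕ) (eR eC : BlockV b k m ≃ Fin n)
      (I : Finset (Fin b)) (D : Finset (Fin n × Fin n)), 0 < k →
      (Nat.log 2 n + d) ^ d + I.card ≤ b →
      (∀ e ∈ D, ∃ i ∈ I, eR.symm e.1 = Sum.inl i ∨
        ∃ (j : Fin b) (t : Fin k), eR.symm e.1 = Sum.inr (Sum.inl (i, j, t))) →
      ((n + 2) * (2 ^ ((Nat.log 2 n + c) ^ c) + 3)) ^ κ <
        complexity (aeval (fun e : Fin n × Fin n =>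
          if e ∈ D then (1 : MvPolynomial (Fin n × Fin n) ℝ≥0) else X e)
            (facePer (placedBlock eR eC))) :=
  -- LANDED (seat c7, wave 1, p128169).
  Summit.ValiantsHypothesis.ValiantsHypothesis.Theorems.DivisionGapPerDivisionHard.stub_erasedArsenal

/-- **stub_confinedVariation (v11; OPEN — route D, the ERASURE form of the core, pair form).**  For
every `c, d` there are `n₀` (and the witnesses below) such that for `n ≥ n₀`: every nonzero
torus-homogeneous `h` with `L(h) ≤ 2^B` and `L(per_n · h) ≤ 2^B` admits a placement of some
`G(b,k) ⊕ M₀` (`k ≥ 1`), a weight cutting it out, and a set `I` of hub rows with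
`b ≥ (log₂ n + d)^d + |I|`, such that the monomials of the top fibre of `h` AGREE on every cell of the
placed face off the paths at `I` (they may vary on those paths and anywhere off the face).  Implied by
the crux (vacuously, like A/B/C); implied by K2′ (`confinedVariation_of_singleGPart`: `I = ∅`); its
negation asks the fibre of `h` to vary on the paths at all but `polylog` hub rows of EVERY large placed
block face under EVERY admissible weight — per-multiples do (`σ - σ'` ranges over all cycles), nothing
cheap known does. -/
theorem stub_confinedVariation :
    ∀ c d : ℕ, ∃ n₀ : ℕ, ∀ n ≥ n₀, ∀ h : MvPolynomial (Fin n × Fin n) ℝ≥0,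
      h ≠ 0 → IsTorusHomogeneous h → complexity h ≤ 2 ^ ((Nat.log 2 n + c) ^ c) →
      complexity (perPoly (Fin n) ℝ≥0 * h) ≤ 2 ^ ((Nat.log 2 n + c) ^ c) →
      ∃ (b k m : ℕ) (eR eC : BlockV b k m ≃ Fin n) (w : Fin n × Fin n → ℕ)
        (I : Finset (Fin b)) (D : Finset (Fin n × Fin n)) (u : (Fin n × Fin n) →₀ ℕ),
        CutsOut w (placedBlock eR eC) ∧ 0 < k ∧ (Nat.log 2 n + d) ^ d + I.card ≤ b ∧
        (∀ e ∈ D, ∃ i ∈ I, eR.symm e.1 = Sum.inl i ∨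
          ∃ (j : Fin b) (t : Fin k), eR.symm e.1 = Sum.inr (Sum.inl (i, j, t))) ∧
        ∀ m' ∈ (topComponent w h).support, ∀ e ∈ placedBlock eR eC, e ∉ D → m' e = u e := by
  sorry

/-- K2′-type witnesses are route-D witnesses: a single `G`-part is confined variation with `I = ∅`,
`D = ∅`. [folklore] -/
theorem confinedVariation_of_singleGPart {n b k m : ℕ} (eR eC : BlockV b k m ≃ Fin n)
    (w : Fin n × Fin n → ℕ) (h : MvPolynomial (Fin n × Fin n) ℝ≥0) (u : (Fin n × Fin n) →₀ ℕ)
    (hs : HasSingleGPart (placedBlock eR eC) w h u) :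
    (∀ e ∈ (∅ : Finset (Fin n × Fin n)), ∃ i ∈ (∅ : Finset (Fin b)), eR.symm e.1 = Sum.inl i ∨
        ∃ (j : Fin b) (t : Fin k), eR.symm e.1 = Sum.inr (Sum.inl (i, j, t))) ∧
      ∀ m' ∈ (topComponent w h).support, ∀ e ∈ placedBlock eR eC,
        e ∉ (∅ : Finset (Fin n × Fin n)) → m' e = u e :=
  ⟨fun e he => absurd he (Finset.notMem_empty e), fun m' hm' e he _ => hs.2 m' hm' e he⟩

/-- **Composition, route D (v11; sorry-free modulo `stub_confinedVariation` (OPEN),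
`stub_erasedDescent`, `stub_erasedArsenal` (provable) and the landed `stub_torus`,
`stub_jssContraction`).**  Concludes the crux BY NAME: torus normal form; route D places a block face
with confined fibre variation; erased descent gives `L(x^{u'} · F_D) ≤ 2^B + 1` for the erased face
permanent `F_D`; JSS contraction strips `x^{u'}`; the erased arsenal says `F_D` is harder than that. -/
theorem PerDivisionHard_of_routeD :
    Summit.ValiantsHypothesis.ValiantsHypothesis.Theses.DivisionGap.PerDivisionHard := by
  intro c
  obtain ⟨κ, hcon⟩ := stub_jssContraction
  obtain ⟨d, n₁, hhard⟩ := stub_erasedArsenal c κ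
  obtain ⟨n₀, hD⟩ := stub_confinedVariation c d
  refine ⟨n₀ + n₁, ?_⟩
  intro n hn h hh
  obtain ⟨h', hh', htor, hle1, hle2⟩ := stub_torus n h hh
  by_contra hlt
  have hle : complexity (perPoly (Fin n) ℝ≥0 * h) + complexity h ≤
      2 ^ ((Nat.log 2 n + c) ^ c) := not_lt.mp hlt
  have hcheap : complexity h' ≤ 2 ^ ((Nat.log 2 n + c) ^ c) :=
    le_trans hle2 (le_trans (Nat.le_add_left _ _) hle)
  have hcheapPair : complexity (perPoly (Fin n) ℝ≥0 * h') ≤ 2 ^ ((Nat.log 2 n + c) ^ c) :=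
    le_trans hle1 (le_trans (Nat.le_add_right _ _) hle)
  obtain ⟨b, k, m, eR, eC, w, I, D, u, hcut, hk, hb, hconf, hagree⟩ :=
    hD n (by omega) h' hh' htor hcheap hcheapPair
  obtain ⟨u', hdesc⟩ := stub_erasedDescent n (placedBlock eR eC) D w h' u hcut hh' hagree
  set F := aeval (fun e : Fin n × Fin n =>
      if e ∈ D then (1 : MvPolynomial (Fin n × Fin n) ℝ≥0) else X e)
    (facePer (placedBlock eR eC)) with hF
  -- erased descent + cheapness: `L(x^{u'} F) ≤ 2^B + 1`
  have h1 : complexity (monomial u' (1 : ℝ≥0) * F) ≤ 2 ^ ((Nat.log 2 n + c) ^ c) + 1 :=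
    hdesc.trans (Nat.add_le_add_right hcheapPair 1)
  -- JSS contraction
  have h2 : complexity F ≤ ((n + 2) * (2 ^ ((Nat.log 2 n + c) ^ c) + 3)) ^ κ :=
    calc complexity F ≤ ((n + 2) * (complexity (monomial u' (1 : ℝ≥0) * F) + 2)) ^ κ :=
          hcon n F u'
      _ ≤ ((n + 2) * (2 ^ ((Nat.log 2 n + c) ^ c) + 3)) ^ κ :=
          Nat.pow_le_pow_left (Nat.mul_le_mul_left _ (by omega)) κ
  -- the erased block face is harder than that
  have h3 := hhard n (by omega) b k m eR eC I D hk hb hconf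
  exact absurd (lt_of_lt_of_le h3 h2) (lt_irrefl _)


/-- **The vacuous direction, once and for all (v11.1):** under the crux no cheap pair exists at any
level `c` once `n` is large — so every PAIR form of the core (K2′, A, B, C, D) is implied by the
crux, hence EQUIVALENT to it through this file (dossier v7 §1). [folklore] -/
theorem no_cheapPair_of_crux
    (H : Summit.ValiantsHypothesis.ValiantsHypothesis.Theses.DivisionGap.PerDivisionHard) :
    ∀ c : ℕ, ∃ n₀ : ℕ, ∀ n ≥ n₀, ∀ h : MvPolynomial (Fin n × Fin n) ℝ≥0,
      h ≠ 0 → complexity h ≤ 2 ^ ((Nat.log 2 n + c) ^ c) →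
      complexity (perPoly (Fin n) ℝ≥0 * h) ≤ 2 ^ ((Nat.log 2 n + c) ^ c) → False := by
  intro c
  obtain ⟨n₀, h₀⟩ := H (c + 1)
  refine ⟨n₀ + 2, fun n hn h hh hcheap hcheapPair => ?_⟩
  have hlt := h₀ n (by omega) h hh
  have hL : 1 ≤ Nat.log 2 n := Nat.log_pos (by norm_num) (by omega)
  have hB : (Nat.log 2 n + c) ^ c + 1 ≤ (Nat.log 2 n + (c + 1)) ^ (c + 1) := by
    set x := Nat.log 2 n + c with hx
    have hx1 : 1 ≤ x := by omega
    have hxc : 1 ≤ x ^ c := Nat.one_le_pow _ _ hx1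
    have hx' : Nat.log 2 n + (c + 1) = x + 1 := by omega
    rw [hx']
    calc x ^ c + 1 ≤ x ^ c * x + x ^ c := by nlinarith [Nat.mul_le_mul hxc hx1]
      _ = x ^ c * (x + 1) := by ring
      _ ≤ (x + 1) ^ c * (x + 1) := Nat.mul_le_mul_right _ (Nat.pow_le_pow_left (by omega) c)
      _ = (x + 1) ^ (c + 1) := by ring
  have hsum : complexity (perPoly (Fin n) ℝ≥0 * h) + complexity h ≤
      2 ^ ((Nat.log 2 n + (c + 1)) ^ (c + 1)) :=
    calc complexity (perPoly (Fin n) ℝ≥0 * h) + complexity h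
        ≤ 2 ^ ((Nat.log 2 n + c) ^ c) + 2 ^ ((Nat.log 2 n + c) ^ c) := Nat.add_le_add hcheapPair hcheap
      _ = 2 ^ ((Nat.log 2 n + c) ^ c + 1) := by ring
      _ ≤ 2 ^ ((Nat.log 2 n + (c + 1)) ^ (c + 1)) := Nat.pow_le_pow_right (by norm_num) hB
  exact absurd hlt (not_lt.mpr hsum)

/-- Route C's registered form is implied by the crux (vacuously). [folklore] -/
theorem stub_noRichOmnipresence_of_crux
    (H : Summit.ValiantsHypothesis.ValiantsHypothesis.Theses.DivisionGap.PerDivisionHard) :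
    ∀ c : ℕ, ∃ a c' n₀ : ℕ, ∀ n ≥ n₀, ∀ h : MvPolynomial (Fin n × Fin n) ℝ≥0,
      h ≠ 0 → IsTorusHomogeneous h → complexity h ≤ 2 ^ ((Nat.log 2 n + c) ^ c) →
      complexity (perPoly (Fin n) ℝ≥0 * h) ≤ 2 ^ ((Nat.log 2 n + c) ^ c) →
      ∃ (b k m : ℕ) (eR eC : BlockV b k m ≃ Fin n) (w : Fin n × Fin n → ℕ),
        CutsOut w (placedBlock eR eC) ∧ n ≤ b ^ a ∧
        (topComponent w h).support.card ≤ 2 ^ ((Nat.log 2 n + c') ^ c') := by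
  intro c
  obtain ⟨n₀, h₀⟩ := no_cheapPair_of_crux H c
  exact ⟨0, 0, n₀, fun n hn h hh _ hc hp => (h₀ n hn h hh hc hp).elim⟩

/-- Route D's registered form is implied by the crux (vacuously). [folklore] -/
theorem stub_confinedVariation_of_crux
    (H : Summit.ValiantsHypothesis.ValiantsHypothesis.Theses.DivisionGap.PerDivisionHard) :
    ∀ c d : ℕ, ∃ n₀ : ℕ, ∀ n ≥ n₀, ∀ h : MvPolynomial (Fin n × Fin n) ℝ≥0,
      h ≠ 0 → IsTorusHomogeneous h → complexity h ≤ 2 ^ ((Nat.log 2 n + c) ^ c) →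
      complexity (perPoly (Fin n) ℝ≥0 * h) ≤ 2 ^ ((Nat.log 2 n + c) ^ c) →
      ∃ (b k m : ℕ) (eR eC : BlockV b k m ≃ Fin n) (w : Fin n × Fin n → ℕ)
        (I : Finset (Fin b)) (D : Finset (Fin n × Fin n)) (u : (Fin n × Fin n) →₀ ℕ),
        CutsOut w (placedBlock eR eC) ∧ 0 < k ∧ (Nat.log 2 n + d) ^ d + I.card ≤ b ∧
        (∀ e ∈ D, ∃ i ∈ I, eR.symm e.1 = Sum.inl i ∨
          ∃ (j : Fin b) (t : Fin k), eR.symm e.1 = Sum.inr (Sum.inl (i, j, t))) ∧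
        ∀ m' ∈ (topComponent w h).support, ∀ e ∈ placedBlock eR eC, e ∉ D → m' e = u e := by
  intro c d
  obtain ⟨n₀, h₀⟩ := no_cheapPair_of_crux H c
  exact ⟨n₀, fun n hn h hh _ hc hp => (h₀ n hn h hh hc hp).elim⟩

/-- **stub_pathRigidity (v11.2; LANDED p129180).**  Statement and proof sketch in the landed file's docstring
(prose compressed in v13.1, 200 kB cap). [folklore] -/
theorem stub_pathRigidity :
    ∀ (b k m n : ℕ) (eR eC : BlockV b k m ≃ Fin n) (h : MvPolynomial (Fin n × Fin n) ℝ≥0)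
      (m₁ m₂ : (Fin n × Fin n) →₀ ℕ) (i j : Fin b), 0 < k → IsTorusHomogeneous h →
      m₁ ∈ h.support → m₂ ∈ h.support → (∀ e ∉ placedBlock eR eC, m₁ e = m₂ e) →
      (∃ e ∈ placedBlock eR eC,
        ((eR.symm e.1 = Sum.inl i ∧ ∃ t : Fin k, (t : ℕ) = 0 ∧ eC.symm e.2 = Sum.inr (Sum.inl (i, j, t))) ∨
          ∃ t : Fin k, eR.symm e.1 = Sum.inr (Sum.inl (i, j, t))) ∧ m₁ e ≠ m₂ e) →
      ∀ e ∈ placedBlock eR eC,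
        ((eR.symm e.1 = Sum.inl i ∧ ∃ t : Fin k, (t : ℕ) = 0 ∧ eC.symm e.2 = Sum.inr (Sum.inl (i, j, t))) ∨
          ∃ t : Fin k, eR.symm e.1 = Sum.inr (Sum.inl (i, j, t))) → m₁ e ≠ m₂ e :=
  -- LANDED (seat c7, wave 3, p129180).
  Summit.ValiantsHypothesis.ValiantsHypothesis.Theorems.DivisionGapPerDivisionHard.stub_pathRigidity

/-! ### v11.1 (lead seat c7): the FORMULA target — K2 for monotone formulas
(Prose compressed in v13.  `stub_formulaRigid` (OPEN, ∃-weight; rated "as hard as STEERED K2 restricted to formulas" after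
the one-scale-cut barrier, dossier v8 §4) ⇒ `PerFormulaDivisionHard` via `perFormulaDivisionHard_of` (formula only on the
cofactor side; Brent balancing then bounds monotone formulas WITH DIVISION for `per_n`); `stub_formulaTorus` landed.
Full text: dossier v7 §6, git history ≤ v12.5.) -/

/-- **PerFormulaDivisionHard (v11.1; the formula target, documented — concluded by
`perFormulaDivisionHard_of` modulo `stub_formulaTorus` (provable) and `stub_formulaRigid` (OPEN)).**
For every `c`, for all large `n`, every nonzero `h` has `2^{(log₂ n + c)^c} < L(per_n · h) + E(h)`,
`E =` monotone fan-in-two FORMULA size over `ℝ≥0`.  Weaker than the crux (`L ≤ E`,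
`complexity_le_formulaComplexity_holds`); new in print if proved (HY21 §6: formulas with division
for `per_n` only through `σ(DS_n)`). -/
def PerFormulaDivisionHard : Prop :=
  ∀ c : ℕ, ∃ n₀ : ℕ, ∀ n ≥ n₀, ∀ h : MvPolynomial (Fin n × Fin n) ℝ≥0, h ≠ 0 →
    2 ^ ((Nat.log 2 n + c) ^ c) <
      complexity (perPoly (Fin n) ℝ≥0 * h) + formulaComplexity h

/-- **stub_formulaTorus (v11.1; LANDED p128633).**  Statement and proof sketch in the landed file's docstring
(prose compressed in v13.1, 200 kB cap). [folklore] -/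
theorem stub_formulaTorus :
    ∀ (n : ℕ) (h : MvPolynomial (Fin n × Fin n) ℝ≥0), h ≠ 0 →
      ∃ h' : MvPolynomial (Fin n × Fin n) ℝ≥0, h' ≠ 0 ∧ IsTorusHomogeneous h' ∧
        complexity (perPoly (Fin n) ℝ≥0 * h') ≤ complexity (perPoly (Fin n) ℝ≥0 * h) ∧
        formulaComplexity h' ≤ formulaComplexity h :=
  -- LANDED (seat c7, wave 2, p128633).
  Summit.ValiantsHypothesis.ValiantsHypothesis.Theorems.DivisionGapPerDivisionHard.stub_formulaTorus

/-- **stub_formulaRigid (v11.1; OPEN — K2 for FORMULAS, `h`-alone).**  For every `c, d` and all large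
`n`: every nonzero torus-homogeneous `h` with a monotone FORMULA of size `≤ 2^{(log₂ n + c)^c}` is
RIGID on some placed block face: a placement `eR, eC` of some `G(b,k) ⊕ M₀` with
`b ≥ (log₂ n + d)^d`, a weight cutting it out, and a single `G`-part `u` of the top fibre.  NOT implied
by the crux and not implying it (its hypothesis is formula-cheapness; `per_n · h′` for a crux
counterexample is only circuit-cheap); FALSE without torus homogeneity (`∏_ρ (Σ_j x_{ρj})^N`: the
torus step kills it); true for every formula shape covered by the landed rungs (sparse, sparse
products, ΣΠΣΠ over decided pools, atomic, pair-binomial).  Research statement of dossier v7 §6. -/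
theorem stub_formulaRigid :
    ∀ c d : ℕ, ∃ n₀ : ℕ, ∀ n ≥ n₀, ∀ h : MvPolynomial (Fin n × Fin n) ℝ≥0,
      h ≠ 0 → IsTorusHomogeneous h → formulaComplexity h ≤ 2 ^ ((Nat.log 2 n + c) ^ c) →
      ∃ (b k m : ℕ) (eR eC : BlockV b k m ≃ Fin n) (w : Fin n × Fin n → ℕ)
        (u : (Fin n × Fin n) →₀ ℕ),
        CutsOut w (placedBlock eR eC) ∧ (Nat.log 2 n + d) ^ d ≤ b ∧
        HasSingleGPart (placedBlock eR eC) w h u := by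
  sorry

/-- **Composition for the formula target (v11.1; sorry-free modulo `stub_formulaRigid`; prose compressed v14).** [folklore] -/
theorem perFormulaDivisionHard_of : PerFormulaDivisionHard := by
  intro c
  obtain ⟨κ, hcon⟩ := stub_jssContraction
  obtain ⟨d, n₁, hhard⟩ := stub_blockArsenal c κ
  obtain ⟨n₀, hrig⟩ := stub_formulaRigid c d
  refine ⟨n₀ + n₁, ?_⟩
  intro n hn h hh
  obtain ⟨h', hh', htor, hle1, hle2⟩ := stub_formulaTorus n h hh
  by_contra hlt
  have hle : complexity (perPoly (Fin n) ℝ≥0 * h) + formulaComplexity h ≤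
      2 ^ ((Nat.log 2 n + c) ^ c) := not_lt.mp hlt
  have hcheap : formulaComplexity h' ≤ 2 ^ ((Nat.log 2 n + c) ^ c) :=
    le_trans hle2 (le_trans (Nat.le_add_left _ _) hle)
  have hcheapPair : complexity (perPoly (Fin n) ℝ≥0 * h') ≤ 2 ^ ((Nat.log 2 n + c) ^ c) :=
    le_trans hle1 (le_trans (Nat.le_add_right _ _) hle)
  obtain ⟨b, k, m, eR, eC, w, u, hcut, hb, hsingle⟩ := hrig n (by omega) h' hh' htor hcheap
  -- face descent + cheapness
  have h1 : complexity (monomial u (1 : ℝ≥0) * facePer (placedBlock eR eC)) ≤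
      2 ^ ((Nat.log 2 n + c) ^ c) + 1 :=
    (stub_faceDescent n (placedBlock eR eC) w h' u hcut hh' hsingle).trans
      (Nat.add_le_add_right hcheapPair 1)
  -- JSS contraction
  have h2 : complexity (facePer (placedBlock eR eC)) ≤
      ((n + 2) * (2 ^ ((Nat.log 2 n + c) ^ c) + 3)) ^ κ :=
    calc complexity (facePer (placedBlock eR eC))
        ≤ ((n + 2) * (complexity (monomial u (1 : ℝ≥0) * facePer (placedBlock eR eC)) + 2)) ^ κ :=
          hcon n (facePer (placedBlock eR eC)) u
      _ ≤ ((n + 2) * (2 ^ ((Nat.log 2 n + c) ^ c) + 3)) ^ κ :=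
          Nat.pow_le_pow_left (Nat.mul_le_mul_left _ (by omega)) κ
  -- the placed block face is harder than that
  have h3 := hhard n (by omega) b k m eR eC hb
  exact absurd (lt_of_lt_of_le h3 h2) (lt_irrefl _)

/-- The formula target is implied by the crux (`L ≤ E`), recorded so that the audit sees the
direction of strength. [folklore] -/
theorem perFormulaDivisionHard_of_perDivisionHard
    (H : Summit.ValiantsHypothesis.ValiantsHypothesis.Theses.DivisionGap.PerDivisionHard) :
    PerFormulaDivisionHard := by
  intro c
  obtain ⟨n₀, hH⟩ := H c
  refine ⟨n₀, fun n hn h hh => ?_⟩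
  have h1 := hH n hn h hh
  have h2 : complexity h ≤ formulaComplexity h := complexity_le_formulaComplexity_holds h
  omega


/-! ### v12 (lead seat c8, prover-line-stmt-ValiantsHypothesis-5065-c8-0, 2026-08-16): the GENERIC-CUT BARRIER and STEERING
(Prose compressed in v13 — 200 kB cap.  Content: the walk step `step(R; Cᵢₙ, Cₒᵤₜ)` with bookkeeping row `ρ₀` / default
column `a₀` has walk-independent margins (`stub_walkStepMargins`), so closed-walk sums are torus-homogeneous and cheap
(`O(n⁴L)` circuits, `n^{O(log L)}` formulas); reversal keeps the bookkeeping and flips the face content by the walk's net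
flow (`stub_walkBookkeepingTwin`, `stub_walkTwin`), hence under every ONE-SCALE generic cut `h_walk = ∏ W_L` is non-rigid at
every placement (exact DP census 82/82 + kit j021007/j021008): the documented h-alone targets T1 `EdgeEntropyAlone`, T3
`NoGateTieAlone` and the one-scale formula reading T9 are FALSE, every registered pair form / landed rung / `stub_formulaRigid`
is untouched.  STEERING: digits magnetise (`stub_magnetRigid`), PM-inert lures relocate (`stub_lureCutsOut`); the priced cut
`stub_pricedCut` is the interface.  Full text: `NegativeNotes-genericCut-walkTwins.md`, dossier v8, git history ≤ v12.5.) -/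

/-- **stub_walkStepMargins (v12; LANDED p131522).**  Statement and proof sketch in the landed file's docstring
(prose compressed in v13.1, 200 kB cap). [folklore] -/
theorem stub_walkStepMargins :
    ∀ (n : ℕ) (ρ₀ a₀ R Cin Cout : Fin n) (e : (Fin n × Fin n) →₀ ℕ),
      e = Finsupp.single (R, Cin) 1 + Finsupp.single (R, Cout) 2 +
          ∑ R' ∈ Finset.univ.erase R, Finsupp.single (R', a₀) 3 +
          ∑ C ∈ Finset.univ.erase Cin, Finsupp.single (ρ₀, C) 1 +
          ∑ C ∈ Finset.univ.erase Cout, Finsupp.single (ρ₀, C) 2 →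
      (∀ r : Fin n, rowDegrees e r = if r = ρ₀ then 3 * n else 3) ∧
      (∀ c : Fin n, Finsupp.mapDomain Prod.snd e c = if c = a₀ then 3 * n else 3) :=
  -- LANDED (seat c8, wave 1, p131522).
  Summit.ValiantsHypothesis.ValiantsHypothesis.Theorems.DivisionGapPerDivisionHard.stub_walkStepMargins

/-- **stub_walkBookkeepingTwin (v12; LANDED p131498).**  Statement and proof sketch in the landed file's docstring
(prose compressed in v13.1, 200 kB cap). [folklore] -/
theorem stub_walkBookkeepingTwin :
    ∀ (n L : ℕ) (ρ₀ a₀ : Fin n) (rows rows' : Fin L → Fin n) (cin cout cin' cout' m : Fin L → Fin n)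
      (σ τ₁ τ₂ τ₃ τ₄ : Equiv.Perm (Fin L)),
      (∀ t, rows' t = rows (σ t)) → (∀ t, cin' t = m (τ₁ t)) → (∀ t, cout' t = m (τ₂ t)) →
      (∀ t, cin t = m (τ₃ t)) → (∀ t, cout t = m (τ₄ t)) →
      (∑ t : Fin L, (∑ R' ∈ Finset.univ.erase (rows t), Finsupp.single (R', a₀) 3 +
          ∑ C ∈ Finset.univ.erase (cin t), Finsupp.single (ρ₀, C) 1 +
          ∑ C ∈ Finset.univ.erase (cout t), Finsupp.single (ρ₀, C) 2) : (Fin n × Fin n) →₀ ℕ) =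
      ∑ t : Fin L, (∑ R' ∈ Finset.univ.erase (rows' t), Finsupp.single (R', a₀) 3 +
          ∑ C ∈ Finset.univ.erase (cin' t), Finsupp.single (ρ₀, C) 1 +
          ∑ C ∈ Finset.univ.erase (cout' t), Finsupp.single (ρ₀, C) 2) :=
  -- LANDED (seat c8, wave 1, p131498).
  Summit.ValiantsHypothesis.ValiantsHypothesis.Theorems.DivisionGapPerDivisionHard.stub_walkBookkeepingTwin

/-- **stub_lureCutsOut (v12; LANDED p131500).**  Statement and proof sketch in the landed file's docstring
(prose compressed in v13.1, 200 kB cap). [folklore] -/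
theorem stub_lureCutsOut :
    ∀ (b k m n : ℕ) (eR eC : BlockV b k m ≃ Fin n) (P Q : Finset (Fin m)) (W : ℕ)
      (w : Fin n × Fin n → ℕ), Disjoint P Q →
      (∀ e ∈ placedBlock eR eC, w e = W) →
      (∀ p ∈ P, ∀ q ∈ Q, w (eR (Sum.inr (Sum.inr p)), eC (Sum.inr (Sum.inr q))) = W) →
      (∀ e ∉ placedBlock eR eC,
        (¬ ∃ p ∈ P, ∃ q ∈ Q, e = (eR (Sum.inr (Sum.inr p)), eC (Sum.inr (Sum.inr q)))) → w e < W) →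
      CutsOut w (placedBlock eR eC) :=
  -- LANDED (seat c8, wave 1, p131500).
  Summit.ValiantsHypothesis.ValiantsHypothesis.Theorems.DivisionGapPerDivisionHard.stub_lureCutsOut


/-! ### v12.2 (lead seat c8): the walk sum as a NAMED tree object (`Theorems/DivisionGapPerDivisionHardWalkDefs.lean`,
p131822: `walkStep`, `IsClosedNBWalk`, `walkExponent`, `closedWalkSum`, `walkStep_margins`) — torus homogeneity and
the reversal-twin identity become theorems about `closedWalkSum` / `walkExponent`. -/

/-- **stub_closedWalkSum_torus (v12.2; LANDED p132087).**  Statement and proof sketch in the landed file's docstring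
(prose compressed in v13.1, 200 kB cap). [folklore] -/
theorem stub_closedWalkSum_torus :
    ∀ (n L : ℕ) (R₀ ρ₀ a₀ : Fin n), IsTorusHomogeneous (closedWalkSum n L R₀ ρ₀ a₀) :=
  -- LANDED (seat c8, wave 2, p132087).
  Summit.ValiantsHypothesis.ValiantsHypothesis.Theorems.DivisionGapPerDivisionHard.stub_closedWalkSum_torus

/-- **stub_walkTwin (v12.2; LANDED p132441).**  Statement and proof sketch in the landed file's docstring
(prose compressed in v13.1, 200 kB cap). [folklore] -/
theorem stub_walkTwin :
    ∀ (n L : ℕ) (R₀ ρ₀ a₀ : Fin n) (rows rows' : Fin L → Fin n) (cols cols' : Fin (L + 1) → Fin n),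
      2 ≤ L → IsClosedNBWalk L R₀ rows cols →
      (∀ t : Fin L, t.val = 0 → rows' t = rows t) →
      (∀ t t' : Fin L, t.val ≠ 0 → t.val + t'.val = L → rows' t = rows t') →
      (∀ t t₁ : Fin (L + 1), t.val = 0 → t₁.val = 1 → cols' t = cols t₁) →
      (∀ t t' : Fin (L + 1), t.val ≠ 0 → t.val + t'.val = L + 1 → cols' t = cols t') →
      IsClosedNBWalk L R₀ rows' cols' ∧
        walkExponent ρ₀ a₀ rows cols + ∑ t : Fin L, Finsupp.single (rows t, cols t.castSucc) 1 =
          walkExponent ρ₀ a₀ rows' cols' + ∑ t : Fin L, Finsupp.single (rows t, cols t.succ) 1 :=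
  -- LANDED (seat c8, wave 2, p132441).
  Summit.ValiantsHypothesis.ValiantsHypothesis.Theorems.DivisionGapPerDivisionHard.stub_walkTwin


/-! ### v12.3 (lead seat c8): the PRICED CUT — the interface between steering and the line's vocabulary

Every steered weight of dossier v8 §3 is an instance of ONE lemma: on a placed `G(b,k) ⊕ M₀` with lure
rectangle `P × Q` (disjoint padding index sets; `P = Q = ∅` allowed) and any PRICES `u ≥ 1` on the remaining
("off") cells, the weight `w = B` on face and lure cells, `w = B − u` off them (`B > max u`) CUTS OUT the face
(`stub_lureCutsOut`) and its top fibre of any equal-degree `h` is exactly the set of monomials of `h` minimising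
the price `Σ_off u(e)·m(e)`.  So a priced rigidity proof only has to exhibit prices whose minimisers agree on the
face; `stub_genericCut` is the one-level instance `u = B^rank`. -/

/-- **stub_pricedCut (v12.3; LANDED p132571).**  Statement and proof sketch in the landed file's docstring
(prose compressed in v13.1, 200 kB cap). [folklore] -/
theorem stub_pricedCut :
    ∀ (b k m n : ℕ) (eR eC : BlockV b k m ≃ Fin n) (P Q : Finset (Fin m)) (u : Fin n × Fin n → ℕ)
      (h : MvPolynomial (Fin n × Fin n) ℝ≥0), Disjoint P Q →
      (∀ e : Fin n × Fin n, e ∉ placedBlock eR eC →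
        (¬ ∃ p ∈ P, ∃ q ∈ Q, e = (eR (Sum.inr (Sum.inr p)), eC (Sum.inr (Sum.inr q)))) → 1 ≤ u e) →
      (∀ m₁ ∈ h.support, ∀ m₂ ∈ h.support, m₁.degree = m₂.degree) →
      ∃ w : Fin n × Fin n → ℕ, CutsOut w (placedBlock eR eC) ∧
        ∀ mo : (Fin n × Fin n) →₀ ℕ, mo ∈ (topComponent w h).support ↔
          (mo ∈ h.support ∧ ∀ mo' ∈ h.support,
            (∑ e ∈ (Finset.univ : Finset (Fin n × Fin n)).filter (fun e => e ∉ placedBlock eR eC ∧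
                ¬ ∃ p ∈ P, ∃ q ∈ Q, e = (eR (Sum.inr (Sum.inr p)), eC (Sum.inr (Sum.inr q)))),
                u e * mo e) ≤
            ∑ e ∈ (Finset.univ : Finset (Fin n × Fin n)).filter (fun e => e ∉ placedBlock eR eC ∧
                ¬ ∃ p ∈ P, ∃ q ∈ Q, e = (eR (Sum.inr (Sum.inr p)), eC (Sum.inr (Sum.inr q)))),
                u e * mo' e) :=
  -- LANDED (seat c8, wave 3, p132571).
  Summit.ValiantsHypothesis.ValiantsHypothesis.Theorems.DivisionGapPerDivisionHard.stub_pricedCut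


/-! ### v12.4 (lead seat c8): the MAGNET — the first certified steering (registered for cycle 2's wave)

Digits defeat the walk sums because unequal rewards magnetise (dossier v8 §3–§4b; census: ONE random digit order leaves
0/2548 factors of `h_walk` non-rigid at `n = 14`).  The cleanest instance, provable now: four magnet prices force the optimal
closed walk of `closedWalkSum n L R₀ ρ₀ a₀` to be ONE explicit bouncing walk. -/

/-- **stub_magnetRigid (v12.4; LANDED p151018).**  Statement and proof sketch in the landed file's docstring
(prose compressed in v13.1, 200 kB cap). [folklore] -/
theorem stub_magnetRigid :
    ∀ (b k m n L : ℕ) (eR eC : BlockV b k m ≃ Fin n) (R₀ ρ₀ a₀ : Fin n),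
      Even L → 2 ≤ L → 8 ≤ m → R₀ ≠ ρ₀ →
      ∃ u : Fin n × Fin n → ℕ, (∀ e : Fin n × Fin n, e ∉ placedBlock eR eC → 1 ≤ u e) ∧
        ∀ mo ∈ (closedWalkSum n L R₀ ρ₀ a₀).support, ∀ mo' ∈ (closedWalkSum n L R₀ ρ₀ a₀).support,
          (∀ x ∈ (closedWalkSum n L R₀ ρ₀ a₀).support,
            (∑ e ∈ (Finset.univ : Finset (Fin n × Fin n)).filter (fun e => e ∉ placedBlock eR eC), u e * mo e) ≤
              ∑ e ∈ (Finset.univ : Finset (Fin n × Fin n)).filter (fun e => e ∉ placedBlock eR eC), u e * x e) →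
          (∀ x ∈ (closedWalkSum n L R₀ ρ₀ a₀).support,
            (∑ e ∈ (Finset.univ : Finset (Fin n × Fin n)).filter (fun e => e ∉ placedBlock eR eC), u e * mo' e) ≤
              ∑ e ∈ (Finset.univ : Finset (Fin n × Fin n)).filter (fun e => e ∉ placedBlock eR eC), u e * x e) →
          mo = mo' :=
  -- LANDED (seat c8, wave 4 + lead assembly, p151018; helpers p149930, p150490).
  Summit.ValiantsHypothesis.ValiantsHypothesis.Theorems.DivisionGapPerDivisionHard.stub_magnetRigid


/-- **The steering pipeline end to end (v12.4 composition, sorry-free; prose compressed v14 — see `Theorems/DivisionGapPerDivisionHardMagnetSingleGPart.lean`).** [folklore] -/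
theorem magnet_hasSingleGPart (b k m n L : ℕ) (eR eC : BlockV b k m ≃ Fin n) (R₀ ρ₀ a₀ : Fin n)
    (hL : Even L) (h2 : 2 ≤ L) (hm : 8 ≤ m) (hne : R₀ ≠ ρ₀) (hW : closedWalkSum n L R₀ ρ₀ a₀ ≠ 0) :
    ∃ (w : Fin n × Fin n → ℕ) (u : (Fin n × Fin n) →₀ ℕ),
      CutsOut w (placedBlock eR eC) ∧ HasSingleGPart (placedBlock eR eC) w (closedWalkSum n L R₀ ρ₀ a₀) u :=
  -- (v15.1 compression) LANDED in Theorems/DivisionGapPerDivisionHardMagnetSingleGPart.lean; in-skeleton proof: git history (≤ v15.0).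
  Summit.ValiantsHypothesis.ValiantsHypothesis.Theorems.DivisionGapPerDivisionHard.magnet_hasSingleGPart b k m n L eR eC R₀ ρ₀ a₀ hL h2 hm hne hW


/-! ### v12.5 (lead seat c8, cycle 1 close): landing the magnet — two small registered markers so that the helper files
of the `stub_magnetRigid` proof (`…StubMagnetRigidAux.lean`: pairing identity (★), face facts, choices, prices;
`…StubMagnetRigidKey.lean`: the lexicographic key lemma) attach to the crux. -/

/-- **stub_magnetFacePad (v12.5 marker; LANDED p149930).**  The face cells of a padding row `eR (pad t)` are exactly
its matching cell `(eR (pad t), eC (pad t))` (`lure_blockAdj_pad_iff`). [folklore] -/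
theorem stub_magnetFacePad :
    ∀ (b k m n : ℕ) (eR eC : BlockV b k m ≃ Fin n) (t : Fin m) (C : Fin n),
      (eR (Sum.inr (Sum.inr t)), C) ∈ placedBlock eR eC ↔ C = eC (Sum.inr (Sum.inr t)) :=
  -- LANDED (p149930, `…StubMagnetRigidAux.lean`).
  Summit.ValiantsHypothesis.ValiantsHypothesis.Theorems.DivisionGapPerDivisionHard.stub_magnetFacePad

/-- **stub_magnetSumPairs (v12.5 marker; LANDED p150490).**  Pair grouping of a sum over an even range:
`Σ_{t<2H} f t = Σ_{j<H} (f(2j) + f(2j+1))`. [folklore] -/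
theorem stub_magnetSumPairs :
    ∀ (f : ℕ → ℕ) (H : ℕ), ∑ t ∈ Finset.range (2 * H), f t = ∑ j ∈ Finset.range H, (f (2 * j) + f (2 * j + 1)) :=
  -- LANDED (p150490, `…StubMagnetRigidKey.lean`).
  Summit.ValiantsHypothesis.ValiantsHypothesis.Theorems.DivisionGapPerDivisionHard.stub_magnetSumPairs


/-- **stub_magnetSingleGPart (v12.5; PROVED here from the landed stubs — registered so that its standalone tree copy
`Theorems/DivisionGapPerDivisionHardMagnetSingleGPart.lean` attaches to the crux).**  The steering pipeline end to end:
for every placement with `m ≥ 8` and every nonzero closed-walk sum there are an ADMISSIBLE weight `w` (cuts out the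
placed face) and an exponent `u` with `HasSingleGPart (placedBlock eR eC) w (closedWalkSum n L R₀ ρ₀ a₀) u`
(`stub_magnetRigid` p151018 + `stub_pricedCut` p132571 + `stub_closedWalkSum_torus` p132087). [folklore] -/
theorem stub_magnetSingleGPart :
    ∀ (b k m n L : ℕ) (eR eC : BlockV b k m ≃ Fin n) (R₀ ρ₀ a₀ : Fin n),
      Even L → 2 ≤ L → 8 ≤ m → R₀ ≠ ρ₀ → closedWalkSum n L R₀ ρ₀ a₀ ≠ 0 →
      ∃ (w : Fin n × Fin n → ℕ) (u : (Fin n × Fin n) →₀ ℕ),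
        CutsOut w (placedBlock eR eC) ∧ HasSingleGPart (placedBlock eR eC) w (closedWalkSum n L R₀ ρ₀ a₀) u :=
  -- (v15.1 compression) LANDED in Theorems/DivisionGapPerDivisionHardMagnetSingleGPart.lean; in-skeleton proof: git history (≤ v15.0).
  Summit.ValiantsHypothesis.ValiantsHypothesis.Theorems.DivisionGapPerDivisionHard.stub_magnetSingleGPart


/-! ### v13 (lead seat c9, prover-line-stmt-ValiantsHypothesis-5065-c9-0, 2026-08-17): the COLUMN-CONTENT rung —
monotone rank across ONE balanced row cut
(Prose: dossier v9, `Lines/pair-descent-jss-endpoint-k2-dossier-v9.md`.  `V_A(h)` := the set of `A`-column-content vectors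
`(Σ_{r∈A} m(r,c))_c` of the monomials of `h` — Nisan's rank across the row cut `(A, Aᶜ)`, support version; an ALTERNATING
placement (internal rows of every path alternate `A`/`Aᶜ`) makes the `A`-column-sums of every nonzero circulation nonzero on
`k-1` core columns, so counting over pairs of rank classes gives a twin-free placement.  All stubs LANDED; rung files
`Theorems/DivisionGapPerDivisionHardColContent{,Ext}.lean`.) -/

/-- **stub_altRowEquiv (v13; LANDED p154909).**  An alternating row labelling exists (internal row `(i,j,t)` in `A` iff
`t` even) when `A` and `Aᶜ` have `≥ b + b²k` elements; statement and proof sketch in the landed file's docstring. [folklore] -/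
theorem stub_altRowEquiv :
    ∀ (b k m n : ℕ) (A : Finset (Fin n)), b + b * (b * k) + m = n →
      b + b * (b * k) ≤ A.card → b + b * (b * k) ≤ n - A.card →
      ∃ eR : BlockV b k m ≃ Fin n,
        ∀ (i j : Fin b) (t : Fin k), eR (Sum.inr (Sum.inl (i, j, t))) ∈ A ↔ (t : ℕ) % 2 = 0 :=
  -- LANDED (seat c9, wave 1, p154909).
  Summit.ValiantsHypothesis.ValiantsHypothesis.Theorems.DivisionGapPerDivisionHard.stub_altRowEquiv

/-- **stub_altFlow (v13; LANDED p155050).  ALTERNATION DETECTS CIRCULATIONS:** the `A`-column-sums of a nonzero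
circulation of an alternately placed block graph are nonzero on `≥ k-1` columns, none padding; details in the landed file. [folklore] -/
theorem stub_altFlow :
    ∀ (b k m n : ℕ) (eR eC : BlockV b k m ≃ Fin n) (A : Finset (Fin n)) (D : Fin n × Fin n → ℤ), 0 < k →
      (∀ e, D e ≠ 0 → e ∈ placedBlock eR eC) → (∀ r, ∑ c, D (r, c) = 0) → (∀ c, ∑ r, D (r, c) = 0) →
      (∀ (i j : Fin b) (t : Fin k), eR (Sum.inr (Sum.inl (i, j, t))) ∈ A ↔ (t : ℕ) % 2 = 0) →
      (∃ e, D e ≠ 0) →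
      k - 1 ≤ (Finset.univ.filter fun c : Fin n => ∑ r ∈ A, D (r, c) ≠ 0).card ∧
        ∀ (c : Fin n) (u : Fin m), ∑ r ∈ A, D (r, c) ≠ 0 → eC.symm c ≠ Sum.inr (Sum.inr u) :=
  -- LANDED (seat c9, wave 1, p155050).
  Summit.ValiantsHypothesis.ValiantsHypothesis.Theorems.DivisionGapPerDivisionHard.stub_altFlow

/-- **stub_torusSplit (v13; LANDED p155024).**  The torus normal form WITHIN a row-split class `Σ_{t<W} f_t(rows A)·g_t(rows Aᶜ)`
has at most `W` distinct `A`-column contents; details in the landed file. [folklore] -/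
theorem stub_torusSplit :
    ∀ (n W : ℕ) (A : Finset (Fin n)) (f g : Fin W → MvPolynomial (Fin n × Fin n) ℝ≥0),
      ∑ t, f t * g t ≠ 0 →
      (∀ t, ∀ mm ∈ (f t).support, ∀ e ∈ mm.support, e.1 ∈ A) →
      (∀ t, ∀ mm ∈ (g t).support, ∀ e ∈ mm.support, e.1 ∉ A) →
      ∃ h' : MvPolynomial (Fin n × Fin n) ℝ≥0, h' ≠ 0 ∧ IsTorusHomogeneous h' ∧
        (h'.support.image fun (mm : (Fin n × Fin n) →₀ ℕ) (cc : Fin n) => ∑ r ∈ A, mm (r, cc)).card ≤ W ∧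
        complexity (perPoly (Fin n) ℝ≥0 * h') ≤ complexity (perPoly (Fin n) ℝ≥0 * ∑ t, f t * g t) ∧
        complexity h' ≤ complexity (∑ t, f t * g t) :=
  -- LANDED (seat c9, wave 1, p155024).
  Summit.ValiantsHypothesis.ValiantsHypothesis.Theorems.DivisionGapPerDivisionHard.stub_torusSplit

/-- **stub_colContentRigid (v13; LANDED p155460 — the lead's stub).**  K2 for cofactors with `≤ 2^{(log₂ n+c)^c}` distinct
`A`-column contents on a balanced row set `A`: rows alternate (`stub_altRowEquiv`), core columns by counting over pairs of values,
generic cut, `stub_altFlow`; details in the landed file. [folklore] -/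
theorem stub_colContentRigid :
    ∀ c d : ℕ, ∃ n₀ : ℕ, ∀ n ≥ n₀, ∀ h : MvPolynomial (Fin n × Fin n) ℝ≥0,
      h ≠ 0 → IsTorusHomogeneous h → ∀ A : Finset (Fin n), n ≤ 4 * A.card → 4 * A.card ≤ 3 * n →
      (h.support.image fun (mm : (Fin n × Fin n) →₀ ℕ) (cc : Fin n) => ∑ r ∈ A, mm (r, cc)).card ≤
          2 ^ ((Nat.log 2 n + c) ^ c) →
      ∃ (b k m : ℕ) (eR eC : BlockV b k m ≃ Fin n) (w : Fin n × Fin n → ℕ)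
        (u : (Fin n × Fin n) →₀ ℕ),
        (Nat.log 2 n + d) ^ d ≤ b ∧ CutsOut w (placedBlock eR eC) ∧
          HasSingleGPart (placedBlock eR eC) w h u :=
  -- LANDED (seat c9, lead, p155460).
  Summit.ValiantsHypothesis.ValiantsHypothesis.Theorems.DivisionGapPerDivisionHard.stub_colContentRigid

-- (v15 compression) `perDivisionHard_colContent_of` — LANDED as Theorems/DivisionGapPerDivisionHardColContent.lean (p156844, `perDivisionHard_colContent`);
-- in-skeleton proof: git history (≤ v14.2).

-- (v15 compression) `perDivisionHard_rowSplit_of` — LANDED as Theorems/DivisionGapPerDivisionHardColContent.lean (p156844, `perDivisionHard_rowSplit`);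
-- in-skeleton proof: git history (≤ v14.2).

/-! ### v13.1 (lead seat c9): the column-content rung at SUBEXPONENTIAL rank, and row-ROABPs literally

Three provable extensions of v13.  (a) `stub_colContentSubexpRigid`: `stub_colContentRigid` with long subdivision
paths (`k = n/(16q²)`, as `stub_subexpRigid` is to `stub_sparseRigid`): rank `|V_A(h)| ≤ 2^{n/(log₂ n+e)^e}` across one
balanced row cut suffices — within a polylogarithmic factor in the exponent of the permanent's own rank `C(n,n/2)` across
every balanced row cut.  (b) `stub_matrixSplit`: an entry of a product `P₁ ⋯ P_ℓ · Q₁ ⋯ Q_ℓ'` of `W × W` matrices of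
polynomials, the `P`'s in the variables of the rows of `A` and the `Q`'s in the other rows (a row-ROABP of width `W` read
in any order whose first part exhausts `A`), is a row-split sum `Σ_{s<W} f_s · g_s` — so `perDivisionHard_rowSplit_of`
applies (`perDivisionHard_roabp_of`).  (c) `stub_transposePair`: transposition is free for the pair, so the column-cut
twin `perDivisionHard_rowContent_of` (few `B`-ROW contents on a balanced COLUMN set `B`) follows from (v13). -/

/-- **stub_colContentSubexpRigid (v13.1; LANDED p157212).**  The same at SUBEXPONENTIAL rank `≤ 2^{n/(log₂ n+e)^e}` (long
subdivision paths `k = n/(16q²)`); details in the landed file. [folklore] -/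
theorem stub_colContentSubexpRigid :
    ∀ d : ℕ, ∃ e n₀ : ℕ, ∀ n ≥ n₀, ∀ h : MvPolynomial (Fin n × Fin n) ℝ≥0,
      h ≠ 0 → IsTorusHomogeneous h → ∀ A : Finset (Fin n), n ≤ 4 * A.card → 4 * A.card ≤ 3 * n →
      (h.support.image fun (mm : (Fin n × Fin n) →₀ ℕ) (cc : Fin n) => ∑ r ∈ A, mm (r, cc)).card ≤
          2 ^ (n / (Nat.log 2 n + e) ^ e) →
      ∃ (b k m : ℕ) (eR eC : BlockV b k m ≃ Fin n) (w : Fin n × Fin n → ℕ)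
        (u : (Fin n × Fin n) →₀ ℕ),
        (Nat.log 2 n + d) ^ d ≤ b ∧ CutsOut w (placedBlock eR eC) ∧
          HasSingleGPart (placedBlock eR eC) w h u :=
  -- LANDED (seat c9, wave 2, p157212).
  Summit.ValiantsHypothesis.ValiantsHypothesis.Theorems.DivisionGapPerDivisionHard.stub_colContentSubexpRigid

-- (v15 compression) `perDivisionHard_colContentSubexp_of` — LANDED as Theorems/DivisionGapPerDivisionHardColContentExt.lean (p157525, `perDivisionHard_colContentSubexp`);
-- in-skeleton proof: git history (≤ v14.2).

/-- **stub_matrixSplit (v13.1; LANDED p157155).  Row-ROABPs are row-split sums.**  If every entry of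
every matrix of the list `Ms₁` is a polynomial in the variables `x_(r,c)` with `r ∈ A`, and every entry of every matrix
of `Ms₂` one in the variables with `r ∉ A`, then the `(s₀, t₀)` entry of `Ms₁.prod * Ms₂.prod` is `Σ_s f_s · g_s` with
`f_s := Ms₁.prod s₀ s` in the `A`-row variables and `g_s := Ms₂.prod s t₀` in the others (`Matrix.mul_apply`; the
variable constraint is preserved by matrix products: induction on the list with `Matrix.mul_apply`, supports of sums
and products — `MvPolynomial.support_mul`, `MvPolynomial.support_add`/`Finsupp.support_finset_sum`, `Finset.mem_add` —
or via `MvPolynomial.vars`/`MvPolynomial.supported`). [folklore] -/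
theorem stub_matrixSplit :
    ∀ (n W : ℕ) (A : Finset (Fin n))
      (Ms₁ Ms₂ : List (Matrix (Fin W) (Fin W) (MvPolynomial (Fin n × Fin n) ℝ≥0))) (s₀ t₀ : Fin W),
      (∀ M ∈ Ms₁, ∀ a b, ∀ mm ∈ (M a b).support, ∀ e ∈ mm.support, e.1 ∈ A) →
      (∀ M ∈ Ms₂, ∀ a b, ∀ mm ∈ (M a b).support, ∀ e ∈ mm.support, e.1 ∉ A) →
      ∃ f g : Fin W → MvPolynomial (Fin n × Fin n) ℝ≥0,
        (Ms₁.prod * Ms₂.prod) s₀ t₀ = ∑ s, f s * g s ∧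
        (∀ s, ∀ mm ∈ (f s).support, ∀ e ∈ mm.support, e.1 ∈ A) ∧
        (∀ s, ∀ mm ∈ (g s).support, ∀ e ∈ mm.support, e.1 ∉ A) :=
  -- LANDED (seat c9, wave 2, p157155).
  Summit.ValiantsHypothesis.ValiantsHypothesis.Theorems.DivisionGapPerDivisionHard.stub_matrixSplit

-- (v15 compression) `perDivisionHard_roabp_of` — LANDED as Theorems/DivisionGapPerDivisionHardColContentExt.lean (p157525, `perDivisionHard_roabp`);
-- in-skeleton proof: git history (≤ v14.2).

/-- **stub_transposePair (v13.1; LANDED p157259).  Transposition is free for the pair.**  Renaming the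
variables along `Prod.swap` (`x_(r,c) ↦ x_(c,r)`) fixes `per_n` (reindex the permutation sum by `σ ↦ σ⁻¹`;
`Matrix.permanent_transpose`) and never increases monotone complexity (`complexity_rename_le_holds'`, any map), so
`L(per_n · hᵀ) ≤ L(per_n · h)` (`rename` is a ring map: `map_mul`) and `L(hᵀ) ≤ L(h)`; and the monomials of `hᵀ` are the
transposes of those of `h` (`MvPolynomial.support_rename_of_injective`). [folklore] -/
theorem stub_transposePair :
    ∀ (n : ℕ) (h : MvPolynomial (Fin n × Fin n) ℝ≥0),
      complexity (perPoly (Fin n) ℝ≥0 * rename (Prod.swap : Fin n × Fin n → Fin n × Fin n) h) ≤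
          complexity (perPoly (Fin n) ℝ≥0 * h) ∧
        complexity (rename (Prod.swap : Fin n × Fin n → Fin n × Fin n) h) ≤ complexity h ∧
        (rename (Prod.swap : Fin n × Fin n → Fin n × Fin n) h).support =
          h.support.image (Finsupp.mapDomain Prod.swap) :=
  -- LANDED (seat c9, wave 2, p157259).
  Summit.ValiantsHypothesis.ValiantsHypothesis.Theorems.DivisionGapPerDivisionHard.stub_transposePair

-- (v15 compression) `perDivisionHard_rowContent_of` — LANDED as Theorems/DivisionGapPerDivisionHardColContentExt.lean (p157525, `perDivisionHard_rowContent`);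
-- in-skeleton proof: git history (≤ v14.2).

/-! ### v14 (lead seat c9, cycle 3): the CELL-CONTENT rung — monotone rank across an ARBITRARY balanced partition of the
variables (T12 of dossier v9, made DETERMINISTIC)

For a cell set `Y ⊆ [n]²` put `Φ_Y(m) := (rowContent_Y(m), colContent_Y(m))`, `rowContent_Y(m)(r) := Σ_{c : (r,c) ∈ Y} m(r,c)`,
`colContent_Y(m)(c) := Σ_{r : (r,c) ∈ Y} m(r,c)`; a torus-homogeneous `h = Σ_{t<W} f_t(x_Y) · g_t(x_{Yᶜ})` has
`|Φ_Y(supp h)| ≤ W` (Nisan–Raz rank across the partition `(Y, Yᶜ)`).  THE RUNG (`perDivisionHard_cellContent_of`): if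
`n²/4 ≤ |Y| ≤ 3n²/4` and `|Φ_Y(supp h)| ≤ 2^{(log₂ n+c)^c}` then `2^{(log₂ n+c)^c} < L(per_n·h) + L(h)`; residual: full rank
across EVERY balanced partition of the variables — Raz's hypothesis verbatim.  Mechanism (no probability): a column `c` is
LIVE if it has more than `n/64` cells in `Y` and more than `n/64` outside; by double counting, a balanced `Y` has `≥ n/8`
live columns or `≥ n/8` live rows (`stub_heavyLines`).  Column mode: choose the core COLUMN set inside the live columns by
the landed union bound (pairs of `colContent_Y`-values), label the columns (`exists_blockEquiv`), and choose the ROWS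
GREEDILY path by path: row `(i,j,t+1)` is an unused row whose cell in the (live!) column `(i,j,t+1)` has the colour
opposite to the cell of row `(i,j,t)` in that column (`stub_greedyRows`: fewer than `n/64` rows are ever used, a live
column has more than that of each colour); then `Y` SPLITS the two path cells of every internal column, so the
`colContent_Y` of a nonzero circulation is nonzero on the `k-1` later internal columns of a flow-carrying path
(`stub_splitFlow`, the `Y`-version of `stub_altFlow`), all core columns — excluded by the count (`stub_cellContentRigid`).
Row mode: transpose (`stub_transposePair`).  For `Y = A × [n]` this is v13 (every column is live; the greedy row choice
is the alternation). -/

/-- **stub_heavyLines (v14; LANDED p158863).**  A balanced cell set (`n² ≤ 4|Y| ≤ 3n²`) has `≥ n/8` live columns or `≥ n/8`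
live rows (`> N` cells of each colour, `64N ≤ n`); one double count, details in the landed file. [folklore] -/
theorem stub_heavyLines :
    ∀ (n N : ℕ) (Y : Finset (Fin n × Fin n)), n * n ≤ 4 * Y.card → 4 * Y.card ≤ 3 * (n * n) → 64 * N ≤ n → 0 < n →
      n ≤ 8 * (Finset.univ.filter fun c : Fin n =>
          N < (Finset.univ.filter fun r : Fin n => (r, c) ∈ Y).card ∧
          N < (Finset.univ.filter fun r : Fin n => (r, c) ∉ Y).card).card ∨
      n ≤ 8 * (Finset.univ.filter fun r : Fin n =>
          N < (Finset.univ.filter fun c : Fin n => (r, c) ∈ Y).card ∧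
          N < (Finset.univ.filter fun c : Fin n => (r, c) ∉ Y).card).card :=
  -- LANDED (seat c9, wave 3, p158863).
  Summit.ValiantsHypothesis.ValiantsHypothesis.Theorems.DivisionGapPerDivisionHard.stub_heavyLines

/-- **stub_greedyRows (v14; LANDED p158261).**  The GREEDY placement of column mode (core/internal columns in a live set `S`,
rows chosen so that `Y` splits the two path cells of every internal column); details in the landed file. [folklore] -/
theorem stub_greedyRows :
    ∀ (b k m n : ℕ) (Y : Finset (Fin n × Fin n)) (S : Finset (Fin n)),
      S.card = b + b * (b * k) → b + b * (b * k) + m = n →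
      (∀ c ∈ S, b + b * (b * k) < (Finset.univ.filter fun r : Fin n => (r, c) ∈ Y).card ∧
        b + b * (b * k) < (Finset.univ.filter fun r : Fin n => (r, c) ∉ Y).card) →
      ∃ eR eC : BlockV b k m ≃ Fin n,
        (∀ i, eC (Sum.inl i) ∈ S) ∧ (∀ p, eC (Sum.inr (Sum.inl p)) ∈ S) ∧
        ∀ (i j : Fin b) (t : ℕ) (ht : t + 1 < k),
          ((eR (Sum.inr (Sum.inl (i, j, ⟨t, Nat.lt_of_succ_lt ht⟩))), eC (Sum.inr (Sum.inl (i, j, ⟨t + 1, ht⟩)))) ∈ Y ↔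
            (eR (Sum.inr (Sum.inl (i, j, ⟨t + 1, ht⟩))), eC (Sum.inr (Sum.inl (i, j, ⟨t + 1, ht⟩)))) ∉ Y) :=
  -- LANDED (seat c9, wave 3, p158261).
  Summit.ValiantsHypothesis.ValiantsHypothesis.Theorems.DivisionGapPerDivisionHard.stub_greedyRows

/-- **stub_splitFlow (v14; LANDED p158180).  SPLITS DETECT CIRCULATIONS:** the `Y`-column-sums of a nonzero circulation
of a split placement are nonzero on `≥ k-1` columns, none padding; details in the landed file. [folklore] -/
theorem stub_splitFlow :
    ∀ (b k m n : ℕ) (eR eC : BlockV b k m ≃ Fin n) (Y : Finset (Fin n × Fin n)) (D : Fin n × Fin n → ℤ), 0 < k →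
      (∀ e, D e ≠ 0 → e ∈ placedBlock eR eC) → (∀ r, ∑ c, D (r, c) = 0) → (∀ c, ∑ r, D (r, c) = 0) →
      (∀ (i j : Fin b) (t : ℕ) (ht : t + 1 < k),
          ((eR (Sum.inr (Sum.inl (i, j, ⟨t, Nat.lt_of_succ_lt ht⟩))), eC (Sum.inr (Sum.inl (i, j, ⟨t + 1, ht⟩)))) ∈ Y ↔
            (eR (Sum.inr (Sum.inl (i, j, ⟨t + 1, ht⟩))), eC (Sum.inr (Sum.inl (i, j, ⟨t + 1, ht⟩)))) ∉ Y)) →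
      (∃ e, D e ≠ 0) →
      k - 1 ≤ (Finset.univ.filter fun c : Fin n =>
          ∑ r ∈ Finset.univ.filter (fun r : Fin n => (r, c) ∈ Y), D (r, c) ≠ 0).card ∧
        ∀ (c : Fin n) (u : Fin m), ∑ r ∈ Finset.univ.filter (fun r : Fin n => (r, c) ∈ Y), D (r, c) ≠ 0 →
          eC.symm c ≠ Sum.inr (Sum.inr u) :=
  -- LANDED (seat c9, wave 3, p158180).
  Summit.ValiantsHypothesis.ValiantsHypothesis.Theorems.DivisionGapPerDivisionHard.stub_splitFlow

/-- **stub_cellContentRigid (v14; LANDED p158588 — the lead's stub; column mode).**  K2 for cofactors with few `Y`-column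
contents when `Y` has `≥ n/8` live columns: core columns by counting inside the live columns, rows greedy, generic cut,
`stub_splitFlow`; details in the landed file. [folklore] -/
theorem stub_cellContentRigid :
    ∀ c d : ℕ, ∃ n₀ : ℕ, ∀ n ≥ n₀, ∀ h : MvPolynomial (Fin n × Fin n) ℝ≥0,
      h ≠ 0 → IsTorusHomogeneous h → ∀ Y : Finset (Fin n × Fin n),
      n ≤ 8 * (Finset.univ.filter fun c : Fin n =>
          n / 64 < (Finset.univ.filter fun r : Fin n => (r, c) ∈ Y).card ∧
          n / 64 < (Finset.univ.filter fun r : Fin n => (r, c) ∉ Y).card).card →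
      (h.support.image fun (mm : (Fin n × Fin n) →₀ ℕ) (cc : Fin n) =>
          ∑ r ∈ Finset.univ.filter (fun r : Fin n => (r, cc) ∈ Y), mm (r, cc)).card ≤ 2 ^ ((Nat.log 2 n + c) ^ c) →
      ∃ (b k m : ℕ) (eR eC : BlockV b k m ≃ Fin n) (w : Fin n × Fin n → ℕ)
        (u : (Fin n × Fin n) →₀ ℕ),
        (Nat.log 2 n + d) ^ d ≤ b ∧ CutsOut w (placedBlock eR eC) ∧
          HasSingleGPart (placedBlock eR eC) w h u :=
  -- LANDED (seat c9, lead, p158588).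
  Summit.ValiantsHypothesis.ValiantsHypothesis.Theorems.DivisionGapPerDivisionHard.stub_cellContentRigid

-- (v15 compression) `perDivisionHard_cellContentCol_of` — LANDED as Theorems/DivisionGapPerDivisionHardCellContent.lean (p159174, `perDivisionHard_cellContentCol`);
-- in-skeleton proof: git history (≤ v14.2).

-- (v15 compression) `perDivisionHard_cellContent_of` — LANDED as Theorems/DivisionGapPerDivisionHardCellContent.lean (p159174, `perDivisionHard_cellContent`);
-- in-skeleton proof: git history (≤ v14.2).

/-! ### v15 (lead seat c10, prover-line-stmt-ValiantsHypothesis-5065-c10-0, 2026-08-17): RIGID CELLS —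
the ROOK-CONSTANT rung and the LEX-TOP transfer (ALL stubs LANDED; prose in the rung files
`Theorems/DivisionGapPerDivisionHardRookConstant.lean`, `…LexTop.lean` and dossier v11)

(A) ROOK-CONSTANT: monomials of `h` agreeing on `≥ (log₂ n+d)^d` cells in ROOK position (e.g. on any `2n(log₂ n+d)^d` cells,
`stub_greedyRooks`) ⇒ crux inequality: the `b²` doubly-internal cells of `G(b,1) ⊕ M₀` sit on the rooks
(`exists_placement_on_rooks`), the generic cut's fibre agrees off the face and on the rooks, and row / column sums force one
monomial (`stub_midRigid`, `stub_rookRigid`) — local, no girth, `k = 1`.  Residual: the constant cells of an undecided cofactor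
are covered by polylog many lines.
(B) LEX-TOP: `per_n` is homogeneous for every torus character `α_i + β_j` (`stub_topTransfer`), so `|supp top_w h| ≤ 2^{(log₂ n+c)^c}`
for SOME character decides `h`; instances: `ΣΠ` over uniquely-topped factors (`stub_uniqueTopSum`) — every `ΣΠΣ` cofactor of
top fan-in `≤ 2^{(log₂ n+c)^c}` (`stub_linearUniqueTop`) and every such sum of products of row-local and column-local polynomials
(`stub_localUniqueTop`), dense classes separated by no single balanced partition. -/

/-- **stub_greedyRooks (v15; LANDED p163534).**  A cell set with `≥ 2nN` cells (`N ≤ n`) contains `N` rooks (greedy). [folklore] -/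
theorem stub_greedyRooks :
    ∀ (n N : ℕ) (Z : Finset (Fin n × Fin n)), N ≤ n → 2 * n * N ≤ Z.card →
      ∃ P : Finset (Fin n × Fin n), P ⊆ Z ∧ P.card = N ∧
        Set.InjOn Prod.fst (P : Set (Fin n × Fin n)) ∧ Set.InjOn Prod.snd (P : Set (Fin n × Fin n)) :=
  -- LANDED (seat c10, p163534 (wave 1)).
  Summit.ValiantsHypothesis.ValiantsHypothesis.Theorems.DivisionGapPerDivisionHard.stub_greedyRooks

/-- **stub_midRigid (v15; LANDED p163551).**  Local rigidity of `G(b,1) ⊕ M₀`: equal margins + agreement off the face and on the doubly-internal cells ⇒ equal (circulation API). [folklore] -/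
theorem stub_midRigid :
    ∀ (b m n : ℕ) (eR eC : BlockV b 1 m ≃ Fin n) (m₁ m₂ : (Fin n × Fin n) →₀ ℕ),
      (∀ e ∉ placedBlock eR eC, m₁ e = m₂ e) →
      rowDegrees m₁ = rowDegrees m₂ → Finsupp.mapDomain Prod.snd m₁ = Finsupp.mapDomain Prod.snd m₂ →
      (∀ i j : Fin b, m₁ (eR (Sum.inr (Sum.inl (i, j, 0))), eC (Sum.inr (Sum.inl (i, j, 0)))) =
        m₂ (eR (Sum.inr (Sum.inl (i, j, 0))), eC (Sum.inr (Sum.inl (i, j, 0))))) →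
      m₁ = m₂ :=
  -- LANDED (seat c10, p163551 (wave 1)).
  Summit.ValiantsHypothesis.ValiantsHypothesis.Theorems.DivisionGapPerDivisionHard.stub_midRigid

/-- **stub_rookRigid (v15; LANDED p164436 — the lead's stub).**  K2 for cofactors constant on `b²` rooks: rooks as doubly-internal cells, generic cut, `stub_midRigid`. [folklore] -/
theorem stub_rookRigid :
    ∀ d : ℕ, ∃ n₀ : ℕ, ∀ n ≥ n₀, ∀ h : MvPolynomial (Fin n × Fin n) ℝ≥0,
      h ≠ 0 → IsTorusHomogeneous h → ∀ P : Finset (Fin n × Fin n),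
      (Nat.log 2 n + d) ^ d * (Nat.log 2 n + d) ^ d ≤ P.card →
      Set.InjOn Prod.fst (P : Set (Fin n × Fin n)) → Set.InjOn Prod.snd (P : Set (Fin n × Fin n)) →
      (∀ m₁ ∈ h.support, ∀ m₂ ∈ h.support, ∀ e ∈ P, m₁ e = m₂ e) →
      ∃ (b k m : ℕ) (eR eC : BlockV b k m ≃ Fin n) (w : Fin n × Fin n → ℕ)
        (u : (Fin n × Fin n) →₀ ℕ),
        (Nat.log 2 n + d) ^ d ≤ b ∧ CutsOut w (placedBlock eR eC) ∧
          HasSingleGPart (placedBlock eR eC) w h u :=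
  -- LANDED (seat c10, p164436 (lead)).
  Summit.ValiantsHypothesis.ValiantsHypothesis.Theorems.DivisionGapPerDivisionHard.stub_rookRigid

-- (v15.2 compression) `perDivisionHard_rookConstant_of` — LANDED as Theorems/DivisionGapPerDivisionHardRookConstant.lean (p165844, `perDivisionHard_rookConstant`);
-- in-skeleton proof: git history (v15.0–v15.1).

-- (v15.2 compression) `perDivisionHard_cellsConstant_of` — LANDED as Theorems/DivisionGapPerDivisionHardRookConstant.lean (p165844, `perDivisionHard_cellsConstant`);
-- in-skeleton proof: git history (v15.0–v15.1).

-- (v15.2 compression) `perDivisionHard_cellsAvoided_of` — LANDED as Theorems/DivisionGapPerDivisionHardRookConstant.lean (p165844, `perDivisionHard_cellsAvoided`);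
-- in-skeleton proof: git history (v15.0–v15.1).

/-- **stub_topTransfer (v15; LANDED p163556).**  `per_n` is homogeneous for every torus character `α_i + β_j`, so `top_w` is free on both sides of the pair. [folklore] -/
theorem stub_topTransfer :
    ∀ (n : ℕ) (α β : Fin n → ℕ) (h : MvPolynomial (Fin n × Fin n) ℝ≥0),
      complexity (perPoly (Fin n) ℝ≥0 * topComponent (fun e : Fin n × Fin n => α e.1 + β e.2) h) ≤
          complexity (perPoly (Fin n) ℝ≥0 * h) ∧
        complexity (topComponent (fun e : Fin n × Fin n => α e.1 + β e.2) h) ≤ complexity h :=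
  -- LANDED (seat c10, p163556 (wave 1)).
  Summit.ValiantsHypothesis.ValiantsHypothesis.Theorems.DivisionGapPerDivisionHard.stub_topTransfer

-- (v15.2 compression) `perDivisionHard_topSparse_of` — LANDED as Theorems/DivisionGapPerDivisionHardLexTop.lean (p164520, `perDivisionHard_topSparse`);
-- in-skeleton proof: git history (v15.0–v15.1).

/-- **stub_uniqueTopSum (v15; LANDED p163842).**  Factors topped by `≤ 1` monomial ⇒ `top_w (Σ_{t∈T} a_t Π F t i)` has `≤ |T|` monomials. [folklore] -/
theorem stub_uniqueTopSum :
    ∀ (n : ℕ) (ι κ : Type) (T : Finset κ) (I : κ → Finset ι)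
      (F : κ → ι → MvPolynomial (Fin n × Fin n) ℝ≥0) (a : κ → ℝ≥0) (w : Fin n × Fin n → ℕ),
      (∀ t ∈ T, ∀ i ∈ I t, (topComponent w (F t i)).support.card ≤ 1) →
      (topComponent w (∑ t ∈ T, a t • ∏ i ∈ I t, F t i)).support.card ≤ T.card :=
  -- LANDED (seat c10, p163842 (wave 1)).
  Summit.ValiantsHypothesis.ValiantsHypothesis.Theorems.DivisionGapPerDivisionHard.stub_uniqueTopSum

-- (v15.2 compression) `perDivisionHard_uniqueTopSum_of` — LANDED as Theorems/DivisionGapPerDivisionHardLexTop.lean (p164520, `perDivisionHard_uniqueTopSum`);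
-- in-skeleton proof: git history (v15.0–v15.1).

/-- **stub_linearUniqueTop (v15; LANDED p163715).**  The injective positive character `i·n + 1 + j` tops an affine linear form by one monomial. [folklore] -/
theorem stub_linearUniqueTop :
    ∀ (n : ℕ) (l : MvPolynomial (Fin n × Fin n) ℝ≥0), l.totalDegree ≤ 1 →
      (topComponent (fun e : Fin n × Fin n => ((e.1 : ℕ) * n + 1) + (e.2 : ℕ)) l).support.card ≤ 1 :=
  -- LANDED (seat c10, p163715 (wave 1)).
  Summit.ValiantsHypothesis.ValiantsHypothesis.Theorems.DivisionGapPerDivisionHard.stub_linearUniqueTop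

-- (v15.2 compression) `perDivisionHard_sigmaPiSigma_of` — LANDED as Theorems/DivisionGapPerDivisionHardLexTop.lean (p164520, `perDivisionHard_sigmaPiSigma`);
-- in-skeleton proof: git history (v15.0–v15.1).

/-- **stub_localUniqueTop (v15; LANDED p163746).**  The two-scale digit character `(D+1)^i + (D+1)^{n+j}` tops a row-local or column-local polynomial of degree `≤ D` by one monomial. [folklore] -/
theorem stub_localUniqueTop :
    ∀ (n D : ℕ) (f : MvPolynomial (Fin n × Fin n) ℝ≥0), f.totalDegree ≤ D →
      ((∃ r : Fin n, ∀ m ∈ f.support, ∀ e ∈ m.support, e.1 = r) ∨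
        (∃ s : Fin n, ∀ m ∈ f.support, ∀ e ∈ m.support, e.2 = s)) →
      (topComponent (fun e : Fin n × Fin n => (D + 1) ^ (e.1 : ℕ) + (D + 1) ^ (n + (e.2 : ℕ))) f).support.card
        ≤ 1 :=
  -- LANDED (seat c10, p163746 (wave 1)).
  Summit.ValiantsHypothesis.ValiantsHypothesis.Theorems.DivisionGapPerDivisionHard.stub_localUniqueTop

-- (v15.2 compression) `perDivisionHard_localSigmaPi_of` — LANDED as Theorems/DivisionGapPerDivisionHardLexTop.lean (p164520, `perDivisionHard_localSigmaPi`);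
-- in-skeleton proof: git history (v15.0–v15.1).


/-! ### v15.1 (lead seat c10, cycle 2): KEYS and CODES — two more RIGID-CELLS rungs

(C) KEY rung.  A set `K` of cells is a KEY for `h` if the monomials of `h` are determined by their exponents on `K`.
If `h` has a key of size `≤ n/4` then `2^{(log₂ n+c)^c} < L(per_n·h) + L(h)` (`perDivisionHard_key_of`): place
`G(b,1) ⊕ M₀` AVOIDING `K` (`stub_keyPlacement`: active rows / columns off the rows / columns of `K`, padding matching
avoiding the `≤ |K|` cells of `K` by Hall — a padding row or column loses at most `|K| ≤ m/2` partners), take the generic cut: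
two fibre monomials agree off the face, hence on `K`, hence are equal (`stub_keyRigid`).  Corollary
(`perDivisionHard_fewGenerators_of`, via the linear algebra of `stub_keyOfSpan`: a `ℤ`-span of `q` exponent vectors is read
off `q` cells): a cofactor supported on the monoid generated by `q ≤ n/4` exponent vectors — ANY nonzero polynomial
`F(x^{v_1}, …, x^{v_q})`, of any degree and density — never helps.  (Incomparable with the sparse rung: `Σ_e x_e` has no small key;
`F` may have `2^{poly}` monomials.)
(D) CODE rung.  If any two distinct monomials of `h` with equal margins differ in more than `n + 2(log₂ n+d)^d` cells, then the crux
inequality holds (`perDivisionHard_minDistance_of`; `stub_farRigid`: ANY placement — two distinct fibre monomials would differ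
only inside the face, which has `n + 2b² - b` cells).  Residual gain of (C)+(D): an undecided cofactor has two equal-margin
monomials at Hamming distance `≤ n + polylog²`, and no `n/4` cells determine its monomials. -/

/-- **stub_keyPlacement (v15.1; LANDED p165503).**  If `2|K| + 2(b + b²) ≤ n`, some placement of `G(b,1) ⊕ M₀` has its face off `K` (active lines off the lines of `K`; padding matching avoiding `K` by Hall). [folklore] -/
theorem stub_keyPlacement :
    ∀ (b n : ℕ) (K : Finset (Fin n × Fin n)), 2 * K.card + 2 * (b + b * (b * 1)) ≤ n →
      ∃ eR eC : BlockV b 1 (n - (b + b * (b * 1))) ≃ Fin n, ∀ e ∈ placedBlock eR eC, e ∉ K :=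
  -- LANDED (seat c10, p165503 (wave 2)).
  Summit.ValiantsHypothesis.ValiantsHypothesis.Theorems.DivisionGapPerDivisionHard.stub_keyPlacement

/-- **stub_keyRigid (v15.1; LANDED p166107 — the lead's stub).**  A key `K` with `4|K| ≤ n` ⇒ one-monomial fibre off `K` (`stub_keyPlacement` + generic cut). [folklore] -/
theorem stub_keyRigid :
    ∀ d : ℕ, ∃ n₀ : ℕ, ∀ n ≥ n₀, ∀ h : MvPolynomial (Fin n × Fin n) ℝ≥0,
      h ≠ 0 → IsTorusHomogeneous h → ∀ K : Finset (Fin n × Fin n), 4 * K.card ≤ n →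
      (∀ m₁ ∈ h.support, ∀ m₂ ∈ h.support, (∀ e ∈ K, m₁ e = m₂ e) → m₁ = m₂) →
      ∃ (b k m : ℕ) (eR eC : BlockV b k m ≃ Fin n) (w : Fin n × Fin n → ℕ)
        (u : (Fin n × Fin n) →₀ ℕ),
        (Nat.log 2 n + d) ^ d ≤ b ∧ CutsOut w (placedBlock eR eC) ∧
          HasSingleGPart (placedBlock eR eC) w h u :=
  -- LANDED (seat c10, p166107 (lead)).
  Summit.ValiantsHypothesis.ValiantsHypothesis.Theorems.DivisionGapPerDivisionHard.stub_keyRigid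

-- (v15.3 compression) `perDivisionHard_key_of` — LANDED as Theorems/DivisionGapPerDivisionHardKeys.lean (p167134, `perDivisionHard_key`);
-- in-skeleton proof: git history (v15.1–v15.2).

/-- **stub_keyOfSpan (v15.1; LANDED p165196).**  Differences in the `ℤ`-span of `q` matrices ⇒ a key of `≤ q` cells (linear algebra over `ℚ`). [folklore] -/
theorem stub_keyOfSpan :
    ∀ (n q : ℕ) (v : Fin q → (Fin n × Fin n) → ℤ) (S : Finset ((Fin n × Fin n) →₀ ℕ)),
      (∀ m₁ ∈ S, ∀ m₂ ∈ S, ∃ a : Fin q → ℤ, ∀ e, (m₁ e : ℤ) - m₂ e = ∑ s, a s * v s e) →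
      ∃ K : Finset (Fin n × Fin n), K.card ≤ q ∧
        ∀ m₁ ∈ S, ∀ m₂ ∈ S, (∀ e ∈ K, m₁ e = m₂ e) → m₁ = m₂ :=
  -- LANDED (seat c10, p165196 (wave 2)).
  Summit.ValiantsHypothesis.ValiantsHypothesis.Theorems.DivisionGapPerDivisionHard.stub_keyOfSpan

-- (v15.3 compression) `perDivisionHard_fewGenerators_of` — LANDED as Theorems/DivisionGapPerDivisionHardKeys.lean (p167134, `perDivisionHard_fewGenerators`);
-- in-skeleton proof: git history (v15.1–v15.2).

/-- **stub_farRigid (v15.1; LANDED p165323).**  Minimum distance `> n + 2b²` ⇒ one-monomial fibre at any placement (`card_placedBlock_le`). [folklore] -/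
theorem stub_farRigid :
    ∀ d : ℕ, ∃ n₀ : ℕ, ∀ n ≥ n₀, ∀ h : MvPolynomial (Fin n × Fin n) ℝ≥0,
      h ≠ 0 → IsTorusHomogeneous h →
      (∀ m₁ ∈ h.support, ∀ m₂ ∈ h.support, m₁ ≠ m₂ →
        n + 2 * ((Nat.log 2 n + d) ^ d * (Nat.log 2 n + d) ^ d) <
          (Finset.univ.filter fun e : Fin n × Fin n => m₁ e ≠ m₂ e).card) →
      ∃ (b k m : ℕ) (eR eC : BlockV b k m ≃ Fin n) (w : Fin n × Fin n → ℕ)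
        (u : (Fin n × Fin n) →₀ ℕ),
        (Nat.log 2 n + d) ^ d ≤ b ∧ CutsOut w (placedBlock eR eC) ∧
          HasSingleGPart (placedBlock eR eC) w h u :=
  -- LANDED (seat c10, p165323 (wave 2)).
  Summit.ValiantsHypothesis.ValiantsHypothesis.Theorems.DivisionGapPerDivisionHard.stub_farRigid

-- (v15.3 compression) `perDivisionHard_minDistance_of` — LANDED as Theorems/DivisionGapPerDivisionHardKeys.lean (p167134, `perDivisionHard_minDistance`);
-- in-skeleton proof: git history (v15.1–v15.2).


/-! ### v15.2 (lead seat c10, cycle 3): ISOLATION — magnets as a class (dossier v11 §5)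

The generic cut is `W` on the face and `W - B^{rank e}` off it, so its top fibre consists of the monomials whose off-face exponent
vector is LEXICOGRAPHICALLY MINIMAL in rank order — and the rank order is the prover's choice.  `m* ∈ supp h` is ISOLATED by
cells `e₀, …, e_{t-1}` if every other monomial of `h` is lexicographically larger along `(e₀, …, e_{t-1})`.  RUNG
(`perDivisionHard_isolation_of`): if all monomials of `h ≠ 0` have one degree and some monomial is isolated by `t ≤ n/4` cells, then
`2^{(log₂ n+c)^c} < L(per_n·h) + L(h)`; for general `h` apply it to the top-degree part (`perDivisionHard_isolationTop_of`, free by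
`stub_topTransfer` with the constant character).  Mechanism: face off `{e_i}` (`stub_keyPlacement`), ORDERED generic cut with the
`e_i` at the top ranks (`stub_orderedCut`: fibre monomials are lex-≤ every monomial of `h` along `e`), so the fibre is `{m*}`
(`stub_isolationRigid`).  No torus homogeneity.  Contains JSS (`t = 0`), the key rung (any order on a key isolates), and with ONE
cell the free-default adversary `h_bal` (minimising the exponent of `(ρ₀, j₁)` forces the constant choice `f ≡ j₁`). -/

/-- **stub_orderedCut (v15.2; LANDED p167041).**  The generic cut with a PRESCRIBED priority list: cuts out the face, fibre agrees off the face and is lexicographically ≤ every monomial of `h` along the list. [folklore] -/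
theorem stub_orderedCut :
    ∀ (b k m n t : ℕ) (eR eC : BlockV b k m ≃ Fin n) (e : Fin t → Fin n × Fin n)
      (h : MvPolynomial (Fin n × Fin n) ℝ≥0),
      0 < k → Function.Injective e → (∀ i, e i ∉ placedBlock eR eC) →
      (∀ m₁ ∈ h.support, ∀ m₂ ∈ h.support, m₁.degree = m₂.degree) →
      ∃ w : Fin n × Fin n → ℕ, CutsOut w (placedBlock eR eC) ∧
        (∀ m₁ ∈ (topComponent w h).support, ∀ m₂ ∈ (topComponent w h).support,
          ∀ f ∉ placedBlock eR eC, m₁ f = m₂ f) ∧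
        ∀ m₁ ∈ (topComponent w h).support, ∀ m₂ ∈ h.support, ∀ i : Fin t,
          (∀ j : Fin t, j < i → m₁ (e j) = m₂ (e j)) → m₁ (e i) ≤ m₂ (e i) :=
  -- LANDED (seat c10, p167041 (wave 3)).
  Summit.ValiantsHypothesis.ValiantsHypothesis.Theorems.DivisionGapPerDivisionHard.stub_orderedCut

/-- **stub_isolationRigid (v15.2; LANDED p167240 — the lead's stub).**  An isolated monomial (strict lex-min along `≤ n/4` cells) ⇒ fibre `{m*}` (`stub_keyPlacement` + `stub_orderedCut`). [folklore] -/
theorem stub_isolationRigid :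
    ∀ d : ℕ, ∃ n₀ : ℕ, ∀ n ≥ n₀, ∀ h : MvPolynomial (Fin n × Fin n) ℝ≥0, h ≠ 0 →
      (∀ m₁ ∈ h.support, ∀ m₂ ∈ h.support, m₁.degree = m₂.degree) →
      ∀ (t : ℕ) (e : Fin t → Fin n × Fin n), Function.Injective e → 4 * t ≤ n →
      ∀ ms ∈ h.support,
      (∀ m' ∈ h.support, m' ≠ ms →
        ∃ i : Fin t, (∀ j : Fin t, j < i → m' (e j) = ms (e j)) ∧ ms (e i) < m' (e i)) →
      ∃ (b k m : ℕ) (eR eC : BlockV b k m ≃ Fin n) (w : Fin n × Fin n → ℕ)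
        (u : (Fin n × Fin n) →₀ ℕ),
        (Nat.log 2 n + d) ^ d ≤ b ∧ CutsOut w (placedBlock eR eC) ∧
          HasSingleGPart (placedBlock eR eC) w h u :=
  -- LANDED (seat c10, p167240 (lead)).
  Summit.ValiantsHypothesis.ValiantsHypothesis.Theorems.DivisionGapPerDivisionHard.stub_isolationRigid

-- (v15.5 compression) `perDivisionHard_isolation_of` — LANDED as Theorems/DivisionGapPerDivisionHardIsolation.lean (p168179, `perDivisionHard_isolation`);
-- in-skeleton proof: git history (v15.2–v15.4).

-- (v15.5 compression) `perDivisionHard_isolationTop_of` — LANDED as Theorems/DivisionGapPerDivisionHardIsolation.lean (p168179, `perDivisionHard_isolationTop`);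
-- in-skeleton proof: git history (v15.2–v15.4).


/-! ### v15.3 (lead seat c10, cycle 4): EXPOSED POINTS — priced isolation (dossier v11 §5b)

The priced cut of v12.3 (`stub_pricedCut`, no lures) makes the top fibre the set of minimisers of ANY positive price functional off
the face.  RUNG (`perDivisionHard_exposed_of`): if all monomials of `h ≠ 0` have one degree and for some cell set `K` with
`4|K| ≤ n` and some prices `p ≥ 0` the functional `m ↦ Σ_{e∈K} p(e)·m(e)` has a UNIQUE minimiser on `supp h` — `m*|_K` is a
point of `proj_K(supp h)` exposed from below —, then `2^{(log₂ n+c)^c} < L(per_n·h) + L(h)`.  Mechanism: face off `K`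
(`stub_keyPlacement`), prices `1 + (D+1)·p·𝟙_K` off the face (`stub_pricedCut`): a non-minimiser of `p` loses `≥ D+1` and gains
`≤ D` from the unit baseline (`stub_exposedRigid`).  This is the small-support form of STEERED K2's "vertex of the dominant"
(dossier v8 §4) and it contains the isolation rung (`stub_exposedOfIsolated`: lexicographic prices `B^{t-1-i}`) and the key rung. -/

/-- **stub_exposedRigid (v15.3; LANDED p167785 — the lead's stub).**  A unique minimiser of a price functional supported on `≤ n/4` cells ⇒ one-monomial fibre (`stub_keyPlacement` + `stub_pricedCut`, prices `1 + (D+1)·p·𝟙_K`). [folklore] -/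
theorem stub_exposedRigid :
    ∀ d : ℕ, ∃ n₀ : ℕ, ∀ n ≥ n₀, ∀ h : MvPolynomial (Fin n × Fin n) ℝ≥0, h ≠ 0 →
      (∀ m₁ ∈ h.support, ∀ m₂ ∈ h.support, m₁.degree = m₂.degree) →
      ∀ (K : Finset (Fin n × Fin n)) (p : Fin n × Fin n → ℕ), 4 * K.card ≤ n →
      ∀ ms ∈ h.support,
      (∀ m' ∈ h.support, m' ≠ ms → ∑ e ∈ K, p e * ms e < ∑ e ∈ K, p e * m' e) →
      ∃ (b k m : ℕ) (eR eC : BlockV b k m ≃ Fin n) (w : Fin n × Fin n → ℕ)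
        (u : (Fin n × Fin n) →₀ ℕ),
        (Nat.log 2 n + d) ^ d ≤ b ∧ CutsOut w (placedBlock eR eC) ∧
          HasSingleGPart (placedBlock eR eC) w h u :=
  -- LANDED (seat c10, p167785 (lead)).
  Summit.ValiantsHypothesis.ValiantsHypothesis.Theorems.DivisionGapPerDivisionHard.stub_exposedRigid

/-- **stub_exposedOfIsolated (v15.3; LANDED p167735).**  Lexicographic isolation is exposure by the lexicographic prices `B^{t-1-i}`. [folklore] -/
theorem stub_exposedOfIsolated :
    ∀ (n t : ℕ) (e : Fin t → Fin n × Fin n) (S : Finset ((Fin n × Fin n) →₀ ℕ)) (ms : (Fin n × Fin n) →₀ ℕ),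
      Function.Injective e → ms ∈ S →
      (∀ m' ∈ S, m' ≠ ms → ∃ i : Fin t, (∀ j : Fin t, j < i → m' (e j) = ms (e j)) ∧ ms (e i) < m' (e i)) →
      ∃ p : Fin n × Fin n → ℕ, ∀ m' ∈ S, m' ≠ ms →
        ∑ f ∈ Finset.univ.image e, p f * ms f < ∑ f ∈ Finset.univ.image e, p f * m' f :=
  -- LANDED (seat c10, p167735 (wave 4)).
  Summit.ValiantsHypothesis.ValiantsHypothesis.Theorems.DivisionGapPerDivisionHard.stub_exposedOfIsolated

/-- **The EXPOSED-POINT rung (v15.3 composition; sorry-free modulo `stub_exposedRigid`).**  For every `c` there is `n₀` such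
that for all `n ≥ n₀` and every nonzero `h` all of whose monomials have the same degree: if some nonnegative price functional
supported on a cell set `K` with `4|K| ≤ n` has a unique minimiser on `supp h`, then `2^{(log₂ n+c)^c} < L(per_n·h) + L(h)`.
Contains the isolation rung (lexicographic prices, `stub_exposedOfIsolated`) and the key rung. [folklore] -/
theorem perDivisionHard_exposed_of :
    ∀ c : ℕ, ∃ n₀ : ℕ, ∀ n ≥ n₀, ∀ h : MvPolynomial (Fin n × Fin n) ℝ≥0, h ≠ 0 →
      (∀ m₁ ∈ h.support, ∀ m₂ ∈ h.support, m₁.degree = m₂.degree) →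
      ∀ (K : Finset (Fin n × Fin n)) (p : Fin n × Fin n → ℕ), 4 * K.card ≤ n →
      ∀ ms ∈ h.support,
      (∀ m' ∈ h.support, m' ≠ ms → ∑ e ∈ K, p e * ms e < ∑ e ∈ K, p e * m' e) →
      2 ^ ((Nat.log 2 n + c) ^ c) < complexity (perPoly (Fin n) ℝ≥0 * h) + complexity h := by
  intro c
  obtain ⟨κ, hcon⟩ := stub_jssContraction
  obtain ⟨d, n₁, hhard⟩ := stub_blockArsenal c κ
  obtain ⟨n₀, hS⟩ := stub_exposedRigid d
  refine ⟨n₀ + n₁, ?_⟩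
  intro n hn h hh hdeg K p hK ms hms hexp
  by_contra hlt
  have hle : complexity (perPoly (Fin n) ℝ≥0 * h) + complexity h ≤
      2 ^ ((Nat.log 2 n + c) ^ c) := not_lt.mp hlt
  obtain ⟨b, k, m, eR, eC, w, u, hb, hcut, hsingle⟩ := hS n (by omega) h hh hdeg K p hK ms hms hexp
  have hdesc := stub_faceDescent n (placedBlock eR eC) w h u hcut hh hsingle
  have h1 : complexity (monomial u (1 : ℝ≥0) * facePer (placedBlock eR eC)) ≤
      2 ^ ((Nat.log 2 n + c) ^ c) + 1 :=
    calc complexity (monomial u (1 : ℝ≥0) * facePer (placedBlock eR eC))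
        ≤ complexity (perPoly (Fin n) ℝ≥0 * h) + 1 := hdesc
      _ ≤ 2 ^ ((Nat.log 2 n + c) ^ c) + 1 :=
          Nat.add_le_add_right (le_trans (Nat.le_add_right _ _) hle) 1
  have h2 : complexity (facePer (placedBlock eR eC)) ≤
      ((n + 2) * (2 ^ ((Nat.log 2 n + c) ^ c) + 3)) ^ κ :=
    calc complexity (facePer (placedBlock eR eC))
        ≤ ((n + 2) * (complexity (monomial u (1 : ℝ≥0) * facePer (placedBlock eR eC)) + 2)) ^ κ :=
          hcon n (facePer (placedBlock eR eC)) u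
      _ ≤ ((n + 2) * (2 ^ ((Nat.log 2 n + c) ^ c) + 3)) ^ κ :=
          Nat.pow_le_pow_left (Nat.mul_le_mul_left _ (by omega)) κ
  have h3 := hhard n (by omega) b k m eR eC hb
  exact absurd (lt_of_lt_of_le h3 h2) (lt_irrefl _)

/-- **Isolation is exposure (v15.3 composition; sorry-free modulo `stub_exposedRigid`, `stub_exposedOfIsolated`):** the
one-degree isolation rung re-derived from the exposed-point rung. [folklore] -/
theorem perDivisionHard_isolation_of_exposed :
    ∀ c : ℕ, ∃ n₀ : ℕ, ∀ n ≥ n₀, ∀ h : MvPolynomial (Fin n × Fin n) ℝ≥0, h ≠ 0 →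
      (∀ m₁ ∈ h.support, ∀ m₂ ∈ h.support, m₁.degree = m₂.degree) →
      ∀ (t : ℕ) (e : Fin t → Fin n × Fin n), Function.Injective e → 4 * t ≤ n →
      ∀ ms ∈ h.support,
      (∀ m' ∈ h.support, m' ≠ ms →
        ∃ i : Fin t, (∀ j : Fin t, j < i → m' (e j) = ms (e j)) ∧ ms (e i) < m' (e i)) →
      2 ^ ((Nat.log 2 n + c) ^ c) < complexity (perPoly (Fin n) ℝ≥0 * h) + complexity h := by
  intro c
  obtain ⟨n₀, hE⟩ := perDivisionHard_exposed_of c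
  refine ⟨n₀, fun n hn h hh hdeg t e he ht ms hms hiso => ?_⟩
  classical
  obtain ⟨p, hp⟩ := stub_exposedOfIsolated n t e h.support ms he hms hiso
  refine hE n hn h hh hdeg (Finset.univ.image e) p ?_ ms hms hp
  exact le_trans (Nat.mul_le_mul_left 4 (Finset.card_image_le.trans (by simp))) ht


end Summit.ValiantsHypothesis.ValiantsHypothesis.Cruxes.PerDivisionHard.PairDescentJssEndpoint

end
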